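import Literature.NumberTheory.LFunctions.SonineExtendedMellinContinuation
import Literature.NumberTheory.LFunctions.BurnolSonineChainDensityProofs
import Literature.NumberTheory.LFunctions.BurnolZetaSystemsHardy
import Literature.NumberTheory.LFunctions.BurnolSonineFourier
import Literature.NumberTheory.LFunctions.BurnolSonineHardy
import Literature.Analysis.FunctionSpaces.PlancherelL1L2
import HarnessLib

/-!
# Burnol 2004b, Prop. 4.3: division by `s − w` in the Sonine spaces `K_a ⊂ L_a`

LINE 1 — LABEL: RH-FREE (Hilbert-space / Mellin analysis of even `L²` functions constant on `(−a,a)`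
together with their cosine transform; the Riemann zeta function does not occur). FRAMING (cell rh-crit,
D-0074): corpus theorems are RH-FREE literature; nothing here is worded as progress toward RH. bears_on:
B-C/B-P (LADDER-RH COLUMN 6, de Branges framework). WHAT THIS IS NOT: not a route, not a criterion, no
positivity is asserted; discharging an as-printed structural proposition of an RH-criterion corpus moves
RH by nothing. Nothing here bears on the truth of RH.

Source: J.-F. Burnol, *Two complete and minimal systems associated with the zeros of the Riemann zeta
function*, J. Théor. Nombres Bordeaux 16 (2004) 65–94 = arXiv:math/0203120v7, Prop. 4.3 (p. 8, TeX
l.711–731 of the TeX of record): "If `G(s)` belongs to `L̂_a` and `s(s−1)π^{−s/2}Γ(s/2)G(s)` vanishes at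
`s = w` then `G(s)/(s−w)` again belongs to `L̂_a`. If `G(s)` belongs to `K̂_a` and `π^{−s/2}Γ(s/2)G(s)`
vanishes at `s = w` then `G(s)/(s−w)` again belongs to `K̂_a`." Typed as `Burnol2004b_prop4_3R`
(`BurnolZetaSystemsHardy.lean`). The printed proof is one line over the Hardy-space characterisation of
`L̂_a` (Prop. 4.1, Paley–Wiener); DEVIATION (no `ℍ²` in the tree): the witnesses are written down on the
`t`-side — for `Re w < ½` the TWISTED CESÀRO AVERAGE `(Q_w f)(t) = ∫₀¹ v^{−w} f(vt) dv`, for `Re w > ½`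
the TWISTED TAIL AVERAGE `(R_w f)(t) = −∫₁^∞ v^{−w} f(vt) dv` (both `L²`-bounded by a Schur /
weighted-Hardy estimate), whose right Mellin transforms are `f̂(s)/(s−w)` (Fubini) and whose membership
in `L_a` / `K_a` consumes exactly the printed vanishing hypothesis: on the support side for `R_w`
(`G_f(w) = 0` through the explicit continuation `G_f(s) = c·a^{1−s}/(1−s) + ∫_a^∞ u^{−s}f`), on the
Fourier side for `Q_w` (duality `⟨𝓕⁻¹α, Q_w f⟩ = ∫ ᾱ Ψ`, dilation law `𝓕(f(v·)) = v⁻¹(𝓕f)(·/v)`,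
`Ψ ≡ const` iff `G_{𝓕f}(1−w) = 0`, which is `G_f(w) = 0` through the functional equation of Prop. 2.2);
for `½ < Re w < 1` the witness is obtained from the `Re w < ½` case applied to `𝓕f` at `1 − w` and
transformed back (functional equations). This file proves BOTH clauses for every `w` OFF THE CRITICAL
LINE (`Re w ≠ ½`): `SonineDivision.sonineK_div_of_re_ne_half`, `SonineDivision.sonineL_div_of_re_ne_half'`
(the point `w = 0` of the `L_a` clause through `c' = 2·G_f(0)`,
`SonineDivision.fourierConst_eq_two_mul_rightMellinExt_zero`), and then ON THE CRITICAL LINE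
`Re w = ½` (section R), where neither operator is `L²`-bounded: there `Q_w f` is obtained as the
`L²`-LIMIT of `Q_{w−δ}f`, `δ ↓ 0` — a Cauchy family by the Mellin–Plancherel identity on the vertical
lines `Re s = 1 − σ`, `σ ↑ ½` (near `w` the first-order vanishing `|f̂(s)| ≤ M|s − w|` of the
continuation controls the resolvent `1/(s − w + δ)`, away from `w` Plancherel for `f` itself; then
`σ ↑ ½` by dominated convergence) —, identified with the pointwise `Q_w f₀` (dominated convergence in
`v`, a.e. along a subsequence), and its Fourier side is obtained by passing to the limit in the duality
identity, the defect `G_{𝓕f}(1 − w + δ)·∫|ξ|^{−w+δ}ᾱ = O(δ^{1/2})` vanishing because `G_{𝓕f}` has a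
zero at `1 − w` (functional equation). This DISCHARGES the named fact: `Burnol2004b_prop4_3R_holds`
(section S).

## Main statements (namespace `Literature.NumberTheory.LFunctions.SonineDivision`)

* tools: `lintegral_enorm_sq_twisted_le` / `memLp_twisted` (Schur bound for `∫_S v^{−w}f(vt)dv`),
  `rightMellin_twisted` (`(T_S f)^(s) = (∫_S v^{s−1−w})·f̂(s)`, Fubini), `inner_fourierInv_twisted`
  (the `𝓕`-side duality for a general `S`), `psi_tail_eq` / `psi_cesaro_eq` (evaluation of `Ψ_S` on
  `[−a,a]`), `fourier_ae_eq_const_of_inner`, `rightMellinExt_eq_of_rep` (the continuation of `f̂`,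
  `f ∈ L_a`, on `Re s > ½`, `s ≠ 1`), `exists_cesaro_twisted`, `exists_tail_twisted` (the witnesses);
* `sonineK_div_of_re_lt_half`, `sonineK_div_of_half_lt_re`, `sonineK_div_of_re_ne_half` (clause `K_a`);
* `sonineL_div_of_re_lt_half` (`w ≠ 0`), `sonineL_div_of_mem_strip`, `sonineL_div_of_one_le_re`,
  `sonineL_div_of_re_ne_half` (clause `L_a`, `w ≠ 0`); `fourierConst_eq_two_mul_rightMellinExt_zero`
  (`c' = 2·G_f(0)`), `sonineL_div_zero`, `sonineL_div_of_re_ne_half'` (clause `L_a`, all `Re w ≠ ½`);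
* `exists_cesaro_twisted_of_memLp` (the Cesàro witness for any `Re w < 1` modulo the two analytic
  inputs of the critical line: `Q_w f₀ ∈ L²` and the duality identity);
* `Burnol2004b_prop4_3R_of_critical_line` (top namespace): the typed fact REDUCED to its two
  critical-line clauses (explicit hypotheses; a reduction, not a discharge);
* section R (critical line): `integral_norm_sq_mellin_cesaro_sub_le` (the line bound),
  `integral_norm_sq_cesaro_sub_le` (`‖Q_{w−δₙ}f₀ − Q_{w−δₘ}f₀‖² ≤ 2Kδₙ`), `tendsto_cesaro_pointwise`,
  `inner_fourierInv_cesaro_eq` (Fourier side of `Q_{w'}f` with the defect term),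
  `memLp_cesaro_critical` (`Q_w f₀ ∈ L²` with its duality identity, from the two analytic inputs),
  `exists_cesaro_twisted_critical`, `sonineL_div_of_re_eq_half`, `sonineK_div_of_re_eq_half`;
* `Burnol2004b_prop4_3R_holds` (top namespace, section S): the DISCHARGE of the named fact.

## References
* [Burnol2004b] J.-F. Burnol, JTNB 16 (2004) = arXiv:math/0203120v7, Prop. 4.3 (TeX l.711–731),
  Prop. 2.2 (TeX l.460–469), Lemma 4.4 (TeX l.750–758).
* [HardyLittlewoodPolya1952] G. H. Hardy, J. E. Littlewood, G. Pólya, *Inequalities*, Thm. 319 (Schur)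
  and Thm. 330 (weighted Hardy).
-/

noncomputable section

open MeasureTheory Complex Filter Set FourierTransform
open scoped Topology Real ENNReal InnerProductSpace

namespace Literature.NumberTheory.LFunctions

namespace SonineDivision

open Literature.Analysis.DeBrangesSpaces.SonineMellin
open Literature.Analysis.Fourier (inner_fourier_right memLp_comp_mul_left coeFn_toLp_comp_mul_left
  fourier_toLp_comp_mul_left measurePreserving_mul_left)

/-! ### A. Even representatives that are constant ON `[−a, a]` -/

/-- An even `L²` class equal to `c` a.e. on `(0,a)` has an everywhere even, measurable representative
equal to `c` on `[−a, a]`. [folklore] -/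
private theorem exists_even_rep_const {a : ℝ} {u : Lp ℂ 2 (volume : Measure ℝ)} (hue : u ∈ evenL2) {c : ℂ}
    (huc : ∀ᵐ x : ℝ, x ∈ Ioo 0 a → (u : ℝ → ℂ) x = c) :
    ∃ u₀ : ℝ → ℂ, Measurable u₀ ∧ (u : ℝ → ℂ) =ᵐ[volume] u₀ ∧ (∀ x, u₀ (-x) = u₀ x) ∧
      (∀ x, |x| ≤ a → u₀ x = c) ∧ MemLp u₀ 2 volume := by
  set u₀ : ℝ → ℂ := fun x ↦ (Ioi a).indicator (u : ℝ → ℂ) |x| + (Iic a).indicator (fun _ ↦ c) |x|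
    with hu₀
  have hm : Measurable u₀ :=
    ((((Lp.stronglyMeasurable u).measurable.indicator measurableSet_Ioi).comp
      continuous_abs.measurable)).add
      ((measurable_const.indicator measurableSet_Iic).comp continuous_abs.measurable)
  have hval_gt : ∀ x, a < |x| → u₀ x = (u : ℝ → ℂ) |x| := by
    intro x hx
    rw [hu₀]
    dsimp only
    rw [indicator_of_mem (mem_Ioi.2 hx), indicator_of_notMem (fun h : |x| ∈ Iic a ↦ not_le.2 hx h),
      add_zero]
  have hval_le : ∀ x, |x| ≤ a → u₀ x = c := by
    intro x hx
    rw [hu₀]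
    dsimp only
    rw [indicator_of_notMem (fun h : |x| ∈ Ioi a ↦ not_lt.2 hx h), indicator_of_mem (mem_Iic.2 hx),
      zero_add]
  have hae : (u : ℝ → ℂ) =ᵐ[volume] u₀ := by
    have hneg : Measure.QuasiMeasurePreserving (fun x : ℝ ↦ -x) volume volume :=
      (Measure.measurePreserving_neg (volume : Measure ℝ)).quasiMeasurePreserving
    have hue' : ∀ᵐ x : ℝ, (u : ℝ → ℂ) (-x) = (u : ℝ → ℂ) x := hue
    have hnull : ∀ᵐ x : ℝ, x ∉ ({-a, 0, a} : Set ℝ) :=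
      compl_mem_ae_iff.mpr ((Set.toFinite _).measure_zero volume)
    filter_upwards [hue', huc, hneg.ae huc, hnull] with x he h0 h0' hx
    simp only [mem_insert_iff, mem_singleton_iff, not_or] at hx
    by_cases hxa : a < |x|
    · rw [hval_gt x hxa]
      rcases le_or_gt 0 x with hx0 | hx0
      · rw [abs_of_nonneg hx0]
      · rw [abs_of_neg hx0, he]
    · have hne : |x| ≠ a := by
        rcases le_or_gt 0 x with h | h
        · rw [abs_of_nonneg h]; exact hx.2.2
        · rw [abs_of_neg h]; intro h'; exact hx.1 (by linarith)
      have hlt : |x| < a := lt_of_le_of_ne (not_lt.1 hxa) hne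
      rw [hval_le x hlt.le]
      rcases lt_trichotomy x 0 with hx0 | hx0 | hx0
      · rw [← he]
        refine h0' ⟨by linarith, ?_⟩
        rw [abs_of_neg hx0] at hlt
        exact hlt
      · exact absurd hx0 hx.2.1
      · rw [abs_of_pos hx0] at hlt
        exact h0 ⟨hx0, hlt⟩
  refine ⟨u₀, hm, hae, fun x ↦ ?_, hval_le, (Lp.memLp u).ae_eq hae⟩
  rw [hu₀]
  dsimp only
  rw [abs_neg]

/-! ### B. Dilation change of variables and the weighted Hardy bound for the twisted averages -/

/-- `∫⁻ G(v t) dt = v⁻¹ ∫⁻ G` for `v > 0`. [folklore] -/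
private theorem lintegral_comp_mul_left (G : ℝ → ℝ≥0∞) {v : ℝ} (hv : 0 < v) :
    ∫⁻ t, G (v * t) = ENNReal.ofReal v⁻¹ * ∫⁻ t, G t := by
  have h1 : ∫⁻ t, G (v * t) = ∫⁻ t, G t ∂(Measure.map (fun s ↦ v * s) volume) := by
    rw [show (fun s ↦ v * s) = ⇑(Homeomorph.mulLeft₀ v hv.ne').toMeasurableEquiv from rfl,
      lintegral_map_equiv]
    rfl
  rw [h1, Real.map_volume_mul_left hv.ne', lintegral_smul_measure, smul_eq_mul,
    abs_of_pos (inv_pos.2 hv)]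

/-- **Weighted Hardy bound (Schur test by Cauchy–Schwarz and Tonelli).** For a measurable `f₀`, a
measurable `S ⊆ (0,∞)`, `w ∈ ℂ` and a real parameter `p`:
`∫_ℝ ‖∫_S v^{−w} f₀(vt) dv‖² dt ≤ (∫_S v^p)(∫_S v^{−2 Re w − p − 1}) ∫_ℝ ‖f₀‖²`.
(For `S = (0,1)`, `Re w < ½` and for `S = (1,∞)`, `Re w > ½` the parameter `p = −½ − Re w` makes both
`v`-integrals finite: the twisted Cesàro / tail averages are bounded on `L²`.)
[cite: HardyLittlewoodPolya1952, Thm. 319 and Thm. 330 (Schur's test; weighted Hardy)] -/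
theorem lintegral_enorm_sq_twisted_le {S : Set ℝ} (hS : MeasurableSet S) (hS0 : S ⊆ Ioi 0)
    {f₀ : ℝ → ℂ} (hf₀m : Measurable f₀) (w : ℂ) (p : ℝ) :
    ∫⁻ t, ‖∫ v in S, (v : ℂ) ^ (-w) * f₀ (v * t)‖ₑ ^ 2 ≤
      (∫⁻ v in S, ENNReal.ofReal (v ^ p)) * (∫⁻ v in S, ENNReal.ofReal (v ^ (-2 * w.re - p - 1))) *
        ∫⁻ t, ‖f₀ t‖ₑ ^ 2 := by
  set A : ℝ≥0∞ := ∫⁻ v in S, ENNReal.ofReal (v ^ p) with hA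
  set q : ℝ := -2 * w.re - p with hq
  -- the two factors of the Cauchy–Schwarz splitting
  set φ : ℝ → ℝ≥0∞ := fun v ↦ ENNReal.ofReal (v ^ (p / 2)) with hφ
  set ψ : ℝ → ℝ → ℝ≥0∞ := fun t v ↦ ENNReal.ofReal (v ^ (-w.re - p / 2)) * ‖f₀ (v * t)‖ₑ with hψ
  have hφm : Measurable φ := ENNReal.measurable_ofReal.comp (measurable_id.pow_const _)
  have hψm : Measurable (Function.uncurry ψ) :=
    (ENNReal.measurable_ofReal.comp (measurable_snd.pow_const _)).mul
      (hf₀m.comp (measurable_snd.mul measurable_fst)).enorm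
  -- pointwise: `‖∫_S‖ₑ ≤ ∫⁻_S φ ψ`
  have hpt : ∀ t : ℝ, ‖∫ v in S, (v : ℂ) ^ (-w) * f₀ (v * t)‖ₑ ≤ ∫⁻ v in S, φ v * ψ t v := by
    intro t
    refine (enorm_integral_le_lintegral_enorm _).trans (le_of_eq ?_)
    refine setLIntegral_congr_fun hS fun v hv ↦ ?_
    have hv0 : 0 < v := hS0 hv
    rw [enorm_mul, ← ofReal_norm ((v : ℂ) ^ (-w)), Complex.norm_cpow_eq_rpow_re_of_pos hv0,
      Complex.neg_re, hφ, hψ]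
    dsimp only
    rw [← mul_assoc, ← ENNReal.ofReal_mul (Real.rpow_nonneg hv0.le _), ← Real.rpow_add hv0,
      show p / 2 + (-w.re - p / 2) = -w.re by ring]
  -- Cauchy–Schwarz in `v`
  have hCS : ∀ t : ℝ, (∫⁻ v in S, φ v * ψ t v) ^ 2 ≤ A * ∫⁻ v in S, ψ t v ^ 2 := by
    intro t
    have hψt : Measurable fun v ↦ ψ t v := hψm.comp measurable_prodMk_left
    have h := ENNReal.lintegral_mul_le_Lp_mul_Lq (volume.restrict S) Real.HolderConjugate.two_two
      hφm.aemeasurable hψt.aemeasurable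
    have hA' : ∫⁻ v in S, φ v ^ (2 : ℝ) = A := by
      rw [hA]
      refine setLIntegral_congr_fun hS fun v hv ↦ ?_
      have hv0 : 0 < v := hS0 hv
      rw [hφ]
      dsimp only
      rw [ENNReal.ofReal_rpow_of_nonneg (Real.rpow_nonneg hv0.le _) (by norm_num : (0 : ℝ) ≤ 2),
        ← Real.rpow_mul hv0.le, show p / 2 * (2 : ℝ) = p by ring]
    calc (∫⁻ v in S, φ v * ψ t v) ^ 2
        ≤ ((∫⁻ v in S, φ v ^ (2 : ℝ)) ^ (1 / (2 : ℝ)) *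
            (∫⁻ v in S, ψ t v ^ (2 : ℝ)) ^ (1 / (2 : ℝ))) ^ 2 := pow_le_pow_left' h 2
      _ = A * ∫⁻ v in S, ψ t v ^ 2 := by
          rw [mul_pow, ← ENNReal.rpow_two, ← ENNReal.rpow_two, ← ENNReal.rpow_mul, ← ENNReal.rpow_mul,
            show (1 / (2 : ℝ) * 2) = 1 by norm_num, ENNReal.rpow_one, ENNReal.rpow_one, hA']
          congr 1
          refine lintegral_congr fun v ↦ ?_
          rw [ENNReal.rpow_two]
  -- `ψ²` and the dilation law
  have hψ2 : ∀ t v : ℝ, v ∈ S → ψ t v ^ 2 =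
      ENNReal.ofReal (v ^ q) * (fun u ↦ ‖f₀ u‖ₑ ^ 2) (v * t) := by
    intro t v hv
    have hv0 : 0 < v := hS0 hv
    rw [hψ]
    dsimp only
    rw [mul_pow, ← ENNReal.ofReal_pow (Real.rpow_nonneg hv0.le _), ← Real.rpow_natCast,
      ← Real.rpow_mul hv0.le]
    congr 3
    rw [hq]; push_cast; ring
  have hinner : ∀ v ∈ S, ∫⁻ t, ψ t v ^ 2 =
      ENNReal.ofReal (v ^ (q - 1)) * ∫⁻ t, ‖f₀ t‖ₑ ^ 2 := by
    intro v hv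
    have hv0 : 0 < v := hS0 hv
    have e : (fun t ↦ ψ t v ^ 2) = fun t ↦ ENNReal.ofReal (v ^ q) * (fun u ↦ ‖f₀ u‖ₑ ^ 2) (v * t) :=
      funext fun t ↦ hψ2 t v hv
    rw [e, lintegral_const_mul' _ _ ENNReal.ofReal_ne_top,
      lintegral_comp_mul_left (fun u ↦ ‖f₀ u‖ₑ ^ 2) hv0, ← mul_assoc,
      ← ENNReal.ofReal_mul (Real.rpow_nonneg hv0.le _), Real.rpow_sub_one hv0.ne', div_eq_mul_inv]
  -- Tonelli
  have hT : ∫⁻ t, ∫⁻ v in S, ψ t v ^ 2 = ∫⁻ v in S, ∫⁻ t, ψ t v ^ 2 :=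
    lintegral_lintegral_swap ((hψm.pow_const 2).aemeasurable)
  calc ∫⁻ t, ‖∫ v in S, (v : ℂ) ^ (-w) * f₀ (v * t)‖ₑ ^ 2
      ≤ ∫⁻ t, (∫⁻ v in S, φ v * ψ t v) ^ 2 := lintegral_mono fun t ↦ pow_le_pow_left' (hpt t) 2
    _ ≤ ∫⁻ t, A * ∫⁻ v in S, ψ t v ^ 2 := lintegral_mono fun t ↦ hCS t
    _ = A * ∫⁻ v in S, ∫⁻ t, ψ t v ^ 2 := by
        have hmeas : AEMeasurable (fun t ↦ ∫⁻ v in S, ψ t v ^ 2) volume :=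
          ((hψm.pow_const 2).lintegral_prod_right' (ν := volume.restrict S)).aemeasurable
        rw [lintegral_const_mul'' _ hmeas, hT]
    _ = A * ∫⁻ v in S, ENNReal.ofReal (v ^ (q - 1)) * ∫⁻ t, ‖f₀ t‖ₑ ^ 2 := by
        congr 1
        exact setLIntegral_congr_fun hS fun v hv ↦ hinner v hv
    _ = A * (∫⁻ v in S, ENNReal.ofReal (v ^ (-2 * w.re - p - 1))) * ∫⁻ t, ‖f₀ t‖ₑ ^ 2 := by
        have hm' : Measurable fun v : ℝ ↦ ENNReal.ofReal (v ^ (q - 1)) :=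
          ENNReal.measurable_ofReal.comp (measurable_id.pow_const _)
        rw [lintegral_mul_const _ hm', ← mul_assoc, hq]


/-! ### C. The twisted averages `T_S f₀(t) = ∫_S v^{−w} f₀(vt) dv`: measurability, evenness, `L²` -/

/-- Measurability of a twisted average. [folklore] -/
private theorem measurable_twisted (S : Set ℝ) {f₀ : ℝ → ℂ} (hf₀m : Measurable f₀)
    (w : ℂ) : Measurable fun t : ℝ ↦ ∫ v in S, (v : ℂ) ^ (-w) * f₀ (v * t) := by
  have h : StronglyMeasurable (Function.uncurry fun t v : ℝ ↦ (v : ℂ) ^ (-w) * f₀ (v * t)) :=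
    (((Complex.measurable_ofReal.comp measurable_snd).pow_const _).mul
      (hf₀m.comp (measurable_snd.mul measurable_fst))).stronglyMeasurable
  have := (h.integral_prod_right (ν := volume.restrict S)).measurable
  exact this

/-- A twisted average of an even function is even. [folklore] -/
private theorem twisted_even {S : Set ℝ} {f₀ : ℝ → ℂ} (hf₀e : ∀ x, f₀ (-x) = f₀ x) (w : ℂ) (t : ℝ) :
    (∫ v in S, (v : ℂ) ^ (-w) * f₀ (v * -t)) = ∫ v in S, (v : ℂ) ^ (-w) * f₀ (v * t) := by
  simp_rw [mul_neg, hf₀e]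

/-- **`T_S f₀ ∈ L²`** when `∫_S v^p < ∞` for the Schur exponent `p = −½ − Re w` (i.e. `S = (0,1)` and
`Re w < ½`, or `S = (1,∞)` and `Re w > ½`). [cite: HardyLittlewoodPolya1952, Thm. 319 and Thm. 330] -/
theorem memLp_twisted {S : Set ℝ} (hS : MeasurableSet S) (hS0 : S ⊆ Ioi 0) {f₀ : ℝ → ℂ}
    (hf₀m : Measurable f₀) (hf₀ : MemLp f₀ 2 volume) {w : ℂ}
    (hp : IntegrableOn (fun v : ℝ ↦ v ^ (-(1 / 2 : ℝ) - w.re)) S) :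
    MemLp (fun t : ℝ ↦ ∫ v in S, (v : ℂ) ^ (-w) * f₀ (v * t)) 2 volume := by
  set p : ℝ := -(1 / 2 : ℝ) - w.re with hpdef
  have hA : (∫⁻ v in S, ENNReal.ofReal (v ^ p)) < ⊤ :=
    lt_of_le_of_lt (lintegral_ofReal_le_lintegral_enorm _) hp.2
  have hB : (∫⁻ v in S, ENNReal.ofReal (v ^ (-2 * w.re - p - 1))) < ⊤ := by
    rw [show -2 * w.re - p - 1 = p by rw [hpdef]; ring]
    exact hA
  have hf2 : ∫⁻ t, ‖f₀ t‖ₑ ^ 2 < ⊤ := by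
    have h := lintegral_rpow_enorm_lt_top_of_eLpNorm_lt_top two_ne_zero ENNReal.ofNat_ne_top
      hf₀.eLpNorm_lt_top
    simp only [ENNReal.toReal_ofNat, ENNReal.rpow_two] at h
    exact h
  have hle := lintegral_enorm_sq_twisted_le hS hS0 hf₀m w p
  refine ⟨(measurable_twisted S hf₀m w).aestronglyMeasurable, ?_⟩
  rw [eLpNorm_eq_lintegral_rpow_enorm_toReal two_ne_zero ENNReal.ofNat_ne_top]
  simp only [ENNReal.toReal_ofNat, ENNReal.rpow_two, one_div]
  refine ENNReal.rpow_lt_top_of_nonneg (by norm_num) (lt_top_iff_ne_top.1 ?_)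
  refine lt_of_le_of_lt hle ?_
  exact ENNReal.mul_lt_top (ENNReal.mul_lt_top hA hB) hf2

/-- The Schur exponent is integrable on `(0,1)` when `Re w < ½`. [folklore] -/
private theorem integrableOn_schur_Ioo {w : ℂ} (hw : w.re < 1 / 2) :
    IntegrableOn (fun v : ℝ ↦ v ^ (-(1 / 2 : ℝ) - w.re)) (Ioo 0 1) :=
  (intervalIntegral.integrableOn_Ioo_rpow_iff zero_lt_one).2 (by linarith)

/-- The Schur exponent is integrable on `(1,∞)` when `Re w > ½`. [folklore] -/
private theorem integrableOn_schur_Ioi {w : ℂ} (hw : 1 / 2 < w.re) :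
    IntegrableOn (fun v : ℝ ↦ v ^ (-(1 / 2 : ℝ) - w.re)) (Ioi 1) :=
  integrableOn_Ioi_rpow_of_lt (by linarith) zero_lt_one

/-! ### D. Values on `[−a, a]` -/

/-- **`Q_w f₀ = c/(1−w)` on `[−a,a]`** when `f₀ = c` on `[−a,a]` (`Re w < 1`). [cite: Burnol2004b, Prop. 4.3 (arXiv:math/0203120v7 p. 8, TeX l.711–731)] -/
theorem cesaro_twisted_eq_const {a : ℝ} {f₀ : ℝ → ℂ} {c : ℂ} (hf₀c : ∀ x, |x| ≤ a → f₀ x = c)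
    {w : ℂ} (hw : w.re < 1) {t : ℝ} (ht : |t| ≤ a) :
    (∫ v in Ioo (0 : ℝ) 1, (v : ℂ) ^ (-w) * f₀ (v * t)) = c / (1 - w) := by
  have h1w : (1 : ℂ) - w ≠ 0 := by
    intro h; have := congrArg Complex.re h; simp at this; linarith
  have e : ∫ v in Ioo (0 : ℝ) 1, (v : ℂ) ^ (-w) * f₀ (v * t) = ∫ v in Ioo (0 : ℝ) 1, (v : ℂ) ^ (-w) * c := by
    refine setIntegral_congr_fun measurableSet_Ioo fun v hv ↦ ?_
    rw [hf₀c]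
    rw [abs_mul, abs_of_pos hv.1]
    exact (mul_le_of_le_one_left (abs_nonneg t) hv.2.le).trans ht
  rw [e, integral_mul_const, ← integral_Ioc_eq_integral_Ioo, ← intervalIntegral.integral_of_le zero_le_one,
    integral_cpow (Or.inl (by rw [Complex.neg_re]; linarith)), Complex.ofReal_one, Complex.one_cpow,
    Complex.ofReal_zero, Complex.zero_cpow (by rwa [ne_eq, neg_add_eq_sub] ), sub_zero, neg_add_eq_sub]
  field_simp


/-- Integrability of `u ↦ u^{−w} f₀(u)` on `(a, ∞)` for `f₀ ∈ L²`, `Re w > ½` (Cauchy–Schwarz).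
[cite: Burnol2004b, §1 (arXiv:math/0203120v7 p. 4, TeX l.350–355)] -/
theorem integrableOn_cpow_mul_Ioi {a : ℝ} (ha : 0 < a) {f₀ : ℝ → ℂ} (hf₀L : MemLp f₀ 2 volume)
    {w : ℂ} (hw : 1 / 2 < w.re) :
    IntegrableOn (fun u : ℝ ↦ (u : ℂ) ^ (-w) * f₀ u) (Ioi a) := by
  set k : ℝ → ℂ := (Ioi a).indicator f₀ with hk
  have hkL : MemLp k 2 volume := hf₀L.indicator measurableSet_Ioi
  have hk0 : ∀ u, u ≤ a → k u = 0 :=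
    fun u hu ↦ indicator_of_notMem (fun h : u ∈ Ioi a ↦ not_lt.2 hu h) _
  have hMC := TailFactor.mellinConvergent_of_memLp ha hkL hk0 hw
  have h : IntegrableOn (fun t : ℝ ↦ (t : ℂ) ^ (1 - w - 1) • k t) (Ioi a) :=
    hMC.mono_set (Ioi_subset_Ioi ha.le)
  refine h.congr_fun (fun u hu ↦ ?_) measurableSet_Ioi
  show (u : ℂ) ^ (1 - w - 1) • k u = _
  rw [hk, indicator_of_mem hu, smul_eq_mul, show (1 - w - 1 : ℂ) = -w by ring]

/-- **The twisted tail average on `(0, a]`**: for `f₀ ∈ L²` with `f₀ = c` on `[−a,a]`, `Re w > ½`,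
`w ≠ 1` and `0 < t ≤ a`,
`∫₁^∞ v^{−w} f₀(vt) dv = −c/(1−w) + t^{w−1}·(c·a^{1−w}/(1−w) + ∫_a^∞ u^{−w} f₀(u) du)`; the bracket is
the value at `w` of the continued Mellin transform `c·a^{1−s}/(1−s) + ∫_a^∞ u^{−s}f₀`.
[cite: Burnol2004b, Prop. 4.3 (arXiv:math/0203120v7 p. 8, TeX l.711–731)] -/
theorem tail_twisted_eq {a : ℝ} (ha : 0 < a) {f₀ : ℝ → ℂ} (hf₀L : MemLp f₀ 2 volume) {c : ℂ}
    (hf₀c : ∀ x, |x| ≤ a → f₀ x = c) {w : ℂ} (hw : 1 / 2 < w.re) (hw1 : w ≠ 1) {t : ℝ}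
    (ht0 : 0 < t) (ht : t ≤ a) :
    (∫ v in Ioi (1 : ℝ), (v : ℂ) ^ (-w) * f₀ (v * t)) =
      -(c / (1 - w)) + (t : ℂ) ^ (w - 1) *
        (c * (a : ℂ) ^ (1 - w) / (1 - w) + ∫ u in Ioi a, (u : ℂ) ^ (-w) * f₀ u) := by
  have h1w : (1 : ℂ) - w ≠ 0 := sub_ne_zero.2 (Ne.symm hw1)
  have hat : 1 ≤ a / t := by rw [le_div_iff₀ ht0, one_mul]; exact ht
  have hat0 : 0 < a / t := div_pos ha ht0
  have htC : (t : ℂ) ≠ 0 := ofReal_ne_zero.2 ht0.ne'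
  set g : ℝ → ℂ := fun u ↦ (u : ℂ) ^ (-w) * f₀ u with hg
  have hgint : IntegrableOn g (Ioi a) := integrableOn_cpow_mul_Ioi ha hf₀L hw
  -- the piece `(1, a/t]`: `f₀(vt) = c`
  have hI1 : IntegrableOn (fun v : ℝ ↦ (v : ℂ) ^ (-w) * f₀ (v * t)) (Ioc 1 (a / t)) := by
    have hc : IntervalIntegrable (fun v : ℝ ↦ (v : ℂ) ^ (-w)) volume 1 (a / t) :=
      intervalIntegral.intervalIntegrable_cpow (Or.inr (by
        rw [Set.uIcc_of_le hat]; exact fun h ↦ by linarith [h.1]))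
    have hc' : IntegrableOn (fun v : ℝ ↦ (v : ℂ) ^ (-w) * c) (Ioc 1 (a / t)) :=
      ((intervalIntegrable_iff_integrableOn_Ioc_of_le hat).1 hc).mul_const c
    refine hc'.congr_fun (fun v hv ↦ ?_) measurableSet_Ioc
    rw [hf₀c]
    rw [abs_of_pos (mul_pos (zero_lt_one.trans hv.1) ht0)]
    calc v * t ≤ (a / t) * t := mul_le_mul_of_nonneg_right hv.2 ht0.le
      _ = a := div_mul_cancel₀ a ht0.ne'
  have hV1 : ∫ v in Ioc 1 (a / t), (v : ℂ) ^ (-w) * f₀ (v * t) =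
      c * ((((a / t : ℝ) : ℂ) ^ (1 - w) - 1) / (1 - w)) := by
    have e : ∫ v in Ioc 1 (a / t), (v : ℂ) ^ (-w) * f₀ (v * t) = ∫ v in Ioc 1 (a / t), (v : ℂ) ^ (-w) * c := by
      refine setIntegral_congr_fun measurableSet_Ioc fun v hv ↦ ?_
      rw [hf₀c]
      rw [abs_of_pos (mul_pos (zero_lt_one.trans hv.1) ht0)]
      calc v * t ≤ (a / t) * t := mul_le_mul_of_nonneg_right hv.2 ht0.le
        _ = a := div_mul_cancel₀ a ht0.ne'
    rw [e, integral_mul_const, ← intervalIntegral.integral_of_le hat,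
      integral_cpow (Or.inr ⟨fun h ↦ hw1 (by rw [neg_eq_iff_eq_neg] at h; simpa using h), by
        rw [Set.uIcc_of_le hat]; exact fun h ↦ by linarith [h.1]⟩),
      Complex.ofReal_one, Complex.one_cpow, neg_add_eq_sub, mul_comm]
  -- the piece `(a/t, ∞)`: substitution `u = vt`
  have hsub : ∫ v in Ioi (a / t), (v : ℂ) ^ (-w) * f₀ (v * t) = (t : ℂ) ^ (w - 1) * ∫ u in Ioi a, g u := by
    have e1 : ∀ v ∈ Ioi (a / t), (v : ℂ) ^ (-w) * f₀ (v * t) = (t : ℂ) ^ w * g (t * v) := by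
      intro v hv
      have hv0 : 0 < v := hat0.trans hv
      rw [hg]
      dsimp only
      rw [Complex.ofReal_mul, Complex.mul_cpow_ofReal_nonneg ht0.le hv0.le, mul_comm t v,
        Complex.cpow_neg (t : ℂ), ← mul_assoc, ← mul_assoc,
        mul_inv_cancel₀ (Complex.cpow_ne_zero_iff_of_exponent_ne_zero ?_ |>.2 htC), one_mul]
      · intro h0; rw [h0, Complex.zero_re] at hw; linarith
    rw [setIntegral_congr_fun measurableSet_Ioi e1, integral_const_mul,
      integral_comp_mul_left_Ioi g (a / t) ht0, mul_div_cancel₀ a ht0.ne', Complex.real_smul,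
      ← mul_assoc, Complex.ofReal_inv, Complex.cpow_sub _ _ htC, Complex.cpow_one, div_eq_mul_inv]
  have hI2 : IntegrableOn (fun v : ℝ ↦ (v : ℂ) ^ (-w) * f₀ (v * t)) (Ioi (a / t)) := by
    have h : IntegrableOn (fun v : ℝ ↦ (t : ℂ) ^ w * g (t * v)) (Ioi (a / t)) :=
      ((integrableOn_Ioi_comp_mul_left_iff g (a / t) ht0).2
        (by rw [mul_div_cancel₀ a ht0.ne']; exact hgint)).const_mul ((t : ℂ) ^ w)
    refine h.congr_fun (fun v hv ↦ ?_) measurableSet_Ioi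
    have hv0 : 0 < v := hat0.trans hv
    rw [hg]
    dsimp only
    rw [Complex.ofReal_mul, Complex.mul_cpow_ofReal_nonneg ht0.le hv0.le, mul_comm t v,
      Complex.cpow_neg (t : ℂ), ← mul_assoc, ← mul_assoc,
      mul_inv_cancel₀ (Complex.cpow_ne_zero_iff_of_exponent_ne_zero ?_ |>.2 htC), one_mul]
    intro h0; rw [h0, Complex.zero_re] at hw; linarith
  -- assemble
  have hsplit : Ioi (1 : ℝ) = Ioc 1 (a / t) ∪ Ioi (a / t) := (Ioc_union_Ioi_eq_Ioi hat).symm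
  rw [hsplit, setIntegral_union Ioc_disjoint_Ioi_same measurableSet_Ioi hI1 hI2, hV1, hsub]
  have hq : (((a / t : ℝ) : ℂ) ^ (1 - w)) = (a : ℂ) ^ (1 - w) * (t : ℂ) ^ (w - 1) := by
    rw [show (a / t : ℝ) = a * t⁻¹ from div_eq_mul_inv a t, Complex.ofReal_mul,
      Complex.mul_cpow_ofReal_nonneg ha.le (inv_nonneg.2 ht0.le), Complex.ofReal_inv,
      Complex.inv_cpow _ _ (by rw [Complex.arg_ofReal_of_nonneg ht0.le]; exact Real.pi_ne_zero.symm),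
      ← Complex.cpow_neg, neg_sub]
  rw [hq]
  field_simp
  ring

/-! ### E. Right Mellin transforms of the twisted averages (Fubini) -/

/-- **`(T_S f₀)^(s) = (∫_S v^{s−1−w} dv) · f̂₀(s)`**, with absolute convergence, for a measurable `f₀`
whose right Mellin transform converges absolutely at `s` and `∫_S v^{Re s − Re w − 1} dv < ∞` (Fubini;
`∫₀^∞ t^{−s} f₀(vt) dt = v^{s−1} f̂₀(s)`). For `S = (0,1)` the `v`-integral is `1/(s − w)`
(`Re s > Re w`), for `S = (1,∞)` it is `−1/(s − w)` (`Re s < Re w`).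
[cite: Burnol2004b, Prop. 4.3 (arXiv:math/0203120v7 p. 8, TeX l.711–731)] -/
theorem rightMellin_twisted {S : Set ℝ} (hS : MeasurableSet S) (hS0 : S ⊆ Ioi 0) {f₀ : ℝ → ℂ}
    (hf₀m : Measurable f₀) {s w : ℂ} (hconv : MellinConvergent f₀ (1 - s))
    (hSint : IntegrableOn (fun v : ℝ ↦ v ^ (s.re - w.re - 1)) S) :
    MellinConvergent (fun t : ℝ ↦ ∫ v in S, (v : ℂ) ^ (-w) * f₀ (v * t)) (1 - s) ∧
      rightMellin (fun t : ℝ ↦ ∫ v in S, (v : ℂ) ^ (-w) * f₀ (v * t)) s =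
        (∫ v in S, (v : ℂ) ^ (s - 1 - w)) * rightMellin f₀ s := by
  set μ : Measure ℝ := volume.restrict (Ioi (0 : ℝ)) with hμ
  set ν : Measure ℝ := volume.restrict S with hν
  set σ : ℝ := s.re with hσ
  -- the kernel
  set F : ℝ → ℝ → ℂ := fun t v ↦ (t : ℂ) ^ (1 - s - 1) • ((v : ℂ) ^ (-w) * f₀ (v * t)) with hF
  have hFm : Measurable (Function.uncurry F) := by
    refine Measurable.smul ((Complex.measurable_ofReal.comp measurable_fst).pow_const _) ?_
    exact ((Complex.measurable_ofReal.comp measurable_snd).pow_const _).mul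
      (hf₀m.comp (measurable_snd.mul measurable_fst))
  have hre : ((1 : ℂ) - s - 1).re = -σ := by
    rw [Complex.sub_re, Complex.sub_re, Complex.one_re, hσ]; ring
  -- sections in `v`
  have hsec : ∀ v ∈ S, Integrable (fun t ↦ F t v) μ := by
    intro v hv
    have hv0 : 0 < v := hS0 hv
    have h := ((MellinConvergent.comp_mul_left hv0).2 hconv).const_mul ((v : ℂ) ^ (-w))
    refine h.congr (ae_of_all _ fun t ↦ ?_)
    show (v : ℂ) ^ (-w) * ((t : ℂ) ^ (1 - s - 1) • f₀ (v * t)) = F t v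
    rw [hF]
    simp only [smul_eq_mul]
    ring
  -- the norm of the sections
  set M : ℝ := ∫ u in Ioi (0 : ℝ), ‖f₀ u‖ * u ^ (-σ) with hM
  have hnormF : ∀ v ∈ S, ∫ t, ‖F t v‖ ∂μ = v ^ (σ - w.re - 1) * M := by
    intro v hv
    have hv0 : 0 < v := hS0 hv
    have h2 : (fun t ↦ ‖F t v‖) =ᶠ[ae μ]
        fun t ↦ v ^ (σ - w.re) * ((fun u : ℝ ↦ ‖f₀ u‖ * u ^ (-σ)) (v * t)) := by
      filter_upwards [ae_restrict_mem (μ := (volume : Measure ℝ)) measurableSet_Ioi] with t ht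
      have ht0 : (0 : ℝ) < t := ht
      rw [hF]
      dsimp only
      rw [norm_smul, norm_mul, Complex.norm_cpow_eq_rpow_re_of_pos ht0, hre,
        Complex.norm_cpow_eq_rpow_re_of_pos hv0, Complex.neg_re, Real.mul_rpow hv0.le ht0.le,
        Real.rpow_neg hv0.le σ, Real.rpow_sub hv0, Real.rpow_neg hv0.le w.re]
      have hvσ : v ^ σ ≠ 0 := (Real.rpow_pos_of_pos hv0 σ).ne'
      have hvw : v ^ w.re ≠ 0 := (Real.rpow_pos_of_pos hv0 w.re).ne'
      field_simp
    rw [integral_congr_ae h2, integral_const_mul]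
    have h3 : (∫ t, (fun u : ℝ ↦ ‖f₀ u‖ * u ^ (-σ)) (v * t) ∂μ) =
        ∫ t in Ioi (0 : ℝ), (fun u : ℝ ↦ ‖f₀ u‖ * u ^ (-σ)) (v * t) := rfl
    rw [h3, integral_comp_mul_left_Ioi (fun u : ℝ ↦ ‖f₀ u‖ * u ^ (-σ)) 0 hv0, mul_zero,
      smul_eq_mul, ← hM, ← mul_assoc, Real.rpow_sub hv0 (σ - w.re) 1, Real.rpow_one,
      div_eq_mul_inv]
  -- integrability on the product
  have hFint : Integrable (Function.uncurry F) (μ.prod ν) := by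
    rw [integrable_prod_iff' hFm.aestronglyMeasurable]
    refine ⟨(ae_restrict_iff' hS).2 (ae_of_all _ hsec), ?_⟩
    exact IntegrableOn.congr_fun (hSint.mul_const M) (fun v hv ↦ (hnormF v hv).symm) hS
  have hswap := integral_integral_swap hFint
  -- the left side
  have hL : rightMellin (fun t : ℝ ↦ ∫ v in S, (v : ℂ) ^ (-w) * f₀ (v * t)) s =
      ∫ t, ∫ v, F t v ∂ν ∂μ := by
    show (∫ t in Ioi (0 : ℝ), (t : ℂ) ^ (1 - s - 1) • ∫ v in S, (v : ℂ) ^ (-w) * f₀ (v * t)) = _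
    refine integral_congr_ae (ae_of_all _ fun t ↦ ?_)
    exact (integral_smul _ _).symm
  -- the right side
  have hinner : ∀ v ∈ S, ∫ t, F t v ∂μ = (v : ℂ) ^ (s - 1 - w) * rightMellin f₀ s := by
    intro v hv
    have hv0 : 0 < v := hS0 hv
    have e : ∫ t, F t v ∂μ = (v : ℂ) ^ (-w) * mellin (fun t ↦ f₀ (v * t)) (1 - s) := by
      show ∫ t, F t v ∂μ = (v : ℂ) ^ (-w) * ∫ t in Ioi (0 : ℝ), (t : ℂ) ^ (1 - s - 1) • f₀ (v * t)
      rw [← integral_const_mul]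
      refine integral_congr_ae (ae_of_all _ fun t ↦ ?_)
      show F t v = (v : ℂ) ^ (-w) * ((t : ℂ) ^ (1 - s - 1) • f₀ (v * t))
      rw [hF]
      simp only [smul_eq_mul]
      ring
    rw [e, mellin_comp_mul_left f₀ (1 - s) hv0, smul_eq_mul, neg_sub, ← mul_assoc,
      ← Complex.cpow_add _ _ (Complex.ofReal_ne_zero.2 hv0.ne')]
    show (v : ℂ) ^ (-w + (s - 1)) * mellin f₀ (1 - s) = (v : ℂ) ^ (s - 1 - w) * mellin f₀ (1 - s)
    rw [show -w + (s - 1) = s - 1 - w by ring]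
  have hR : ∫ v, ∫ t, F t v ∂μ ∂ν = (∫ v in S, (v : ℂ) ^ (s - 1 - w)) * rightMellin f₀ s := by
    rw [← integral_mul_const]
    exact setIntegral_congr_fun hS fun v hv ↦ hinner v hv
  refine ⟨?_, ?_⟩
  · have h := hFint.integral_prod_left
    refine h.congr (ae_of_all _ fun t ↦ ?_)
    show (∫ y, F t y ∂ν) = (t : ℂ) ^ (1 - s - 1) • ∫ v, (v : ℂ) ^ (-w) * f₀ (v * t) ∂ν
    exact integral_smul _ _
  · rw [hL, hswap, hR]

/-- `∫₀¹ v^{s−1−w} dv = 1/(s − w)` for `Re w < Re s`. [folklore] -/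
private theorem integral_Ioo_cpow_eq {s w : ℂ} (hsw : w.re < s.re) :
    ∫ v in Ioo (0 : ℝ) 1, (v : ℂ) ^ (s - 1 - w) = 1 / (s - w) := by
  have hswne : s - w ≠ 0 := by
    intro h; have := congrArg Complex.re h; rw [Complex.sub_re, Complex.zero_re] at this; linarith
  rw [← integral_Ioc_eq_integral_Ioo, ← intervalIntegral.integral_of_le zero_le_one,
    integral_cpow (Or.inl (by rw [Complex.sub_re, Complex.sub_re, Complex.one_re]; linarith))]
  rw [show s - 1 - w + 1 = s - w by ring, Complex.ofReal_one, Complex.one_cpow, Complex.ofReal_zero,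
    Complex.zero_cpow hswne, sub_zero]

/-- `∫₁^∞ v^{s−1−w} dv = −1/(s − w)` for `Re s < Re w`. [folklore] -/
private theorem integral_Ioi_cpow_eq {s w : ℂ} (hsw : s.re < w.re) :
    ∫ v in Ioi (1 : ℝ), (v : ℂ) ^ (s - 1 - w) = -(1 / (s - w)) := by
  rw [integral_Ioi_cpow_of_lt (by rw [Complex.sub_re, Complex.sub_re, Complex.one_re]; linarith)
    zero_lt_one, show s - 1 - w + 1 = s - w by ring, Complex.ofReal_one, Complex.one_cpow, neg_div]


/-! ### F. The Fourier side: `⟨𝓕⁻¹α, T_S f⟩ = ∫ ᾱ(ξ) Ψ_S(ξ) dξ` (Parseval, dilation law, two Fubini) -/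

/-- Pull-back of an a.e. equality along a dilation `x ↦ cx`, `c ≠ 0`. [folklore] -/
private theorem ae_eq_comp_mul_left {f g : ℝ → ℂ} (h : f =ᵐ[volume] g) {c : ℝ} (hc : c ≠ 0) :
    (fun x : ℝ ↦ f (c * x)) =ᵐ[volume] fun x ↦ g (c * x) :=
  ((measurePreserving_mul_left hc).quasiMeasurePreserving.mono_right
    Measure.smul_absolutelyContinuous).ae_eq h

/-- **Duality form of `𝓕 ∘ T_S`.** Let `f ∈ L²(ℝ)` with representative `f₀`, `g₀` a representative of
`𝓕f`, `S ⊆ (0,∞)` measurable with `∫_S v^{−½−Re w} dv < ∞`, `H ∈ L²` the class of the twisted average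
`t ↦ ∫_S v^{−w} f₀(vt) dv`, and `α ∈ L²`. Then
`⟨𝓕⁻¹α, H⟩ = ∫ (∫_S v⁻¹·v^{−w}·g₀(ξ/v) dv) ᾱ(ξ) dξ`
(`⟨𝓕⁻¹α, T_S f⟩ = ∫_S v^{−w}⟨α, 𝓕(f(v·))⟩ dv = ∫_S v^{−w−1}⟨α, (𝓕f)(·/v)⟩ dv`, dilation law
`𝓕(f(v·)) = v⁻¹(𝓕f)(·/v)`). [cite: Burnol2004b, Prop. 4.3 and Lemma 4.4 (arXiv:math/0203120v7 p. 8, TeX l.711–758)] -/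
theorem inner_fourierInv_twisted (f : Lp ℂ 2 (volume : Measure ℝ))
    {f₀ : ℝ → ℂ} (hf₀m : Measurable f₀) (hff₀ : (f : ℝ → ℂ) =ᵐ[volume] f₀)
    {g₀ : ℝ → ℂ} (hg₀m : Measurable g₀)
    (hgg₀ : ((𝓕 f : Lp ℂ 2 (volume : Measure ℝ)) : ℝ → ℂ) =ᵐ[volume] g₀)
    {S : Set ℝ} (hS : MeasurableSet S) (hS0 : S ⊆ Ioi 0) {w : ℂ}
    (hSw : IntegrableOn (fun v : ℝ ↦ v ^ (-(1 / 2 : ℝ) - w.re)) S)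
    (H : Lp ℂ 2 (volume : Measure ℝ))
    (hH : (H : ℝ → ℂ) =ᵐ[volume] fun t ↦ ∫ v in S, (v : ℂ) ^ (-w) * f₀ (v * t))
    (α : Lp ℂ 2 (volume : Measure ℝ)) :
    ⟪(𝓕⁻ α : Lp ℂ 2 (volume : Measure ℝ)), H⟫_ℂ =
      ∫ ξ, (∫ v in S, ((v⁻¹ : ℝ) : ℂ) * ((v : ℂ) ^ (-w) * g₀ (v⁻¹ * ξ))) *
        (starRingEnd ℂ) ((α : ℝ → ℂ) ξ) := by
  set m : Lp ℂ 2 (volume : Measure ℝ) := (𝓕⁻ α : Lp ℂ 2 (volume : Measure ℝ)) with hm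
  set ν : Measure ℝ := volume.restrict S with hν
  have hf₀L : MemLp f₀ 2 volume := (Lp.memLp f).ae_eq hff₀
  have hg₀L : MemLp g₀ 2 volume := (Lp.memLp (𝓕 f : Lp ℂ 2 (volume : Measure ℝ))).ae_eq hgg₀
  have hmm : Measurable (m : ℝ → ℂ) := (Lp.stronglyMeasurable m).measurable
  have hαm : Measurable (α : ℝ → ℂ) := (Lp.stronglyMeasurable α).measurable
  have hp : ENNReal.ofReal (2 : ℝ) = 2 := by norm_num
  have h22 : (2 : ℝ).HolderConjugate 2 := Real.HolderConjugate.two_two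
  have hcpow_norm : ∀ v : ℝ, 0 < v → ‖(v : ℂ) ^ (-w)‖ = v ^ (-w.re) := by
    intro v hv
    rw [Complex.norm_cpow_eq_rpow_re_of_pos hv, Complex.neg_re]
  -- Step 1: `⟨m, H⟩` as an iterated integral
  have h1 : ⟪m, H⟫_ℂ = ∫ t, ∫ v, (v : ℂ) ^ (-w) * f₀ (v * t) * (starRingEnd ℂ) ((m : ℝ → ℂ) t) ∂ν := by
    rw [L2.inner_def]
    refine integral_congr_ae ?_
    filter_upwards [hH] with t ht
    rw [RCLike.inner_apply, ht]
    exact (integral_mul_const _ _).symm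
  -- Step 2: Fubini in `(t, v)`
  set G : ℝ → ℝ → ℂ := fun t v ↦ (v : ℂ) ^ (-w) * f₀ (v * t) * (starRingEnd ℂ) ((m : ℝ → ℂ) t) with hG
  have hGm : Measurable (Function.uncurry G) :=
    ((((Complex.measurable_ofReal.comp measurable_snd).pow_const _)).mul
      (hf₀m.comp (measurable_snd.mul measurable_fst))).mul
      (Complex.continuous_conj.measurable.comp (hmm.comp measurable_fst))
  have hdil : ∀ v : ℝ, v ≠ 0 → MemLp (fun t : ℝ ↦ f₀ (v * t)) 2 volume :=
    fun v hv ↦ memLp_comp_mul_left hf₀L hv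
  set A : ℝ := ∫ t, ‖f₀ t‖ ^ (2 : ℝ) with hA
  set B : ℝ := ∫ t, ‖(m : ℝ → ℂ) t‖ ^ (2 : ℝ) with hB
  have hA0 : 0 ≤ A := integral_nonneg fun t ↦ by positivity
  have hGnorm : ∀ v t : ℝ, 0 < v →
      ‖G t v‖ = v ^ (-w.re) * (‖f₀ (v * t)‖ * ‖(m : ℝ → ℂ) t‖) := by
    intro v t hv
    rw [hG]
    dsimp only
    rw [norm_mul, norm_mul, RCLike.norm_conj, hcpow_norm v hv, mul_assoc]
  have hsecG : ∀ v : ℝ, 0 < v → Integrable (fun t ↦ G t v) volume := by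
    intro v hv
    have h := (((hdil v hv.ne').norm).integrable_mul (Lp.memLp m).norm).const_mul (v ^ (-w.re))
    refine h.mono' (hGm.comp (measurable_id.prodMk measurable_const)).aestronglyMeasurable
      (ae_of_all _ fun t ↦ ?_)
    exact (hGnorm v t hv).le
  have hboundG : ∀ v : ℝ, 0 < v →
      ∫ t, ‖G t v‖ ≤ v ^ (-(1 / 2 : ℝ) - w.re) * (A ^ (1 / 2 : ℝ) * B ^ (1 / 2 : ℝ)) := by
    intro v hv
    have hf' : MemLp (fun t : ℝ ↦ f₀ (v * t)) (ENNReal.ofReal 2) volume := by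
      rw [hp]; exact hdil v hv.ne'
    have hm' : MemLp (m : ℝ → ℂ) (ENNReal.ofReal 2) volume := by rw [hp]; exact Lp.memLp m
    have h := integral_mul_norm_le_Lp_mul_Lq h22 hf' hm'
    have hG' : (fun t ↦ ‖G t v‖) = fun t ↦ v ^ (-w.re) * (‖f₀ (v * t)‖ * ‖(m : ℝ → ℂ) t‖) :=
      funext fun t ↦ hGnorm v t hv
    rw [hG', integral_const_mul]
    have hsub : ∫ t, ‖f₀ (v * t)‖ ^ (2 : ℝ) = v⁻¹ * A := by
      rw [hA, show (∫ t, ‖f₀ (v * t)‖ ^ (2 : ℝ)) =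
          ∫ t, (fun u : ℝ ↦ ‖f₀ u‖ ^ (2 : ℝ)) (v * t) from rfl,
        Measure.integral_comp_mul_left (fun u : ℝ ↦ ‖f₀ u‖ ^ (2 : ℝ)) v, smul_eq_mul,
        abs_of_pos (inv_pos.2 hv)]
    rw [hsub] at h
    calc v ^ (-w.re) * ∫ t, ‖f₀ (v * t)‖ * ‖(m : ℝ → ℂ) t‖
        ≤ v ^ (-w.re) * ((v⁻¹ * A) ^ (1 / 2 : ℝ) * B ^ (1 / 2 : ℝ)) :=
          mul_le_mul_of_nonneg_left h (Real.rpow_nonneg hv.le _)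
      _ = v ^ (-(1 / 2 : ℝ) - w.re) * (A ^ (1 / 2 : ℝ) * B ^ (1 / 2 : ℝ)) := by
          rw [Real.mul_rpow (inv_pos.2 hv).le hA0, Real.inv_rpow hv.le, ← Real.rpow_neg hv.le,
            show -(1 / 2 : ℝ) - w.re = -w.re + -(1 / 2) by ring, Real.rpow_add hv]
          ring
  have hGint : Integrable (Function.uncurry G) ((volume : Measure ℝ).prod ν) := by
    rw [integrable_prod_iff' hGm.aestronglyMeasurable]
    refine ⟨(ae_restrict_iff' hS).2 (ae_of_all _ fun v hv ↦ hsecG v (hS0 hv)), ?_⟩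
    have hmeas : AEStronglyMeasurable
        (fun v ↦ ∫ t, ‖Function.uncurry G (t, v)‖ ∂(volume : Measure ℝ)) ν :=
      (hGm.stronglyMeasurable.norm.integral_prod_left').aestronglyMeasurable
    have hdom : IntegrableOn
        (fun v : ℝ ↦ v ^ (-(1 / 2 : ℝ) - w.re) * (A ^ (1 / 2 : ℝ) * B ^ (1 / 2 : ℝ))) S :=
      hSw.mul_const _
    refine hdom.mono' hmeas ?_
    filter_upwards [ae_restrict_mem (μ := (volume : Measure ℝ)) hS] with v hv
    rw [Real.norm_eq_abs, abs_of_nonneg (integral_nonneg fun t ↦ norm_nonneg _)]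
    exact hboundG v (hS0 hv)
  have hswap := integral_integral_swap hGint
  -- Step 3: the `t`-integral for fixed `v`: Parseval and the dilation law
  have h3 : ∀ v ∈ S, ∫ t, G t v =
      (v : ℂ) ^ (-w) * (((v⁻¹ : ℝ) : ℂ) * ∫ ξ, g₀ (v⁻¹ * ξ) * (starRingEnd ℂ) ((α : ℝ → ℂ) ξ)) := by
    intro v hv
    have hv1 : 0 < v := hS0 hv
    have hv0 : v ≠ 0 := hv1.ne'
    set d : Lp ℂ 2 (volume : Measure ℝ) := (memLp_comp_mul_left (Lp.memLp f) hv0).toLp _ with hd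
    have hdco : (d : ℝ → ℂ) =ᵐ[volume] fun t ↦ f₀ (v * t) :=
      (coeFn_toLp_comp_mul_left f hv0).trans (ae_eq_comp_mul_left hff₀ hv0)
    have e1 : ∫ t, G t v = (v : ℂ) ^ (-w) * ⟪m, d⟫_ℂ := by
      rw [L2.inner_def, ← integral_const_mul]
      refine integral_congr_ae ?_
      filter_upwards [hdco] with t ht
      rw [RCLike.inner_apply, ht, hG]
      dsimp only
      ring
    have e2 : ⟪m, d⟫_ℂ = ⟪α, (𝓕 d : Lp ℂ 2 (volume : Measure ℝ))⟫_ℂ := (inner_fourier_right α d).symm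
    set d' : Lp ℂ 2 (volume : Measure ℝ) :=
      (memLp_comp_mul_left (Lp.memLp (𝓕 f : Lp ℂ 2 (volume : Measure ℝ))) (inv_ne_zero hv0)).toLp _
      with hd'
    have e3 : (𝓕 d : Lp ℂ 2 (volume : Measure ℝ)) = |v|⁻¹ • d' := fourier_toLp_comp_mul_left f hv0
    have hd'co : (d' : ℝ → ℂ) =ᵐ[volume] fun ξ ↦ g₀ (v⁻¹ * ξ) :=
      (coeFn_toLp_comp_mul_left (𝓕 f : Lp ℂ 2 (volume : Measure ℝ)) (inv_ne_zero hv0)).trans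
        (ae_eq_comp_mul_left hgg₀ (inv_ne_zero hv0))
    have e4 : ⟪α, d'⟫_ℂ = ∫ ξ, g₀ (v⁻¹ * ξ) * (starRingEnd ℂ) ((α : ℝ → ℂ) ξ) := by
      rw [L2.inner_def]
      refine integral_congr_ae ?_
      filter_upwards [hd'co] with ξ hξ
      rw [RCLike.inner_apply, hξ]
    rw [e1, e2, e3, RCLike.real_smul_eq_coe_smul (K := ℂ), inner_smul_right, e4, abs_of_pos hv1]
    rfl
  -- Step 4: Fubini in `(v, ξ)`
  set K : ℝ → ℝ → ℂ := fun v ξ ↦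
    ((v⁻¹ : ℝ) : ℂ) * ((v : ℂ) ^ (-w) * g₀ (v⁻¹ * ξ)) * (starRingEnd ℂ) ((α : ℝ → ℂ) ξ) with hK
  have hKm : Measurable (Function.uncurry K) := by
    refine Measurable.mul (Measurable.mul (Complex.measurable_ofReal.comp measurable_fst.inv) ?_) ?_
    · exact ((Complex.measurable_ofReal.comp measurable_fst).pow_const _).mul
        (hg₀m.comp (measurable_fst.inv.mul measurable_snd))
    · exact Complex.continuous_conj.measurable.comp (hαm.comp measurable_snd)
  have h4 : ∀ v ∈ S, ∫ t, G t v = ∫ ξ, K v ξ := by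
    intro v hv
    rw [h3 v hv, ← integral_const_mul, ← integral_const_mul]
    refine integral_congr_ae (ae_of_all _ fun ξ ↦ ?_)
    rw [hK]
    dsimp only
    ring
  set C : ℝ := ∫ ξ, ‖g₀ ξ‖ ^ (2 : ℝ) with hC
  set D : ℝ := ∫ ξ, ‖(α : ℝ → ℂ) ξ‖ ^ (2 : ℝ) with hD
  have hC0 : 0 ≤ C := integral_nonneg fun _ ↦ by positivity
  have hdil' : ∀ v : ℝ, v ≠ 0 → MemLp (fun ξ : ℝ ↦ g₀ (v⁻¹ * ξ)) 2 volume :=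
    fun v hv ↦ memLp_comp_mul_left hg₀L (inv_ne_zero hv)
  have hKnorm : ∀ v : ℝ, 0 < v → ∀ ξ : ℝ,
      ‖K v ξ‖ = v⁻¹ * v ^ (-w.re) * (‖g₀ (v⁻¹ * ξ)‖ * ‖(α : ℝ → ℂ) ξ‖) := by
    intro v hv ξ
    rw [hK]
    dsimp only
    rw [norm_mul, norm_mul, norm_mul, RCLike.norm_conj, Complex.norm_real, Real.norm_eq_abs,
      abs_of_pos (inv_pos.2 hv), hcpow_norm v hv]
    ring
  have hsecK : ∀ v : ℝ, 0 < v → Integrable (fun ξ ↦ K v ξ) volume := by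
    intro v hv
    have h := (((hdil' v hv.ne').norm).integrable_mul (Lp.memLp α).norm).const_mul (v⁻¹ * v ^ (-w.re))
    refine h.mono' (hKm.comp (measurable_const.prodMk measurable_id)).aestronglyMeasurable
      (ae_of_all _ fun ξ ↦ ?_)
    exact (hKnorm v hv ξ).le
  have hboundK : ∀ v : ℝ, 0 < v →
      ∫ ξ, ‖K v ξ‖ ≤ v ^ (-(1 / 2 : ℝ) - w.re) * (C ^ (1 / 2 : ℝ) * D ^ (1 / 2 : ℝ)) := by
    intro v hv
    have hg' : MemLp (fun ξ : ℝ ↦ g₀ (v⁻¹ * ξ)) (ENNReal.ofReal 2) volume := by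
      rw [hp]; exact hdil' v hv.ne'
    have hα' : MemLp (α : ℝ → ℂ) (ENNReal.ofReal 2) volume := by rw [hp]; exact Lp.memLp α
    have h := integral_mul_norm_le_Lp_mul_Lq h22 hg' hα'
    have hK' : (fun ξ ↦ ‖K v ξ‖) = fun ξ ↦ v⁻¹ * v ^ (-w.re) * (‖g₀ (v⁻¹ * ξ)‖ * ‖(α : ℝ → ℂ) ξ‖) :=
      funext (hKnorm v hv)
    rw [hK', integral_const_mul]
    have hsub : ∫ ξ, ‖g₀ (v⁻¹ * ξ)‖ ^ (2 : ℝ) = v * C := by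
      rw [hC, show (∫ ξ, ‖g₀ (v⁻¹ * ξ)‖ ^ (2 : ℝ)) =
          ∫ ξ, (fun u : ℝ ↦ ‖g₀ u‖ ^ (2 : ℝ)) (v⁻¹ * ξ) from rfl,
        Measure.integral_comp_inv_mul_left (fun u : ℝ ↦ ‖g₀ u‖ ^ (2 : ℝ)) v, smul_eq_mul,
        abs_of_pos hv]
    rw [hsub, ← hD] at h
    calc v⁻¹ * v ^ (-w.re) * ∫ ξ, ‖g₀ (v⁻¹ * ξ)‖ * ‖(α : ℝ → ℂ) ξ‖
        ≤ v⁻¹ * v ^ (-w.re) * ((v * C) ^ (1 / 2 : ℝ) * D ^ (1 / 2 : ℝ)) :=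
          mul_le_mul_of_nonneg_left h (mul_nonneg (inv_pos.2 hv).le (Real.rpow_nonneg hv.le _))
      _ = v ^ (-(1 / 2 : ℝ) - w.re) * (C ^ (1 / 2 : ℝ) * D ^ (1 / 2 : ℝ)) := by
          rw [Real.mul_rpow hv.le hC0, show v⁻¹ = v ^ (-1 : ℝ) from (Real.rpow_neg_one v).symm,
            show -(1 / 2 : ℝ) - w.re = (-1 + -w.re) + 1 / 2 by ring, Real.rpow_add hv,
            Real.rpow_add hv]
          ring
  have hKint : Integrable (Function.uncurry K) (ν.prod (volume : Measure ℝ)) := by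
    rw [integrable_prod_iff hKm.aestronglyMeasurable]
    refine ⟨(ae_restrict_iff' hS).2 (ae_of_all _ fun v hv ↦ hsecK v (hS0 hv)), ?_⟩
    have hmeas : AEStronglyMeasurable
        (fun v ↦ ∫ ξ, ‖Function.uncurry K (v, ξ)‖ ∂(volume : Measure ℝ)) ν :=
      (hKm.stronglyMeasurable.norm.integral_prod_right').aestronglyMeasurable
    have hdom : IntegrableOn
        (fun v : ℝ ↦ v ^ (-(1 / 2 : ℝ) - w.re) * (C ^ (1 / 2 : ℝ) * D ^ (1 / 2 : ℝ))) S :=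
      hSw.mul_const _
    refine hdom.mono' hmeas ?_
    filter_upwards [ae_restrict_mem (μ := (volume : Measure ℝ)) hS] with v hv
    rw [Real.norm_eq_abs, abs_of_nonneg (integral_nonneg fun t ↦ norm_nonneg _)]
    exact hboundK v (hS0 hv)
  have hswap2 := integral_integral_swap hKint
  have h45 : ∫ v, ∫ t, G t v ∂(volume : Measure ℝ) ∂ν = ∫ v, ∫ ξ, K v ξ ∂(volume : Measure ℝ) ∂ν :=
    setIntegral_congr_fun hS fun v hv ↦ h4 v hv
  have h6 : ∀ ξ : ℝ, ∫ v, K v ξ ∂ν =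
      (∫ v in S, ((v⁻¹ : ℝ) : ℂ) * ((v : ℂ) ^ (-w) * g₀ (v⁻¹ * ξ))) *
        (starRingEnd ℂ) ((α : ℝ → ℂ) ξ) := by
    intro ξ
    rw [← integral_mul_const]
  calc ⟪m, H⟫_ℂ = ∫ t, ∫ v, G t v ∂ν := h1
    _ = ∫ v, ∫ t, G t v ∂(volume : Measure ℝ) ∂ν := hswap
    _ = ∫ v, ∫ ξ, K v ξ ∂(volume : Measure ℝ) ∂ν := h45
    _ = ∫ ξ, ∫ v, K v ξ ∂ν := hswap2
    _ = _ := integral_congr_ae (ae_of_all _ h6)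


/-! ### G. Evaluation of `Ψ_S` on `[−a, a]` -/

/-- **Tail side (`S = (1,∞)`, `Re w > 0`)**: if `g₀ = c'` on `[−a,a]` then for `|ξ| ≤ a`,
`Ψ(ξ) = ∫₁^∞ v⁻¹ v^{−w} g₀(ξ/v) dv = c'/w` (as `|ξ/v| ≤ a`). [cite: Burnol2004b, Prop. 4.3 (arXiv:math/0203120v7 p. 8, TeX l.711–731)] -/
theorem psi_tail_eq {a : ℝ} {g₀ : ℝ → ℂ} {c' : ℂ} (hg₀c : ∀ x, |x| ≤ a → g₀ x = c') {w : ℂ}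
    (hw : 0 < w.re) {ξ : ℝ} (hξ : |ξ| ≤ a) :
    (∫ v in Ioi (1 : ℝ), ((v⁻¹ : ℝ) : ℂ) * ((v : ℂ) ^ (-w) * g₀ (v⁻¹ * ξ))) = c' / w := by
  have hw0 : w ≠ 0 := by intro h; rw [h, Complex.zero_re] at hw; exact lt_irrefl _ hw
  have e : ∀ v ∈ Ioi (1 : ℝ), ((v⁻¹ : ℝ) : ℂ) * ((v : ℂ) ^ (-w) * g₀ (v⁻¹ * ξ)) =
      (v : ℂ) ^ (-w - 1) * c' := by
    intro v hv
    have hv0 : 0 < v := zero_lt_one.trans hv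
    have hle : |v⁻¹ * ξ| ≤ a := by
      rw [abs_mul, abs_of_pos (inv_pos.2 hv0)]
      calc v⁻¹ * |ξ| ≤ 1 * |ξ| := by
            refine mul_le_mul_of_nonneg_right ?_ (abs_nonneg ξ)
            exact inv_le_one_of_one_le₀ hv.le
        _ ≤ a := by rw [one_mul]; exact hξ
    rw [hg₀c _ hle, Complex.ofReal_inv, ← Complex.cpow_neg_one, ← mul_assoc,
      ← Complex.cpow_add _ _ (Complex.ofReal_ne_zero.2 hv0.ne'), show (-1 + -w : ℂ) = -w - 1 by ring]
  rw [setIntegral_congr_fun measurableSet_Ioi e, integral_mul_const,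
    integral_Ioi_cpow_of_lt (by rw [Complex.sub_re, Complex.neg_re, Complex.one_re]; linarith)
      zero_lt_one, show (-w - 1 + 1 : ℂ) = -w by ring, Complex.ofReal_one, Complex.one_cpow]
  field_simp

/-- The change of variables `η = c/v` (`c > 0`): `∫_{0<v<1} v⁻¹ φ(c/v) dv = ∫_{η>c} η⁻¹ φ(η) dη`
(no integrability hypothesis: both sides are `0` together otherwise). [folklore] -/
private theorem integral_Ioo_inv_smul_comp_div {E : Type*} [NormedAddCommGroup E] [NormedSpace ℝ E]
    (φ : ℝ → E) {c : ℝ} (hc : 0 < c) :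
    ∫ v in Ioo (0 : ℝ) 1, v⁻¹ • φ (c / v) = ∫ η in Ioi c, η⁻¹ • φ η := by
  have h1 := integral_comp_rpow_Ioi
    (fun y : ℝ ↦ (Ioi (1 : ℝ)).indicator (fun y : ℝ ↦ y⁻¹ • φ (c * y)) y) (p := -1) (by norm_num)
  have hL : (∫ x in Ioi (0 : ℝ), (|(-1 : ℝ)| * x ^ ((-1 : ℝ) - 1)) •
      (Ioi (1 : ℝ)).indicator (fun y : ℝ ↦ y⁻¹ • φ (c * y)) (x ^ (-1 : ℝ))) =
      ∫ v in Ioo (0 : ℝ) 1, v⁻¹ • φ (c / v) := by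
    rw [← Ioi_inter_Iio, ← setIntegral_indicator measurableSet_Iio]
    refine setIntegral_congr_fun measurableSet_Ioi fun x hx ↦ ?_
    have hx0 : (0 : ℝ) < x := hx
    rw [Real.rpow_neg_one, show ((-1 : ℝ) - 1) = -2 by norm_num, Real.rpow_neg hx0.le,
      Real.rpow_two, abs_neg, abs_one, one_mul]
    by_cases hx1 : x < 1
    · have hmem : x⁻¹ ∈ Ioi (1 : ℝ) := by
        rw [mem_Ioi]; exact one_lt_inv_iff₀.2 ⟨hx0, hx1⟩
      rw [indicator_of_mem hmem, indicator_of_mem (mem_Iio.2 hx1), inv_inv, smul_smul,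
        ← div_eq_mul_inv c x]
      congr 1
      field_simp
    · have hnot : x⁻¹ ∉ Ioi (1 : ℝ) := by
        rw [mem_Ioi, not_lt]
        exact inv_le_one_of_one_le₀ (not_lt.1 hx1)
      rw [indicator_of_notMem hnot, indicator_of_notMem (fun h : x ∈ Iio (1 : ℝ) ↦ hx1 h),
        smul_zero]
  have hR : (∫ y in Ioi (0 : ℝ), (Ioi (1 : ℝ)).indicator (fun y : ℝ ↦ y⁻¹ • φ (c * y)) y) =
      ∫ y in Ioi (1 : ℝ), y⁻¹ • φ (c * y) := by
    rw [setIntegral_indicator measurableSet_Ioi, Ioi_inter_Ioi, max_eq_right zero_le_one]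
  rw [hL, hR] at h1
  rw [h1]
  have h2 := integral_comp_mul_left_Ioi (fun η : ℝ ↦ (c / η) • φ η) 1 hc
  have h2' : (fun y : ℝ ↦ (fun η : ℝ ↦ (c / η) • φ η) (c * y)) = fun y ↦ y⁻¹ • φ (c * y) := by
    funext y
    simp only
    by_cases hy : y = 0
    · rw [hy, mul_zero, inv_zero, div_zero]
    · rw [show c / (c * y) = y⁻¹ by field_simp]
  rw [h2'] at h2
  rw [h2, mul_one, ← integral_smul]
  refine setIntegral_congr_fun measurableSet_Ioi fun η hη ↦ ?_
  have hη0 : (0 : ℝ) < η := hc.trans hη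
  rw [smul_smul]
  congr 1
  field_simp

/-- **Cesàro side (`S = (0,1)`, `Re w < ½`)**: if `g₀ ∈ L²` is even with `g₀ = c'` on `[−a,a]`
(`a > 0`), then for `0 < |ξ| ≤ a`,
`Ψ(ξ) = ∫₀¹ v⁻¹ v^{−w} g₀(ξ/v) dv = |ξ|^{−w}·(c'·∫_{|ξ|}^a η^{w−1} dη + ∫_a^∞ η^{w−1} g₀(η) dη)`
(substitution `η = |ξ|/v`). [cite: Burnol2004b, Prop. 4.3 (arXiv:math/0203120v7 p. 8, TeX l.711–731)] -/
theorem psi_cesaro_eq {a : ℝ} (ha : 0 < a) {g₀ : ℝ → ℂ} (hg₀L : MemLp g₀ 2 volume)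
    (hg₀e : ∀ x, g₀ (-x) = g₀ x) {c' : ℂ} (hg₀c : ∀ x, |x| ≤ a → g₀ x = c') {w : ℂ}
    (hw : w.re < 1 / 2) {ξ : ℝ} (hξ0 : ξ ≠ 0) (hξ : |ξ| ≤ a) :
    (∫ v in Ioo (0 : ℝ) 1, ((v⁻¹ : ℝ) : ℂ) * ((v : ℂ) ^ (-w) * g₀ (v⁻¹ * ξ))) =
      ((|ξ| : ℝ) : ℂ) ^ (-w) * ((c' * ∫ η in Ioc |ξ| a, (η : ℂ) ^ (w - 1)) +
        ∫ η in Ioi a, (η : ℂ) ^ (w - 1) * g₀ η) := by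
  have hξp : 0 < |ξ| := abs_pos.2 hξ0
  have hξC : ((|ξ| : ℝ) : ℂ) ≠ 0 := Complex.ofReal_ne_zero.2 hξp.ne'
  set φ : ℝ → ℂ := fun η ↦ (η : ℂ) ^ w * g₀ η with hφ
  -- rewrite the integrand as `|ξ|^{−w} · (v⁻¹ • φ(|ξ|/v))`
  have e1 : ∀ v ∈ Ioo (0 : ℝ) 1, ((v⁻¹ : ℝ) : ℂ) * ((v : ℂ) ^ (-w) * g₀ (v⁻¹ * ξ)) =
      ((|ξ| : ℝ) : ℂ) ^ (-w) * (v⁻¹ • φ (|ξ| / v)) := by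
    intro v hv
    have hg : g₀ (v⁻¹ * ξ) = g₀ (|ξ| / v) := by
      rcases le_or_gt 0 ξ with h | h
      · rw [abs_of_nonneg h, div_eq_inv_mul]
      · rw [abs_of_neg h, neg_div, hg₀e, div_eq_inv_mul]
    have harg : (v : ℂ).arg ≠ Real.pi := by
      rw [Complex.arg_ofReal_of_nonneg hv.1.le]; exact Real.pi_ne_zero.symm
    rw [hg, hφ, Complex.real_smul]
    dsimp only
    rw [show (|ξ| / v : ℝ) = |ξ| * v⁻¹ from div_eq_mul_inv _ _, Complex.ofReal_mul,
      Complex.mul_cpow_ofReal_nonneg hξp.le (inv_nonneg.2 hv.1.le), Complex.ofReal_inv,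
      Complex.inv_cpow _ _ harg, ← Complex.cpow_neg]
    have h1 : ((|ξ| : ℝ) : ℂ) ^ (-w) * ((|ξ| : ℝ) : ℂ) ^ w = 1 := by
      rw [Complex.cpow_neg, inv_mul_cancel₀]
      exact fun h ↦ hξC ((Complex.cpow_eq_zero_iff _ _).1 h).1
    linear_combination -((v : ℂ)⁻¹ * ((v : ℂ) ^ (-w) * g₀ (|ξ| * v⁻¹))) * h1
  rw [setIntegral_congr_fun measurableSet_Ioo e1, integral_const_mul,
    integral_Ioo_inv_smul_comp_div φ hξp]
  congr 1
  have e2 : ∀ η ∈ Ioi |ξ|, η⁻¹ • φ η = (η : ℂ) ^ (w - 1) * g₀ η := by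
    intro η hη
    have hη0 : 0 < η := hξp.trans hη
    rw [hφ, Complex.real_smul]
    dsimp only
    rw [Complex.cpow_sub _ _ (Complex.ofReal_ne_zero.2 hη0.ne'), Complex.cpow_one, Complex.ofReal_inv]
    field_simp
  rw [setIntegral_congr_fun measurableSet_Ioi e2]
  -- split `(|ξ|, ∞) = (|ξ|, a] ∪ (a, ∞)`
  have hI2 : IntegrableOn (fun η : ℝ ↦ (η : ℂ) ^ (w - 1) * g₀ η) (Ioi a) := by
    have h := integrableOn_cpow_mul_Ioi ha hg₀L (w := 1 - w) (by rw [Complex.sub_re, Complex.one_re]; linarith)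
    refine h.congr_fun (fun η _ ↦ ?_) measurableSet_Ioi
    rw [neg_sub]
  have hI1 : IntegrableOn (fun η : ℝ ↦ (η : ℂ) ^ (w - 1) * g₀ η) (Ioc |ξ| a) := by
    have hc : IntervalIntegrable (fun η : ℝ ↦ (η : ℂ) ^ (w - 1)) volume |ξ| a :=
      intervalIntegral.intervalIntegrable_cpow (Or.inr (by
        rw [Set.uIcc_of_le hξ]; exact fun h ↦ by linarith [h.1]))
    have hc' : IntegrableOn (fun η : ℝ ↦ (η : ℂ) ^ (w - 1) * c') (Ioc |ξ| a) :=
      ((intervalIntegrable_iff_integrableOn_Ioc_of_le hξ).1 hc).mul_const c'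
    refine hc'.congr_fun (fun η hη ↦ ?_) measurableSet_Ioc
    rw [hg₀c η (by rw [abs_of_pos (hξp.trans hη.1)]; exact hη.2)]
  have hV1 : ∫ η in Ioc |ξ| a, (η : ℂ) ^ (w - 1) * g₀ η = c' * ∫ η in Ioc |ξ| a, (η : ℂ) ^ (w - 1) := by
    rw [← integral_const_mul]
    refine setIntegral_congr_fun measurableSet_Ioc fun η hη ↦ ?_
    rw [hg₀c η (by rw [abs_of_pos (hξp.trans hη.1)]; exact hη.2), mul_comm]
  rw [← Ioc_union_Ioi_eq_Ioi hξ, setIntegral_union Ioc_disjoint_Ioi_same measurableSet_Ioi hI1 hI2,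
    hV1]

/-! ### H. From the duality identity to "`𝓕H` is a.e. constant on `[−a, a]`" -/

/-- If `⟨𝓕⁻¹α, H⟩ = κ · conj(∫ α)` for every `α ∈ L²` vanishing off `[−a,a]`, then `𝓕H = κ` a.e. on
`[−a,a]` (test with `α = 𝟙_{[−a,a]}(𝓕H − κ)`). [folklore] -/
private theorem fourier_ae_eq_const_of_inner {a : ℝ} (H : Lp ℂ 2 (volume : Measure ℝ)) {κ : ℂ}
    (h : ∀ α : Lp ℂ 2 (volume : Measure ℝ), (∀ᵐ ξ : ℝ, ξ ∉ Icc (-a) a → (α : ℝ → ℂ) ξ = 0) →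
      ⟪(𝓕⁻ α : Lp ℂ 2 (volume : Measure ℝ)), H⟫_ℂ = κ * (starRingEnd ℂ) (∫ ξ, (α : ℝ → ℂ) ξ)) :
    ∀ᵐ ξ : ℝ, ξ ∈ Icc (-a) a → ((𝓕 H : Lp ℂ 2 (volume : Measure ℝ)) : ℝ → ℂ) ξ = κ := by
  set Φ : ℝ → ℂ := ((𝓕 H : Lp ℂ 2 (volume : Measure ℝ)) : ℝ → ℂ) with hΦ
  have hIcc : MeasurableSet (Icc (-a) a) := measurableSet_Icc
  have hfin : volume (Icc (-a) a) ≠ ⊤ := measure_Icc_lt_top.ne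
  set D : ℝ → ℂ := (Icc (-a) a).indicator (fun ξ ↦ Φ ξ - κ) with hD
  have hDL : MemLp D 2 volume := by
    have h1 : MemLp (fun ξ ↦ Φ ξ - κ) 2 (volume.restrict (Icc (-a) a)) :=
      ((Lp.memLp (𝓕 H : Lp ℂ 2 (volume : Measure ℝ))).restrict _).sub
        (memLp_const κ (μ := volume.restrict (Icc (-a) a)))
    exact (memLp_indicator_iff_restrict hIcc).2 h1
  set α : Lp ℂ 2 (volume : Measure ℝ) := hDL.toLp D with hα
  have hαD : (α : ℝ → ℂ) =ᵐ[volume] D := hDL.coeFn_toLp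
  have hα0 : ∀ᵐ ξ : ℝ, ξ ∉ Icc (-a) a → (α : ℝ → ℂ) ξ = 0 := by
    filter_upwards [hαD] with ξ hξ hξI
    rw [hξ, hD, indicator_of_notMem hξI]
  have hDint : Integrable D volume := by
    have : IntegrableOn (fun ξ ↦ Φ ξ - κ) (Icc (-a) a) :=
      (((Lp.memLp (𝓕 H : Lp ℂ 2 (volume : Measure ℝ))).restrict _).sub
        (memLp_const κ (μ := volume.restrict (Icc (-a) a)))).integrable (by norm_num)
    exact this.integrable_indicator hIcc
  have hαΦ : Integrable (fun ξ ↦ (starRingEnd ℂ) ((α : ℝ → ℂ) ξ) * Φ ξ) volume := by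
    have h0 : Integrable (fun ξ ↦ (α : ℝ → ℂ) ξ * Φ ξ) volume :=
      (Lp.memLp α).integrable_mul (Lp.memLp (𝓕 H : Lp ℂ 2 (volume : Measure ℝ)))
    refine h0.norm.mono' ?_ (ae_of_all _ fun ξ ↦ ?_)
    · exact (Complex.continuous_conj.comp_aestronglyMeasurable (Lp.aestronglyMeasurable α)).mul
        (Lp.aestronglyMeasurable _)
    · rw [norm_mul, norm_mul, RCLike.norm_conj]
  have hακ : Integrable (fun ξ ↦ (starRingEnd ℂ) ((α : ℝ → ℂ) ξ) * κ) volume := by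
    have h0 : Integrable (α : ℝ → ℂ) volume := hDint.congr hαD.symm
    refine (h0.norm.mul_const ‖κ‖).mono' ?_ (ae_of_all _ fun ξ ↦ ?_)
    · exact (Complex.continuous_conj.comp_aestronglyMeasurable (Lp.aestronglyMeasurable α)).mul
        aestronglyMeasurable_const
    · rw [norm_mul, RCLike.norm_conj]
  -- `⟨α, 𝓕H⟩ = ∫ conj(α)·Φ` and `κ conj(∫α) = ∫ conj(α)·κ`
  have e1 : ⟪(𝓕⁻ α : Lp ℂ 2 (volume : Measure ℝ)), H⟫_ℂ =
      ∫ ξ, (starRingEnd ℂ) ((α : ℝ → ℂ) ξ) * Φ ξ := by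
    rw [← inner_fourier_right, L2.inner_def]
    refine integral_congr_ae (ae_of_all _ fun ξ ↦ ?_)
    dsimp only
    rw [RCLike.inner_apply, mul_comm]
  have e2 : κ * (starRingEnd ℂ) (∫ ξ, (α : ℝ → ℂ) ξ) = ∫ ξ, (starRingEnd ℂ) ((α : ℝ → ℂ) ξ) * κ := by
    rw [integral_mul_const, ← integral_conj, mul_comm]
  have e3 : ∫ ξ, (starRingEnd ℂ) ((α : ℝ → ℂ) ξ) * (Φ ξ - κ) = 0 := by
    have : (fun ξ ↦ (starRingEnd ℂ) ((α : ℝ → ℂ) ξ) * (Φ ξ - κ)) =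
        fun ξ ↦ (starRingEnd ℂ) ((α : ℝ → ℂ) ξ) * Φ ξ - (starRingEnd ℂ) ((α : ℝ → ℂ) ξ) * κ := by
      funext ξ; ring
    rw [this, integral_sub hαΦ hακ, ← e1, ← e2, h α hα0, sub_self]
  -- the integrand is `‖D‖²`
  have e4 : (fun ξ ↦ (starRingEnd ℂ) ((α : ℝ → ℂ) ξ) * (Φ ξ - κ)) =ᵐ[volume]
      fun ξ ↦ ((‖D ξ‖ ^ 2 : ℝ) : ℂ) := by
    filter_upwards [hαD] with ξ hξ
    rw [hξ]
    by_cases hI : ξ ∈ Icc (-a) a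
    · have hDξ : D ξ = Φ ξ - κ := by rw [hD, indicator_of_mem hI]
      rw [hDξ, Complex.conj_mul', Complex.ofReal_pow]
    · have hDξ : D ξ = 0 := by rw [hD, indicator_of_notMem hI]
      rw [hDξ, map_zero, zero_mul, norm_zero]
      simp
  have e5 : ∫ ξ, ‖D ξ‖ ^ 2 = 0 := by
    have h5 : ∫ ξ, ((‖D ξ‖ ^ 2 : ℝ) : ℂ) = 0 := by rw [← integral_congr_ae e4, e3]
    rw [integral_complex_ofReal] at h5
    exact_mod_cast h5
  have hD2 : Integrable (fun ξ ↦ ‖D ξ‖ ^ 2) volume :=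
    (memLp_two_iff_integrable_sq_norm hDL.1).1 hDL
  have hD0 : (fun ξ ↦ ‖D ξ‖ ^ 2) =ᵐ[volume] 0 :=
    (integral_eq_zero_iff_of_nonneg (fun ξ ↦ by positivity) hD2).1 e5
  filter_upwards [hD0] with ξ hξ hξI
  have hz : D ξ = 0 := by
    have : ‖D ξ‖ ^ 2 = 0 := hξ
    exact norm_eq_zero.1 (pow_eq_zero_iff two_ne_zero |>.1 this)
  rw [hD, indicator_of_mem hξI] at hz
  exact sub_eq_zero.1 hz


/-! ### I. Strip bookkeeping for representatives of elements of `L_a` -/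

/-- Absolute convergence of `f̂₀(s)` on `½ < Re s < 1` for `f₀ ∈ L²` constant on `[−a,a]`.
[cite: Burnol2004b, §1 (arXiv:math/0203120v7 p. 4, TeX l.350–355)] -/
theorem mellinConvergent_rep {a : ℝ} (ha : 0 < a) {f₀ : ℝ → ℂ}
    (hf₀L : MemLp f₀ 2 volume) {c : ℂ} (hf₀c : ∀ x, |x| ≤ a → f₀ x = c) {s : ℂ}
    (hs : 1 / 2 < s.re) (hs1 : s.re < 1) : MellinConvergent f₀ (1 - s) := by
  have h1 : IntegrableOn (fun t : ℝ ↦ (t : ℂ) ^ (1 - s - 1) • f₀ t) (Ioc 0 a) := by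
    have hc : IntervalIntegrable (fun t : ℝ ↦ (t : ℂ) ^ (-s)) volume 0 a :=
      intervalIntegral.intervalIntegrable_cpow' (by rw [Complex.neg_re]; linarith)
    have hc' : IntegrableOn (fun t : ℝ ↦ (t : ℂ) ^ (-s) * c) (Ioc 0 a) :=
      ((intervalIntegrable_iff_integrableOn_Ioc_of_le ha.le).1 hc).mul_const c
    refine hc'.congr_fun (fun t ht ↦ ?_) measurableSet_Ioc
    rw [hf₀c t (by rw [abs_of_pos ht.1]; exact ht.2), smul_eq_mul, show (1 - s - 1 : ℂ) = -s by ring]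
  have h2 : IntegrableOn (fun t : ℝ ↦ (t : ℂ) ^ (1 - s - 1) • f₀ t) (Ioi a) := by
    refine (integrableOn_cpow_mul_Ioi ha hf₀L hs).congr_fun (fun t _ ↦ ?_) measurableSet_Ioi
    rw [smul_eq_mul, show (1 - s - 1 : ℂ) = -s by ring]
  have h := h1.union h2
  rw [Ioc_union_Ioi_eq_Ioi ha.le] at h
  exact h

/-- **Strip decomposition** `f̂₀(s) = c·a^{1−s}/(1−s) + ∫_a^∞ u^{−s} f₀(u) du` on `½ < Re s < 1`.
[cite: Burnol2004, proof of Thm. 6.10 (TeX l.2436–2441)] -/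
theorem rightMellin_rep_eq {a : ℝ} (ha : 0 < a) {f₀ : ℝ → ℂ} (hf₀L : MemLp f₀ 2 volume) {c : ℂ}
    (hf₀c : ∀ x, |x| ≤ a → f₀ x = c) {s : ℂ} (hs : 1 / 2 < s.re) (hs1 : s.re < 1) :
    rightMellin f₀ s = c * (a : ℂ) ^ (1 - s) / (1 - s) + ∫ u in Ioi a, (u : ℂ) ^ (-s) * f₀ u := by
  have h1s : (1 : ℂ) - s ≠ 0 := by
    intro h; have := congrArg Complex.re h; simp at this; linarith
  have hc : IntervalIntegrable (fun t : ℝ ↦ (t : ℂ) ^ (-s)) volume 0 a :=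
    intervalIntegral.intervalIntegrable_cpow' (by rw [Complex.neg_re]; linarith)
  have hI1 : IntegrableOn (fun t : ℝ ↦ (t : ℂ) ^ (-s) * f₀ t) (Ioc 0 a) := by
    have hc' : IntegrableOn (fun t : ℝ ↦ (t : ℂ) ^ (-s) * c) (Ioc 0 a) :=
      ((intervalIntegrable_iff_integrableOn_Ioc_of_le ha.le).1 hc).mul_const c
    refine hc'.congr_fun (fun t ht ↦ ?_) measurableSet_Ioc
    rw [hf₀c t (by rw [abs_of_pos ht.1]; exact ht.2)]
  have hI2 : IntegrableOn (fun t : ℝ ↦ (t : ℂ) ^ (-s) * f₀ t) (Ioi a) :=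
    integrableOn_cpow_mul_Ioi ha hf₀L hs
  have hV1 : ∫ t in Ioc 0 a, (t : ℂ) ^ (-s) * f₀ t = c * (a : ℂ) ^ (1 - s) / (1 - s) := by
    have e : ∫ t in Ioc 0 a, (t : ℂ) ^ (-s) * f₀ t = ∫ t in Ioc 0 a, (t : ℂ) ^ (-s) * c :=
      setIntegral_congr_fun measurableSet_Ioc fun t ht ↦ by
        rw [hf₀c t (by rw [abs_of_pos ht.1]; exact ht.2)]
    rw [e, integral_mul_const, ← intervalIntegral.integral_of_le ha.le,
      integral_cpow (Or.inl (by rw [Complex.neg_re]; linarith)), Complex.ofReal_zero,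
      Complex.zero_cpow (by rwa [ne_eq, neg_add_eq_sub]), sub_zero, neg_add_eq_sub]
    field_simp
  have e0 : rightMellin f₀ s = ∫ t in Ioi (0 : ℝ), (t : ℂ) ^ (-s) * f₀ t := by
    show (∫ t in Ioi (0 : ℝ), (t : ℂ) ^ (1 - s - 1) • f₀ t) = _
    refine setIntegral_congr_fun measurableSet_Ioi fun t _ ↦ ?_
    rw [smul_eq_mul, show (1 - s - 1 : ℂ) = -s by ring]
  rw [e0, ← Ioc_union_Ioi_eq_Ioi ha.le, setIntegral_union Ioc_disjoint_Ioi_same measurableSet_Ioi hI1 hI2,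
    hV1]

/-- `rightMellin` only sees a.e. values on `(0, ∞)`. [folklore] -/
private theorem rightMellin_congr_ae {f g : ℝ → ℂ} (h : f =ᵐ[volume] g) (s : ℂ) :
    rightMellin f s = rightMellin g s := by
  show (∫ t in Ioi (0 : ℝ), (t : ℂ) ^ (1 - s - 1) • f t) = ∫ t in Ioi (0 : ℝ), (t : ℂ) ^ (1 - s - 1) • g t
  refine integral_congr_ae ?_
  filter_upwards [ae_restrict_of_ae (s := Ioi (0 : ℝ)) h] with t ht
  rw [ht]

/-- `L_a` is stable under scalars. [cite: Burnol2004b, §2 (arXiv:math/0203120v7 p. 5, TeX l.413–423)] -/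
theorem smul_mem_sonineL {a : ℝ} (c : ℂ) {f : Lp ℂ 2 (volume : Measure ℝ)} (hf : f ∈ sonineL a) :
    c • f ∈ sonineL a := by
  obtain ⟨he, ⟨c₁, h0⟩, ⟨c₂, h1⟩⟩ := hf
  refine ⟨smul_mem_evenL2 c he, ⟨c • c₁, ?_⟩, ⟨c • c₂, ?_⟩⟩
  · filter_upwards [Lp.coeFn_smul c f, h0] with x hx h hxa
    rw [hx, Pi.smul_apply, h hxa]
  · rw [fourier_smul]
    filter_upwards [Lp.coeFn_smul c (𝓕 f : Lp ℂ 2 (volume : Measure ℝ)), h1] with x hx h hxa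
    rw [hx, Pi.smul_apply, h hxa]

/-- `rightMellin (c • f) = c · rightMellin f` for an `L²` class. [folklore] -/
private theorem rightMellin_smul (c : ℂ) (f : Lp ℂ 2 (volume : Measure ℝ)) (s : ℂ) :
    rightMellin ((c • f : Lp ℂ 2 (volume : Measure ℝ)) : ℝ → ℂ) s = c * rightMellin (f : ℝ → ℂ) s := by
  rw [rightMellin_congr_ae (Lp.coeFn_smul c f) s]
  show mellin (fun t ↦ (c • (f : ℝ → ℂ)) t) (1 - s) = c * mellin (f : ℝ → ℂ) (1 - s)
  rw [show (fun t ↦ (c • (f : ℝ → ℂ)) t) = fun t ↦ c • (f : ℝ → ℂ) t from rfl, mellin_const_smul,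
    smul_eq_mul]

/-! ### J. The continuation of `f̂` on the half-plane `Re s > ½` for `f ∈ L_a` -/

/-- **`G_f(s) = c·a^{1−s}/(1−s) + ∫_a^∞ u^{−s} f₀(u) du` on `Re s > ½`, `s ≠ 1`** for `f ∈ L_a` with
representative `f₀ = c` on `[−a,a]` (both sides are holomorphic on the half-plane punctured at `1` and
agree on the strip; identity theorem on the convex pieces `{Im s > 0}`, `{Im s < 0}`, `{Re s > 1}`).
[cite: Burnol2004b, Prop. 2.2 and §4 Note (arXiv:math/0203120v7 pp. 5, 7; TeX l.460–469, 614–623)] -/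
theorem rightMellinExt_eq_of_rep {a : ℝ} (ha : 0 < a) {f : Lp ℂ 2 (volume : Measure ℝ)}
    (hf : f ∈ sonineL a) {f₀ : ℝ → ℂ} (hff₀ : (f : ℝ → ℂ) =ᵐ[volume] f₀) {c : ℂ}
    (hf₀c : ∀ x, |x| ≤ a → f₀ x = c) {s : ℂ} (hs : 1 / 2 < s.re) (hs1 : s ≠ 1) :
    rightMellinExt f s = c * (a : ℂ) ^ (1 - s) / (1 - s) + ∫ u in Ioi a, (u : ℂ) ^ (-s) * f₀ u := by
  have hf₀L : MemLp f₀ 2 volume := (Lp.memLp f).ae_eq hff₀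
  have hcont := hasRightMellinContinuation_rightMellinExt_of_mem_sonineL ha hf
  -- the truncation as an `L²` class and the holomorphy of its Mellin transform
  have hgm : MemLp (Set.indicator {x : ℝ | a < |x|} (f : ℝ → ℂ)) 2 volume :=
    (Lp.memLp f).indicator (isOpen_lt continuous_const continuous_abs).measurableSet
  set g : Lp ℂ 2 (volume : Measure ℝ) := hgm.toLp _ with hgdef
  have hg : ∀ᵐ x : ℝ, g x = Set.indicator {x : ℝ | a < |x|} (f : ℝ → ℂ) x := hgm.coeFn_toLp
  have hga : ∀ᵐ x : ℝ, x ∈ Icc (-a) a → (g : ℝ → ℂ) x = 0 := by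
    filter_upwards [hg] with x hx hxI
    rw [hx, Set.indicator_of_notMem]
    simp only [mem_setOf_eq, not_lt]
    exact abs_le.2 ⟨hxI.1, hxI.2⟩
  have hgmel : ∀ z : ℂ, mellin (g : ℝ → ℂ) (1 - z) = ∫ u in Ioi a, (u : ℂ) ^ (-z) * f₀ u := by
    intro z
    have e : ∫ u in Ioi a, (u : ℂ) ^ (-z) * f₀ u =
        ∫ u in Ioi (0 : ℝ), (Ioi a).indicator (fun u : ℝ ↦ (u : ℂ) ^ (-z) * f₀ u) u := by
      rw [setIntegral_indicator measurableSet_Ioi, Ioi_inter_Ioi, sup_of_le_right ha.le]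
    rw [e, mellin]
    refine setIntegral_congr_ae measurableSet_Ioi ?_
    filter_upwards [hg, hff₀] with t ht hft htpos
    have ht0 : (0 : ℝ) < t := htpos
    rw [ht, show (1 - z - 1 : ℂ) = -z by ring]
    by_cases hta : a < t
    · have hm : t ∈ {x : ℝ | a < |x|} := by simpa [abs_of_pos ht0] using hta
      rw [Set.indicator_of_mem hm, indicator_of_mem (mem_Ioi.2 hta), smul_eq_mul, hft]
    · have hm : t ∉ {x : ℝ | a < |x|} := by simpa [abs_of_pos ht0] using hta
      rw [Set.indicator_of_notMem hm, indicator_of_notMem (fun h : t ∈ Ioi a ↦ hta h), smul_zero]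
  set R : ℂ → ℂ := fun z ↦ c * (a : ℂ) ^ (1 - z) / (1 - z) + ∫ u in Ioi a, (u : ℂ) ^ (-z) * f₀ u with hR
  have hRd : DifferentiableOn ℂ R {z : ℂ | 1 / 2 < z.re ∧ z ≠ 1} := by
    have h1 : DifferentiableOn ℂ (fun z : ℂ ↦ c * (a : ℂ) ^ (1 - z) / (1 - z)) {z : ℂ | 1 / 2 < z.re ∧ z ≠ 1} := by
      refine DifferentiableOn.div ?_ ?_ ?_
      · exact ((differentiable_id.const_sub (1 : ℂ)).const_cpow
          (Or.inl (ofReal_ne_zero.2 ha.ne'))).differentiableOn.const_mul c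
      · exact (differentiable_id.const_sub (1 : ℂ)).differentiableOn
      · intro z hz; exact sub_ne_zero.2 (Ne.symm hz.2)
    have h2 : DifferentiableOn ℂ (fun z : ℂ ↦ mellin (g : ℝ → ℂ) (1 - z)) {z : ℂ | 1 / 2 < z.re ∧ z ≠ 1} := by
      have hd := differentiableOn_mellin ha g hga
      intro z hz
      have hz' : (1 - z).re < 1 / 2 := by rw [Complex.sub_re, Complex.one_re]; linarith [hz.1]
      have hO : IsOpen {w : ℂ | w.re < 1 / 2} := isOpen_lt Complex.continuous_re continuous_const
      have hda : DifferentiableAt ℂ (mellin (g : ℝ → ℂ)) (1 - z) :=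
        (hd (1 - z) hz').differentiableAt (hO.mem_nhds hz')
      exact (hda.comp z ((differentiable_id.const_sub (1 : ℂ)) z)).differentiableWithinAt
    refine (h1.add h2).congr fun z _ ↦ ?_
    rw [hR, Pi.add_apply]
    dsimp only
    rw [hgmel z]
  -- agreement on the strip
  have hstrip : ∀ z : ℂ, 1 / 2 < z.re → z.re < 1 → rightMellinExt f z = R z := by
    intro z hz1 hz2
    rw [hcont.2 z hz1 hz2, rightMellin_congr_ae hff₀, rightMellin_rep_eq ha hf₀L hf₀c hz1 hz2]
  -- identity theorem on a convex open piece `C ⊆ {Re > 1/2, ≠ 1}` containing a strip point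
  have key : ∀ C : Set ℂ, IsOpen C → Convex ℝ C → C ⊆ {z : ℂ | 1 / 2 < z.re ∧ z ≠ 1} →
      ∀ z₀ ∈ C, rightMellinExt f =ᶠ[𝓝 z₀] R → Set.EqOn (rightMellinExt f) R C := by
    intro C hCo hCc hCsub z₀ hz₀ hev
    have ha₁ : AnalyticOnNhd ℂ (rightMellinExt f) C :=
      (hcont.1.mono fun z hz ↦ (hCsub hz).2).analyticOnNhd hCo
    have ha₂ : AnalyticOnNhd ℂ R C := (hRd.mono hCsub).analyticOnNhd hCo
    exact ha₁.eqOn_of_preconnected_of_eventuallyEq ha₂ hCc.isPreconnected hz₀ hev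
  have hOstrip : IsOpen {z : ℂ | 1 / 2 < z.re ∧ z.re < 1} :=
    (isOpen_lt continuous_const Complex.continuous_re).inter (isOpen_lt Complex.continuous_re continuous_const)
  have hev_strip : ∀ z₀ : ℂ, 1 / 2 < z₀.re → z₀.re < 1 → rightMellinExt f =ᶠ[𝓝 z₀] R := by
    intro z₀ h1 h2
    filter_upwards [hOstrip.mem_nhds ⟨h1, h2⟩] with z hz
    exact hstrip z hz.1 hz.2
  -- the three pieces
  set Cp : Set ℂ := {z : ℂ | 1 / 2 < z.re ∧ 0 < z.im} with hCp
  set Cm : Set ℂ := {z : ℂ | 1 / 2 < z.re ∧ z.im < 0} with hCm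
  set Cr : Set ℂ := {z : ℂ | 1 < z.re} with hCr
  have hCpo : IsOpen Cp := (isOpen_lt continuous_const Complex.continuous_re).inter
    (isOpen_lt continuous_const Complex.continuous_im)
  have hCmo : IsOpen Cm := (isOpen_lt continuous_const Complex.continuous_re).inter
    (isOpen_lt Complex.continuous_im continuous_const)
  have hCro : IsOpen Cr := isOpen_lt continuous_const Complex.continuous_re
  have hCpc : Convex ℝ Cp := (convex_halfSpace_re_gt (1 / 2)).inter (convex_halfSpace_im_gt 0)
  have hCmc : Convex ℝ Cm := (convex_halfSpace_re_gt (1 / 2)).inter (convex_halfSpace_im_lt 0)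
  have hCrc : Convex ℝ Cr := convex_halfSpace_re_gt 1
  have hne1 : ∀ z : ℂ, z.im ≠ 0 → z ≠ 1 := fun z hz h ↦ hz (by rw [h, Complex.one_im])
  have hCpsub : Cp ⊆ {z : ℂ | 1 / 2 < z.re ∧ z ≠ 1} := fun z hz ↦ ⟨hz.1, hne1 z hz.2.ne'⟩
  have hCmsub : Cm ⊆ {z : ℂ | 1 / 2 < z.re ∧ z ≠ 1} := fun z hz ↦ ⟨hz.1, hne1 z hz.2.ne⟩
  have hCrsub : Cr ⊆ {z : ℂ | 1 / 2 < z.re ∧ z ≠ 1} := fun z hz ↦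
    ⟨by simp only [hCr, mem_setOf_eq] at hz; linarith, fun h ↦ by
      simp only [hCr, mem_setOf_eq] at hz; rw [h, Complex.one_re] at hz; linarith⟩
  have hp0 : (⟨3 / 4, 1⟩ : ℂ) ∈ Cp := ⟨show (1 : ℝ) / 2 < 3 / 4 by norm_num, show (0 : ℝ) < 1 by norm_num⟩
  have hm0 : (⟨3 / 4, -1⟩ : ℂ) ∈ Cm := ⟨show (1 : ℝ) / 2 < 3 / 4 by norm_num, show (-1 : ℝ) < 0 by norm_num⟩
  have hEp : Set.EqOn (rightMellinExt f) R Cp :=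
    key Cp hCpo hCpc hCpsub _ hp0 (hev_strip _ (show (1 : ℝ) / 2 < 3 / 4 by norm_num)
      (show (3 : ℝ) / 4 < 1 by norm_num))
  have hEm : Set.EqOn (rightMellinExt f) R Cm :=
    key Cm hCmo hCmc hCmsub _ hm0 (hev_strip _ (show (1 : ℝ) / 2 < 3 / 4 by norm_num)
      (show (3 : ℝ) / 4 < 1 by norm_num))
  have hr0 : (⟨2, 1⟩ : ℂ) ∈ Cr := show (1 : ℝ) < 2 by norm_num
  have hEr : Set.EqOn (rightMellinExt f) R Cr := by
    refine key Cr hCro hCrc hCrsub _ hr0 ?_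
    have hm : (⟨2, 1⟩ : ℂ) ∈ Cp := ⟨show (1 : ℝ) / 2 < 2 by norm_num, show (0 : ℝ) < 1 by norm_num⟩
    filter_upwards [hCpo.mem_nhds hm] with z hz
    exact hEp hz
  -- conclusion
  show rightMellinExt f s = R s
  by_cases h1 : s.re < 1
  · exact hstrip s hs h1
  rcases lt_trichotomy s.im 0 with him | him | him
  · exact hEm ⟨hs, him⟩
  · have hsre : 1 < s.re := by
      rcases lt_or_eq_of_le (not_lt.1 h1) with h | h
      · exact h
      · exact absurd (Complex.ext (by rw [Complex.one_re]; exact h.symm) (by rw [Complex.one_im]; exact him)) hs1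
    exact hEr hsre
  · exact hEp ⟨hs, him⟩


/-! ### K. The two witnesses: twisted Cesàro average (`Re w < ½`) and twisted tail average (`Re w > ½`) -/

/-- a.e. `ξ ≠ 0`. [folklore] -/
private theorem ae_ne_zero' : ∀ᵐ ξ : ℝ, ξ ≠ 0 := by
  have : ∀ᵐ ξ : ℝ, ξ ∉ ({0} : Set ℝ) := compl_mem_ae_iff.mpr (measure_singleton 0)
  filter_upwards [this] with ξ hξ h
  exact hξ (mem_singleton_iff.2 h)

/-- **The twisted Cesàro witness (`Re w < ½`).** For `f ∈ L²` with an even representative `f₀ = c` on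
`[−a,a]`, a representative `g₀` of `𝓕f`, and `Ψ(ξ) = ∫₀¹ v⁻¹v^{−w}g₀(ξ/v)dv = κ` on `[−a,a] ∖ {0}`: the
class `h` of `Q_w f₀ = ∫₀¹ v^{−w} f₀(vt) dv` is even, equals `c/(1−w)` on `(0,a)`, has `𝓕h = κ` on
`(0,a)`, and `ĥ(s) = f̂(s)/(s − w)` on the strip. [cite: Burnol2004b, Prop. 4.3 (arXiv:math/0203120v7 p. 8, TeX l.711–731)] -/
theorem exists_cesaro_twisted {a : ℝ} (ha : 0 < a) (f : Lp ℂ 2 (volume : Measure ℝ))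
    {f₀ : ℝ → ℂ} (hf₀m : Measurable f₀) (hff₀ : (f : ℝ → ℂ) =ᵐ[volume] f₀)
    (hf₀e : ∀ x, f₀ (-x) = f₀ x) {c : ℂ} (hf₀c : ∀ x, |x| ≤ a → f₀ x = c)
    {g₀ : ℝ → ℂ} (hg₀m : Measurable g₀)
    (hgg₀ : ((𝓕 f : Lp ℂ 2 (volume : Measure ℝ)) : ℝ → ℂ) =ᵐ[volume] g₀)
    {w : ℂ} (hw : w.re < 1 / 2) {κ : ℂ}
    (hΨ : ∀ ξ : ℝ, ξ ≠ 0 → |ξ| ≤ a →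
      (∫ v in Ioo (0 : ℝ) 1, ((v⁻¹ : ℝ) : ℂ) * ((v : ℂ) ^ (-w) * g₀ (v⁻¹ * ξ))) = κ) :
    ∃ h : Lp ℂ 2 (volume : Measure ℝ), h ∈ evenL2 ∧
      (∀ᵐ x : ℝ, x ∈ Ioo 0 a → (h : ℝ → ℂ) x = c / (1 - w)) ∧
      (∀ᵐ x : ℝ, x ∈ Ioo 0 a → ((𝓕 h : Lp ℂ 2 (volume : Measure ℝ)) : ℝ → ℂ) x = κ) ∧
      ∀ s : ℂ, 1 / 2 < s.re → s.re < 1 →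
        rightMellin (h : ℝ → ℂ) s = rightMellin (f : ℝ → ℂ) s / (s - w) := by
  have hf₀L : MemLp f₀ 2 volume := (Lp.memLp f).ae_eq hff₀
  have hHL : MemLp (fun t : ℝ ↦ ∫ v in Ioo (0 : ℝ) 1, (v : ℂ) ^ (-w) * f₀ (v * t)) 2 volume :=
    memLp_twisted measurableSet_Ioo Ioo_subset_Ioi_self hf₀m hf₀L (integrableOn_schur_Ioo hw)
  set h : Lp ℂ 2 (volume : Measure ℝ) := hHL.toLp _ with hh
  have hco : (h : ℝ → ℂ) =ᵐ[volume] fun t ↦ ∫ v in Ioo (0 : ℝ) 1, (v : ℂ) ^ (-w) * f₀ (v * t) :=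
    hHL.coeFn_toLp
  refine ⟨h, ?_, ?_, ?_, ?_⟩
  · have hneg : Measure.QuasiMeasurePreserving (fun x : ℝ ↦ -x) volume volume :=
      (Measure.measurePreserving_neg (volume : Measure ℝ)).quasiMeasurePreserving
    show ∀ᵐ x : ℝ, (h : ℝ → ℂ) (-x) = (h : ℝ → ℂ) x
    filter_upwards [hco, hneg.ae hco] with x h1 h2
    rw [h2, h1]
    exact twisted_even hf₀e w x
  · filter_upwards [hco] with x hx hxI
    rw [hx]
    exact cesaro_twisted_eq_const hf₀c (by linarith) (by rw [abs_of_pos hxI.1]; exact hxI.2.le)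
  · have hF := fourier_ae_eq_const_of_inner (a := a) h (κ := κ) (fun α hα0 ↦ by
      rw [inner_fourierInv_twisted f hf₀m hff₀ hg₀m hgg₀ measurableSet_Ioo Ioo_subset_Ioi_self
        (integrableOn_schur_Ioo hw) h hco α]
      have hpt : ∀ᵐ ξ : ℝ,
          (∫ v in Ioo (0 : ℝ) 1, ((v⁻¹ : ℝ) : ℂ) * ((v : ℂ) ^ (-w) * g₀ (v⁻¹ * ξ))) *
            (starRingEnd ℂ) ((α : ℝ → ℂ) ξ) = κ * (starRingEnd ℂ) ((α : ℝ → ℂ) ξ) := by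
        filter_upwards [hα0, ae_ne_zero'] with ξ h0 hξ0
        by_cases hI : ξ ∈ Icc (-a) a
        · rw [hΨ ξ hξ0 (abs_le.2 ⟨hI.1, hI.2⟩)]
        · rw [h0 hI, map_zero, mul_zero, mul_zero]
      rw [integral_congr_ae hpt, integral_const_mul, integral_conj])
    filter_upwards [hF] with x hx hxI
    exact hx ⟨by linarith [hxI.1], hxI.2.le⟩
  · intro s hs hs1
    have hSint : IntegrableOn (fun v : ℝ ↦ v ^ (s.re - w.re - 1)) (Ioo 0 1) :=
      (intervalIntegral.integrableOn_Ioo_rpow_iff zero_lt_one).2 (by linarith)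
    obtain ⟨-, hM⟩ := rightMellin_twisted measurableSet_Ioo Ioo_subset_Ioi_self hf₀m
      (mellinConvergent_rep ha hf₀L hf₀c hs hs1) hSint (w := w)
    rw [rightMellin_congr_ae hco, hM, integral_Ioo_cpow_eq (by linarith), rightMellin_congr_ae hff₀]
    ring

/-- **The twisted tail witness (`Re w > ½`, `w ≠ 1`).** For `f ∈ L²` with an even representative
`f₀ = c` on `[−a,a]` such that `c·a^{1−w}/(1−w) + ∫_a^∞ u^{−w}f₀(u)du = 0` (i.e. `G_f(w) = 0`), and a
representative `g₀ = c'` on `[−a,a]` of `𝓕f`: the class `h` of `R_w f₀ = −∫₁^∞ v^{−w} f₀(vt) dv` is even,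
equals `c/(1−w)` on `(0,a)`, has `𝓕h = −c'/w` on `(0,a)`, and `ĥ(s) = f̂(s)/(s − w)` for `s` in the strip
with `Re s < Re w`. [cite: Burnol2004b, Prop. 4.3 (arXiv:math/0203120v7 p. 8, TeX l.711–731)] -/
theorem exists_tail_twisted {a : ℝ} (ha : 0 < a) (f : Lp ℂ 2 (volume : Measure ℝ))
    {f₀ : ℝ → ℂ} (hf₀m : Measurable f₀) (hff₀ : (f : ℝ → ℂ) =ᵐ[volume] f₀)
    (hf₀e : ∀ x, f₀ (-x) = f₀ x) {c : ℂ} (hf₀c : ∀ x, |x| ≤ a → f₀ x = c)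
    {g₀ : ℝ → ℂ} (hg₀m : Measurable g₀)
    (hgg₀ : ((𝓕 f : Lp ℂ 2 (volume : Measure ℝ)) : ℝ → ℂ) =ᵐ[volume] g₀)
    {c' : ℂ} (hg₀c : ∀ x, |x| ≤ a → g₀ x = c')
    {w : ℂ} (hw : 1 / 2 < w.re) (hw1 : w ≠ 1)
    (hvan : c * (a : ℂ) ^ (1 - w) / (1 - w) + ∫ u in Ioi a, (u : ℂ) ^ (-w) * f₀ u = 0) :
    ∃ h : Lp ℂ 2 (volume : Measure ℝ), h ∈ evenL2 ∧
      (∀ᵐ x : ℝ, x ∈ Ioo 0 a → (h : ℝ → ℂ) x = c / (1 - w)) ∧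
      (∀ᵐ x : ℝ, x ∈ Ioo 0 a → ((𝓕 h : Lp ℂ 2 (volume : Measure ℝ)) : ℝ → ℂ) x = -(c' / w)) ∧
      ∀ s : ℂ, 1 / 2 < s.re → s.re < 1 → s.re < w.re →
        rightMellin (h : ℝ → ℂ) s = rightMellin (f : ℝ → ℂ) s / (s - w) := by
  have hf₀L : MemLp f₀ 2 volume := (Lp.memLp f).ae_eq hff₀
  have hw0 : 0 < w.re := by linarith
  have hHL : MemLp (fun t : ℝ ↦ ∫ v in Ioi (1 : ℝ), (v : ℂ) ^ (-w) * f₀ (v * t)) 2 volume :=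
    memLp_twisted measurableSet_Ioi (Ioi_subset_Ioi zero_le_one) hf₀m hf₀L
      (integrableOn_schur_Ioi hw)
  set hT : Lp ℂ 2 (volume : Measure ℝ) := hHL.toLp _ with hhT
  have hco : (hT : ℝ → ℂ) =ᵐ[volume] fun t ↦ ∫ v in Ioi (1 : ℝ), (v : ℂ) ^ (-w) * f₀ (v * t) :=
    hHL.coeFn_toLp
  have hneg : Measure.QuasiMeasurePreserving (fun x : ℝ ↦ -x) volume volume :=
    (Measure.measurePreserving_neg (volume : Measure ℝ)).quasiMeasurePreserving
  have hTe : hT ∈ evenL2 := by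
    show ∀ᵐ x : ℝ, (hT : ℝ → ℂ) (-x) = (hT : ℝ → ℂ) x
    filter_upwards [hco, hneg.ae hco] with x h1 h2
    rw [h2, h1]
    exact twisted_even hf₀e w x
  -- `𝓕 hT = c'/w` on `[−a, a]`
  have hFT : ∀ᵐ x : ℝ, x ∈ Icc (-a) a → ((𝓕 hT : Lp ℂ 2 (volume : Measure ℝ)) : ℝ → ℂ) x = c' / w := by
    refine fourier_ae_eq_const_of_inner (a := a) hT (κ := c' / w) (fun α hα0 ↦ ?_)
    rw [inner_fourierInv_twisted f hf₀m hff₀ hg₀m hgg₀ measurableSet_Ioi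
      (Ioi_subset_Ioi zero_le_one) (integrableOn_schur_Ioi hw) hT hco α]
    have hpt : ∀ᵐ ξ : ℝ,
        (∫ v in Ioi (1 : ℝ), ((v⁻¹ : ℝ) : ℂ) * ((v : ℂ) ^ (-w) * g₀ (v⁻¹ * ξ))) *
          (starRingEnd ℂ) ((α : ℝ → ℂ) ξ) = c' / w * (starRingEnd ℂ) ((α : ℝ → ℂ) ξ) := by
      filter_upwards [hα0] with ξ h0
      by_cases hI : ξ ∈ Icc (-a) a
      · rw [psi_tail_eq hg₀c hw0 (abs_le.2 ⟨hI.1, hI.2⟩)]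
      · rw [h0 hI, map_zero, mul_zero, mul_zero]
    rw [integral_congr_ae hpt, integral_const_mul, integral_conj]
  refine ⟨(-1 : ℂ) • hT, smul_mem_evenL2 _ hTe, ?_, ?_, ?_⟩
  · filter_upwards [Lp.coeFn_smul (-1 : ℂ) hT, hco] with x hx h1 hxI
    rw [hx, Pi.smul_apply, h1, smul_eq_mul,
      tail_twisted_eq ha hf₀L hf₀c hw hw1 hxI.1 hxI.2.le, hvan, mul_zero, add_zero]
    ring
  · rw [fourier_smul]
    filter_upwards [Lp.coeFn_smul (-1 : ℂ) (𝓕 hT : Lp ℂ 2 (volume : Measure ℝ)), hFT] with x hx h1 hxI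
    rw [hx, Pi.smul_apply, h1 ⟨by linarith [hxI.1], hxI.2.le⟩, smul_eq_mul]
    ring
  · intro s hs hs1 hsw
    have hSint : IntegrableOn (fun v : ℝ ↦ v ^ (s.re - w.re - 1)) (Ioi 1) :=
      integrableOn_Ioi_rpow_of_lt (by linarith) zero_lt_one
    obtain ⟨-, hM⟩ := rightMellin_twisted measurableSet_Ioi (Ioi_subset_Ioi zero_le_one) hf₀m
      (mellinConvergent_rep ha hf₀L hf₀c hs hs1) hSint (w := w)
    have hswne : s - w ≠ 0 := by
      intro h0; have := congrArg Complex.re h0; rw [Complex.sub_re, Complex.zero_re] at this; linarith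
    rw [rightMellin_smul, rightMellin_congr_ae hco, hM, integral_Ioi_cpow_eq hsw,
      rightMellin_congr_ae hff₀]
    field_simp

/-- **`Ψ_Q` is constant, case `w ≠ 0`**: with `c'·a^w/w + ∫_a^∞ η^{w−1}g₀ = 0` one gets `Ψ(ξ) = −c'/w` on
`[−a,a] ∖ {0}`. [cite: Burnol2004b, Prop. 4.3 (arXiv:math/0203120v7 p. 8, TeX l.711–731)] -/
theorem psi_cesaro_const {a : ℝ} (ha : 0 < a) {g₀ : ℝ → ℂ} (hg₀L : MemLp g₀ 2 volume)
    (hg₀e : ∀ x, g₀ (-x) = g₀ x) {c' : ℂ} (hg₀c : ∀ x, |x| ≤ a → g₀ x = c') {w : ℂ}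
    (hw : w.re < 1 / 2) (hw0 : w ≠ 0)
    (hvan : c' * (a : ℂ) ^ w / w + ∫ η in Ioi a, (η : ℂ) ^ (w - 1) * g₀ η = 0)
    {ξ : ℝ} (hξ0 : ξ ≠ 0) (hξ : |ξ| ≤ a) :
    (∫ v in Ioo (0 : ℝ) 1, ((v⁻¹ : ℝ) : ℂ) * ((v : ℂ) ^ (-w) * g₀ (v⁻¹ * ξ))) = -(c' / w) := by
  have hξp : 0 < |ξ| := abs_pos.2 hξ0
  have hξC : ((|ξ| : ℝ) : ℂ) ≠ 0 := Complex.ofReal_ne_zero.2 hξp.ne'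
  rw [psi_cesaro_eq ha hg₀L hg₀e hg₀c hw hξ0 hξ]
  have hP : ∫ η in Ioc |ξ| a, (η : ℂ) ^ (w - 1) = ((a : ℂ) ^ w - ((|ξ| : ℝ) : ℂ) ^ w) / w := by
    rw [← intervalIntegral.integral_of_le hξ,
      integral_cpow (Or.inr ⟨fun h ↦ hw0 (by linear_combination h), by
        rw [Set.uIcc_of_le hξ]; exact fun h ↦ by linarith [h.1]⟩), sub_add_cancel]
  have hT : ∫ η in Ioi a, (η : ℂ) ^ (w - 1) * g₀ η = -(c' * (a : ℂ) ^ w / w) := by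
    linear_combination hvan
  rw [hP, hT]
  have h1 : ((|ξ| : ℝ) : ℂ) ^ (-w) * ((|ξ| : ℝ) : ℂ) ^ w = 1 := by
    rw [Complex.cpow_neg, inv_mul_cancel₀]
    exact fun h ↦ hξC ((Complex.cpow_eq_zero_iff _ _).1 h).1
  field_simp
  linear_combination (-c') * h1

/-- **`Ψ_Q` is constant, case `w = 0`** (then `c' = 0`): `Ψ(ξ) = ∫_a^∞ η^{−1}g₀` on `[−a,a] ∖ {0}`.
[cite: Burnol2004b, Prop. 4.3 (arXiv:math/0203120v7 p. 8, TeX l.711–731)] -/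
theorem psi_cesaro_const_zero {a : ℝ} (ha : 0 < a) {g₀ : ℝ → ℂ} (hg₀L : MemLp g₀ 2 volume)
    (hg₀e : ∀ x, g₀ (-x) = g₀ x) (hg₀c : ∀ x, |x| ≤ a → g₀ x = 0)
    {ξ : ℝ} (hξ0 : ξ ≠ 0) (hξ : |ξ| ≤ a) :
    (∫ v in Ioo (0 : ℝ) 1, ((v⁻¹ : ℝ) : ℂ) * ((v : ℂ) ^ (-(0 : ℂ)) * g₀ (v⁻¹ * ξ))) =
      ∫ η in Ioi a, (η : ℂ) ^ ((0 : ℂ) - 1) * g₀ η := by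
  rw [psi_cesaro_eq ha hg₀L hg₀e hg₀c (by rw [Complex.zero_re]; norm_num) hξ0 hξ, neg_zero,
    Complex.cpow_zero, one_mul, zero_mul, zero_add]


/-! ### L. Prop. 4.3 on `K_a` -/

/-- `∫_{(0,∞)} t^{−s} u₀ = ∫_a^∞ t^{−s} u₀` for `u₀` vanishing on `[−a,a]` (`a > 0`). [folklore] -/
private theorem mellin_eq_setIntegral_Ioi_of_zero {a : ℝ} (ha : 0 < a) {u₀ : ℝ → ℂ}
    (hu₀c : ∀ x, |x| ≤ a → u₀ x = 0) (z : ℂ) :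
    mellin u₀ z = ∫ t in Ioi a, (t : ℂ) ^ (z - 1) * u₀ t := by
  have e : ∫ t in Ioi a, (t : ℂ) ^ (z - 1) * u₀ t =
      ∫ t in Ioi (0 : ℝ), (Ioi a).indicator (fun t : ℝ ↦ (t : ℂ) ^ (z - 1) * u₀ t) t := by
    rw [setIntegral_indicator measurableSet_Ioi, Ioi_inter_Ioi, sup_of_le_right ha.le]
  rw [e, mellin]
  refine setIntegral_congr_fun measurableSet_Ioi fun t ht ↦ ?_
  have ht0 : (0 : ℝ) < t := ht
  by_cases hta : a < t
  · rw [indicator_of_mem (mem_Ioi.2 hta), smul_eq_mul]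
  · rw [indicator_of_notMem (fun h : t ∈ Ioi a ↦ hta h), smul_eq_mul,
      hu₀c t (by rw [abs_of_pos ht0]; exact not_lt.1 hta), mul_zero]

/-- For `f ∈ K_a` with `𝒢_f(w) = 0` and `Re w < ½`: the tail moment `∫_a^∞ η^{w−1} g₀(η) dη` of a
representative `g₀` of `𝓕f` vanishes (`𝒢_{𝓕f}(1−w) = 𝒢_f(w)`, `𝒢_{𝓕f}(1−w) = Γ_ℝ(1−w)·(𝓕f)^(1−w)`).
[cite: Burnol2004b, Thm. 2.1 and Prop. 2.2 (arXiv:math/0203120v7 p. 5, TeX l.437–469)] -/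
theorem tail_moment_eq_zero_of_sonineK {a : ℝ} (ha : 0 < a) {f : Lp ℂ 2 (volume : Measure ℝ)}
    (hf : f ∈ sonineK a) {f₀ : ℝ → ℂ} (hff₀ : (f : ℝ → ℂ) =ᵐ[volume] f₀)
    (hf₀c : ∀ x, |x| ≤ a → f₀ x = 0) {g₀ : ℝ → ℂ}
    (hgg₀ : ((𝓕 f : Lp ℂ 2 (volume : Measure ℝ)) : ℝ → ℂ) =ᵐ[volume] g₀)
    (hg₀c : ∀ x, |x| ≤ a → g₀ x = 0) {w : ℂ} (hw : w.re < 1 / 2)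
    (hG : completedMellinEntire (f : ℝ → ℂ) w = 0) :
    ∫ η in Ioi a, (η : ℂ) ^ (w - 1) * g₀ η = 0 := by
  have hfe : f ∈ evenL2 := hf.1
  have hFK : (𝓕 f : Lp ℂ 2 (volume : Measure ℝ)) ∈ sonineK a := fourier_mem_sonineK hf
  have hFF : (𝓕 (𝓕 f : Lp ℂ 2 (volume : Measure ℝ)) : Lp ℂ 2 (volume : Measure ℝ)) = f :=
    fourier_fourier_eq_self_of_mem_evenL2 hfe
  have h1 : completedMellinEntire ((𝓕 f : Lp ℂ 2 (volume : Measure ℝ)) : ℝ → ℂ) (1 - w) = 0 := by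
    rw [completedMellinEntire_fourier_eq_of_mem_sonineK ha hf]
    simp only [sub_sub_cancel]
    exact hG
  have hΓ : Gammaℝ (1 - w) ≠ 0 := Gammaℝ_ne_zero_of_re_pos (by rw [Complex.sub_re, Complex.one_re]; linarith)
  rw [completedMellinEntire_eq_Gammaℝ_mul_of_mem_sonineK ha hFK hΓ, sub_sub_cancel] at h1
  have h2 : sonineMellinExt a a
      ((𝓕 (𝓕 f : Lp ℂ 2 (volume : Measure ℝ)) : Lp ℂ 2 (volume : Measure ℝ)) : ℝ → ℂ) w = 0 :=
    (mul_eq_zero.1 h1).resolve_left hΓ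
  have hFeven : ∀ᵐ x : ℝ, ((𝓕 f : Lp ℂ 2 (volume : Measure ℝ)) : ℝ → ℂ) (-x) =
      ((𝓕 f : Lp ℂ 2 (volume : Measure ℝ)) : ℝ → ℂ) x := fourier_mem_evenL2 hfe
  have hFa : ∀ᵐ x : ℝ, x ∈ Icc (-a) a → ((𝓕 f : Lp ℂ 2 (volume : Measure ℝ)) : ℝ → ℂ) x = 0 := by
    filter_upwards [hgg₀] with x hx hxI
    rw [hx]; exact hg₀c x (abs_le.2 ⟨hxI.1, hxI.2⟩)
  have hFFa : ∀ᵐ x : ℝ, x ∈ Icc (-a) a →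
      ((𝓕 (𝓕 f : Lp ℂ 2 (volume : Measure ℝ)) : Lp ℂ 2 (volume : Measure ℝ)) : ℝ → ℂ) x = 0 := by
    rw [hFF]
    filter_upwards [hff₀] with x hx hxI
    rw [hx]; exact hf₀c x (abs_le.2 ⟨hxI.1, hxI.2⟩)
  rw [sonineMellinExt_eq_mellin ha ha (𝓕 f : Lp ℂ 2 (volume : Measure ℝ)) hFeven hFa hFFa hw] at h2
  rw [← h2, show mellin ((𝓕 f : Lp ℂ 2 (volume : Measure ℝ)) : ℝ → ℂ) w = mellin g₀ w from by
    rw [mellin, mellin]; exact integral_congr_ae (by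
      filter_upwards [ae_restrict_of_ae (s := Ioi (0 : ℝ)) hgg₀] with t ht; rw [ht]),
    mellin_eq_setIntegral_Ioi_of_zero ha hg₀c]

/-- **Prop. 4.3, `K_a`, half-plane `Re w < ½`.** [cite: Burnol2004b, Prop. 4.3 (arXiv:math/0203120v7 p. 8, TeX l.711–731)] -/
theorem sonineK_div_of_re_lt_half {a : ℝ} (ha : 0 < a) {f : Lp ℂ 2 (volume : Measure ℝ)}
    (hf : f ∈ sonineK a) {w : ℂ} (hw : w.re < 1 / 2) (hG : completedMellinEntire (f : ℝ → ℂ) w = 0) :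
    ∃ h ∈ sonineK a, ∀ s : ℂ, 1 / 2 < s.re → s.re < 1 →
      rightMellin (h : ℝ → ℂ) s = rightMellin (f : ℝ → ℂ) s / (s - w) := by
  obtain ⟨hfe, hfz, hFz⟩ := hf
  obtain ⟨f₀, hf₀m, hff₀, hf₀e, hf₀c, hf₀L⟩ := exists_even_rep_const hfe (c := 0) hfz
  obtain ⟨g₀, hg₀m, hgg₀, hg₀e, hg₀c, hg₀L⟩ := exists_even_rep_const (fourier_mem_evenL2 hfe) (c := 0) hFz
  have hT := tail_moment_eq_zero_of_sonineK ha ⟨hfe, hfz, hFz⟩ hff₀ hf₀c hgg₀ hg₀c hw hG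
  have hΨ : ∀ ξ : ℝ, ξ ≠ 0 → |ξ| ≤ a →
      (∫ v in Ioo (0 : ℝ) 1, ((v⁻¹ : ℝ) : ℂ) * ((v : ℂ) ^ (-w) * g₀ (v⁻¹ * ξ))) = 0 := by
    intro ξ hξ0 hξ
    by_cases hw0 : w = 0
    · subst hw0
      rw [psi_cesaro_const_zero ha hg₀L hg₀e hg₀c hξ0 hξ]
      exact hT
    · rw [psi_cesaro_const ha hg₀L hg₀e hg₀c hw hw0 (by rw [hT, zero_mul, zero_div, add_zero]) hξ0 hξ]
      rw [zero_div, neg_zero]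
  obtain ⟨h, hhe, hh0, hhF, hhM⟩ := exists_cesaro_twisted ha f hf₀m hff₀ hf₀e hf₀c hg₀m hgg₀ hw hΨ
  refine ⟨h, ⟨hhe, ?_, hhF⟩, fun s hs hs1 ↦ hhM s hs hs1⟩
  filter_upwards [hh0] with x hx hxI
  rw [hx hxI, zero_div]

/-- **Prop. 4.3, `K_a`, half-plane `Re w > ½`** by Fourier symmetry: divide `(𝓕f)^` by `s − (1 − w)` and
transform back (`𝒢_{𝓕k}(s) = 𝒢_k(1−s)`). [cite: Burnol2004b, Prop. 4.3 and Prop. 2.2 (arXiv:math/0203120v7 pp. 5, 8; TeX l.459–468, 711–731)] -/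
theorem sonineK_div_of_half_lt_re {a : ℝ} (ha : 0 < a) {f : Lp ℂ 2 (volume : Measure ℝ)}
    (hf : f ∈ sonineK a) {w : ℂ} (hw : 1 / 2 < w.re) (hG : completedMellinEntire (f : ℝ → ℂ) w = 0) :
    ∃ h ∈ sonineK a, ∀ s : ℂ, 1 / 2 < s.re → s.re < 1 → s ≠ w →
      rightMellin (h : ℝ → ℂ) s = rightMellin (f : ℝ → ℂ) s / (s - w) := by
  have hfe : f ∈ evenL2 := hf.1
  have hFK : (𝓕 f : Lp ℂ 2 (volume : Measure ℝ)) ∈ sonineK a := fourier_mem_sonineK hf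
  have hFF : (𝓕 (𝓕 f : Lp ℂ 2 (volume : Measure ℝ)) : Lp ℂ 2 (volume : Measure ℝ)) = f :=
    fourier_fourier_eq_self_of_mem_evenL2 hfe
  have hw' : (1 - w).re < 1 / 2 := by rw [Complex.sub_re, Complex.one_re]; linarith
  have hG' : completedMellinEntire ((𝓕 f : Lp ℂ 2 (volume : Measure ℝ)) : ℝ → ℂ) (1 - w) = 0 := by
    rw [completedMellinEntire_fourier_eq_of_mem_sonineK ha hf]
    simp only [sub_sub_cancel]
    exact hG
  obtain ⟨k, hk, hkM⟩ := sonineK_div_of_re_lt_half ha hFK hw' hG'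
  have hFkK : (𝓕 k : Lp ℂ 2 (volume : Measure ℝ)) ∈ sonineK a := fourier_mem_sonineK hk
  refine ⟨(-1 : ℂ) • (𝓕 k : Lp ℂ 2 (volume : Measure ℝ)), smul_mem_sonineK _ hFkK, fun s hs hs1 hsw ↦ ?_⟩
  have hΓs : Gammaℝ s ≠ 0 := Gammaℝ_ne_zero_of_re_pos (by linarith)
  have hMk := hasCompletedMellinEntire_of_mem_sonineK ha hk
  have hMFk := hasCompletedMellinEntire_of_mem_sonineK ha hFkK
  have hMf := hasCompletedMellinEntire_of_mem_sonineK ha hf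
  have hMF := hasCompletedMellinEntire_of_mem_sonineK ha hFK
  -- `𝒢_k(z)·(z − (1−w)) = 𝒢_{𝓕f}(z)` for all `z` (identity theorem from the strip)
  have hA : ∀ z : ℂ, completedMellinEntire (k : ℝ → ℂ) z * (z - (1 - w)) =
      completedMellinEntire ((𝓕 f : Lp ℂ 2 (volume : Measure ℝ)) : ℝ → ℂ) z := by
    have hd1 : Differentiable ℂ fun z ↦ completedMellinEntire (k : ℝ → ℂ) z * (z - (1 - w)) :=
      hMk.1.mul (differentiable_id.sub_const _)
    have ha1 : AnalyticOnNhd ℂ (fun z ↦ completedMellinEntire (k : ℝ → ℂ) z * (z - (1 - w))) Set.univ :=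
      hd1.differentiableOn.analyticOnNhd isOpen_univ
    have ha2 : AnalyticOnNhd ℂ (completedMellinEntire ((𝓕 f : Lp ℂ 2 (volume : Measure ℝ)) : ℝ → ℂ))
        Set.univ := hMF.1.differentiableOn.analyticOnNhd isOpen_univ
    have hO : IsOpen {z : ℂ | 1 / 2 < z.re ∧ z.re < 1} :=
      (isOpen_lt continuous_const Complex.continuous_re).inter (isOpen_lt Complex.continuous_re continuous_const)
    have hz0 : (⟨3 / 4, 0⟩ : ℂ) ∈ {z : ℂ | 1 / 2 < z.re ∧ z.re < 1} :=
      ⟨show (1 : ℝ) / 2 < 3 / 4 by norm_num, show (3 : ℝ) / 4 < 1 by norm_num⟩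
    have hev : (fun z ↦ completedMellinEntire (k : ℝ → ℂ) z * (z - (1 - w))) =ᶠ[𝓝 (⟨3 / 4, 0⟩ : ℂ)]
        completedMellinEntire ((𝓕 f : Lp ℂ 2 (volume : Measure ℝ)) : ℝ → ℂ) := by
      filter_upwards [hO.mem_nhds hz0] with z hz
      have hne : z - (1 - w) ≠ 0 := by
        intro h0
        have := congrArg Complex.re h0
        rw [Complex.sub_re, Complex.sub_re, Complex.one_re, Complex.zero_re] at this
        linarith [hz.1]
      rw [hMk.2 z hz.1 hz.2, hMF.2 z hz.1 hz.2, hkM z hz.1 hz.2]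
      field_simp
    have h := ha1.eqOn_of_preconnected_of_eventuallyEq ha2 isPreconnected_univ (Set.mem_univ _) hev
    exact fun z ↦ h (Set.mem_univ z)
  -- at `z = 1 − s`
  have hws : w - s ≠ 0 := sub_ne_zero.2 (Ne.symm hsw)
  have key : rightMellin ((𝓕 k : Lp ℂ 2 (volume : Measure ℝ)) : ℝ → ℂ) s * (w - s) =
      rightMellin (f : ℝ → ℂ) s := by
    have e1 : completedMellinEntire ((𝓕 k : Lp ℂ 2 (volume : Measure ℝ)) : ℝ → ℂ) s =
        completedMellinEntire (k : ℝ → ℂ) (1 - s) := by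
      rw [completedMellinEntire_fourier_eq_of_mem_sonineK ha hk]
    have e2 := hA (1 - s)
    rw [show (1 - s - (1 - w)) = w - s by ring, ← e1, hMFk.2 s hs hs1,
      completedMellinEntire_fourier_eq_of_mem_sonineK ha hf] at e2
    simp only [sub_sub_cancel] at e2
    rw [hMf.2 s hs hs1, mul_assoc] at e2
    exact mul_left_cancel₀ hΓs e2
  rw [rightMellin_smul]
  have hsw' : s - w ≠ 0 := sub_ne_zero.2 hsw
  have key' : rightMellin ((𝓕 k : Lp ℂ 2 (volume : Measure ℝ)) : ℝ → ℂ) s =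
      rightMellin (f : ℝ → ℂ) s / (w - s) := by
    rw [← key]; field_simp
  rw [key']
  field_simp
  ring


/-! ### M. Prop. 4.3 on `L_a` -/

/-- Representatives for `f ∈ L_a`: even `f₀ = c` on `[−a,a]`, even `g₀ = c'` on `[−a,a]` for `𝓕f`. [folklore] -/
private theorem exists_reps_of_mem_sonineL {a : ℝ} {f : Lp ℂ 2 (volume : Measure ℝ)} (hf : f ∈ sonineL a) :
    ∃ f₀ g₀ : ℝ → ℂ, ∃ c c' : ℂ, Measurable f₀ ∧ (f : ℝ → ℂ) =ᵐ[volume] f₀ ∧ (∀ x, f₀ (-x) = f₀ x) ∧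
      (∀ x, |x| ≤ a → f₀ x = c) ∧ MemLp f₀ 2 volume ∧ Measurable g₀ ∧
      ((𝓕 f : Lp ℂ 2 (volume : Measure ℝ)) : ℝ → ℂ) =ᵐ[volume] g₀ ∧ (∀ x, g₀ (-x) = g₀ x) ∧
      (∀ x, |x| ≤ a → g₀ x = c') ∧ MemLp g₀ 2 volume ∧
      (∀ᵐ x : ℝ, x ∈ Ioo 0 a → (f : ℝ → ℂ) x = c) ∧
      (∀ᵐ x : ℝ, x ∈ Ioo 0 a → ((𝓕 f : Lp ℂ 2 (volume : Measure ℝ)) : ℝ → ℂ) x = c') := by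
  obtain ⟨hfe, ⟨c, hfc⟩, ⟨c', hFc⟩⟩ := hf
  obtain ⟨f₀, hf₀m, hff₀, hf₀e, hf₀c, hf₀L⟩ := exists_even_rep_const hfe hfc
  obtain ⟨g₀, hg₀m, hgg₀, hg₀e, hg₀c, hg₀L⟩ := exists_even_rep_const (fourier_mem_evenL2 hfe) hFc
  exact ⟨f₀, g₀, c, c', hf₀m, hff₀, hf₀e, hf₀c, hf₀L, hg₀m, hgg₀, hg₀e, hg₀c, hg₀L, hfc, hFc⟩

/-- **Prop. 4.3, `L_a`, half-plane `Re w < ½`, `w ≠ 0, −2, −4, …`.** The twisted Cesàro average of `f` is in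
`L_a` with Mellin transform `f̂(s)/(s − w)`; the `𝓕`-side consumes `G_{𝓕f}(1 − w) = 0`, which is
`G_f(w) = 0` through the functional equation of Prop. 2.2. [cite: Burnol2004b, Prop. 4.3 (arXiv:math/0203120v7 p. 8, TeX l.711–731)] -/
theorem sonineL_div_of_re_lt_half {a : ℝ} (ha : 0 < a) {f : Lp ℂ 2 (volume : Measure ℝ)}
    (hf : f ∈ sonineL a) {w : ℂ} (hw : w.re < 1 / 2) (hw0 : w ≠ 0)
    (hwn : ∀ n : ℕ, w ≠ -2 * ((n : ℂ) + 1)) (hG : rightMellinExt f w = 0) :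
    ∃ h ∈ sonineL a, ∀ s : ℂ, 1 / 2 < s.re → s.re < 1 →
      rightMellin (h : ℝ → ℂ) s = rightMellin (f : ℝ → ℂ) s / (s - w) := by
  obtain ⟨f₀, g₀, c, c', hf₀m, hff₀, hf₀e, hf₀c, hf₀L, hg₀m, hgg₀, hg₀e, hg₀c, hg₀L, hfc, hFc⟩ :=
    exists_reps_of_mem_sonineL hf
  have hFL : (𝓕 f : Lp ℂ 2 (volume : Measure ℝ)) ∈ sonineL a := fourier_mem_sonineL hf
  -- the functional equation at `1 − w`: `H(1 − w) = 0`
  have hw1 : 1 / 2 < (1 - w).re := by rw [Complex.sub_re, Complex.one_re]; linarith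
  have hΓ : Gammaℝ (1 - w) ≠ 0 := Gammaℝ_ne_zero_of_re_pos (by linarith)
  have hH : rightMellinExt (𝓕 f : Lp ℂ 2 (volume : Measure ℝ)) (1 - w) = 0 := by
    have hFE := SonineLContinuation.rightMellinExt_functionalEquation_of_mem_sonineL ha hf (1 - w) (fun n h ↦ by
      have := congrArg Complex.re h
      simp at this; linarith) (fun n h ↦ by
      rcases n with _ | n
      · apply hw0; linear_combination -h
      · apply hwn n; push_cast at h ⊢; linear_combination -h)
    rw [sub_sub_cancel, hG, mul_zero] at hFE
    exact (mul_eq_zero.1 hFE).resolve_left hΓ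
  -- explicit value of the continuation of `(𝓕f)^` at `1 − w`
  have hvan : c' * (a : ℂ) ^ w / w + ∫ η in Ioi a, (η : ℂ) ^ (w - 1) * g₀ η = 0 := by
    have h := rightMellinExt_eq_of_rep ha hFL hgg₀ hg₀c hw1 (by
      intro h0; apply hw0; linear_combination -h0)
    rw [hH, sub_sub_cancel] at h
    rw [show (w - 1 : ℂ) = -(1 - w) by ring]
    exact h.symm
  have hΨ : ∀ ξ : ℝ, ξ ≠ 0 → |ξ| ≤ a →
      (∫ v in Ioo (0 : ℝ) 1, ((v⁻¹ : ℝ) : ℂ) * ((v : ℂ) ^ (-w) * g₀ (v⁻¹ * ξ))) = -(c' / w) :=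
    fun ξ hξ0 hξ ↦ psi_cesaro_const ha hg₀L hg₀e hg₀c hw hw0 hvan hξ0 hξ
  obtain ⟨h, hhe, hh0, hhF, hhM⟩ := exists_cesaro_twisted ha f hf₀m hff₀ hf₀e hf₀c hg₀m hgg₀ hw hΨ
  exact ⟨h, ⟨hhe, ⟨_, hh0⟩, ⟨_, hhF⟩⟩, fun s hs hs1 ↦ hhM s hs hs1⟩

/-- **Prop. 4.3, `L_a`, half-plane `Re w ≥ 1`, `w ≠ 1`.** The twisted tail average of `f` is in `L_a`
with Mellin transform `f̂(s)/(s − w)`; the support side consumes `G_f(w) = 0` through the explicit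
continuation. [cite: Burnol2004b, Prop. 4.3 (arXiv:math/0203120v7 p. 8, TeX l.711–731)] -/
theorem sonineL_div_of_one_le_re {a : ℝ} (ha : 0 < a) {f : Lp ℂ 2 (volume : Measure ℝ)}
    (hf : f ∈ sonineL a) {w : ℂ} (hw : 1 ≤ w.re) (hw1 : w ≠ 1) (hG : rightMellinExt f w = 0) :
    ∃ h ∈ sonineL a, ∀ s : ℂ, 1 / 2 < s.re → s.re < 1 →
      rightMellin (h : ℝ → ℂ) s = rightMellin (f : ℝ → ℂ) s / (s - w) := by
  obtain ⟨f₀, g₀, c, c', hf₀m, hff₀, hf₀e, hf₀c, hf₀L, hg₀m, hgg₀, hg₀e, hg₀c, hg₀L, hfc, hFc⟩ :=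
    exists_reps_of_mem_sonineL hf
  have hw' : 1 / 2 < w.re := by linarith
  have hvan : c * (a : ℂ) ^ (1 - w) / (1 - w) + ∫ u in Ioi a, (u : ℂ) ^ (-w) * f₀ u = 0 := by
    rw [← rightMellinExt_eq_of_rep ha hf hff₀ hf₀c hw' hw1, hG]
  obtain ⟨h, hhe, hh0, hhF, hhM⟩ :=
    exists_tail_twisted ha f hf₀m hff₀ hf₀e hf₀c hg₀m hgg₀ hg₀c hw' hw1 hvan
  exact ⟨h, ⟨hhe, ⟨_, hh0⟩, ⟨_, hhF⟩⟩, fun s hs hs1 ↦ hhM s hs hs1 (by linarith)⟩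

/-- **Prop. 4.3, `L_a`, strip `½ < Re w < 1`** by Fourier symmetry from the `Re w < ½` case applied to
`𝓕f` at `1 − w` (continuations compared on `ℂ ∖ {1}`, functional equation of Prop. 2.2).
[cite: Burnol2004b, Prop. 4.3 and Prop. 2.2 (arXiv:math/0203120v7 pp. 5, 8; TeX l.459–468, 711–731)] -/
theorem sonineL_div_of_mem_strip {a : ℝ} (ha : 0 < a) {f : Lp ℂ 2 (volume : Measure ℝ)}
    (hf : f ∈ sonineL a) {w : ℂ} (hw : 1 / 2 < w.re) (hw1 : w.re < 1) (hG : rightMellinExt f w = 0) :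
    ∃ h ∈ sonineL a, ∀ s : ℂ, 1 / 2 < s.re → s.re < 1 → s ≠ w →
      rightMellin (h : ℝ → ℂ) s = rightMellin (f : ℝ → ℂ) s / (s - w) := by
  have hfe : f ∈ evenL2 := hf.1
  have hFL : (𝓕 f : Lp ℂ 2 (volume : Measure ℝ)) ∈ sonineL a := fourier_mem_sonineL hf
  have hFF : (𝓕 (𝓕 f : Lp ℂ 2 (volume : Measure ℝ)) : Lp ℂ 2 (volume : Measure ℝ)) = f :=
    fourier_fourier_eq_self_of_mem_evenL2 hfe
  have hw' : (1 - w).re < 1 / 2 := by rw [Complex.sub_re, Complex.one_re]; linarith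
  have hw0' : (1 : ℂ) - w ≠ 0 := by
    intro h; have := congrArg Complex.re h; simp at this; linarith
  have hwn' : ∀ n : ℕ, (1 : ℂ) - w ≠ -2 * ((n : ℂ) + 1) := by
    intro n h; have := congrArg Complex.re h; simp at this; linarith
  -- `G_{𝓕f}(1 − w) = 0` by the functional equation at `1 − w`
  have hΓ : Gammaℝ (1 - w) ≠ 0 := Gammaℝ_ne_zero_of_re_pos (by simp; linarith)
  have hG' : rightMellinExt (𝓕 f : Lp ℂ 2 (volume : Measure ℝ)) (1 - w) = 0 := by
    have hFE := SonineLContinuation.rightMellinExt_functionalEquation_of_mem_sonineL ha hf (1 - w) (fun n h ↦ by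
      have := congrArg Complex.re h; simp at this; linarith) (fun n h ↦ by
      have := congrArg Complex.re h; simp at this; linarith)
    rw [sub_sub_cancel, hG, mul_zero] at hFE
    exact (mul_eq_zero.1 hFE).resolve_left hΓ
  obtain ⟨k, hk, hkM⟩ := sonineL_div_of_re_lt_half ha hFL hw' hw0' hwn' hG'
  have hFk : (𝓕 k : Lp ℂ 2 (volume : Measure ℝ)) ∈ sonineL a := fourier_mem_sonineL hk
  refine ⟨(-1 : ℂ) • (𝓕 k : Lp ℂ 2 (volume : Measure ℝ)), smul_mem_sonineL _ hFk, fun s hs hs1 hsw ↦ ?_⟩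
  have hck := hasRightMellinContinuation_rightMellinExt_of_mem_sonineL ha hk
  have hcFk := hasRightMellinContinuation_rightMellinExt_of_mem_sonineL ha hFk
  have hcf := hasRightMellinContinuation_rightMellinExt_of_mem_sonineL ha hf
  have hcF := hasRightMellinContinuation_rightMellinExt_of_mem_sonineL ha hFL
  -- `k~(z)·(z − (1 − w)) = (𝓕f)~(z)` on `ℂ ∖ {1}` (identity theorem from the strip)
  have hA : ∀ z : ℂ, z ≠ 1 → rightMellinExt k z * (z - (1 - w)) =
      rightMellinExt (𝓕 f : Lp ℂ 2 (volume : Measure ℝ)) z := by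
    have hopen : IsOpen {z : ℂ | z ≠ 1} := isOpen_ne
    have hconn : IsPreconnected {z : ℂ | z ≠ 1} :=
      (isConnected_compl_singleton_of_one_lt_rank (by simp) (1 : ℂ)).isPreconnected
    have ha1 : AnalyticOnNhd ℂ (fun z ↦ rightMellinExt k z * (z - (1 - w))) {z : ℂ | z ≠ 1} :=
      (hck.1.mul ((differentiable_id.sub_const _).differentiableOn)).analyticOnNhd hopen
    have ha2 : AnalyticOnNhd ℂ (rightMellinExt (𝓕 f : Lp ℂ 2 (volume : Measure ℝ))) {z : ℂ | z ≠ 1} :=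
      hcF.1.analyticOnNhd hopen
    have hO : IsOpen {z : ℂ | 1 / 2 < z.re ∧ z.re < 1} :=
      (isOpen_lt continuous_const Complex.continuous_re).inter (isOpen_lt Complex.continuous_re continuous_const)
    have hz0 : (⟨3 / 4, 0⟩ : ℂ) ∈ {z : ℂ | 1 / 2 < z.re ∧ z.re < 1} :=
      ⟨show (1 : ℝ) / 2 < 3 / 4 by norm_num, show (3 : ℝ) / 4 < 1 by norm_num⟩
    have hz0' : (⟨3 / 4, 0⟩ : ℂ) ∈ {z : ℂ | z ≠ 1} := by
      intro h; have := congrArg Complex.re h; simp at this; norm_num at this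
    have hev : (fun z ↦ rightMellinExt k z * (z - (1 - w))) =ᶠ[𝓝 (⟨3 / 4, 0⟩ : ℂ)]
        rightMellinExt (𝓕 f : Lp ℂ 2 (volume : Measure ℝ)) := by
      filter_upwards [hO.mem_nhds hz0] with z hz
      have hne : z - (1 - w) ≠ 0 := by
        intro h0
        have := congrArg Complex.re h0
        rw [Complex.sub_re, Complex.sub_re, Complex.one_re, Complex.zero_re] at this
        linarith [hz.1]
      rw [hck.2 z hz.1 hz.2, hcF.2 z hz.1 hz.2, hkM z hz.1 hz.2]
      field_simp
    have h := ha1.eqOn_of_preconnected_of_eventuallyEq ha2 hconn hz0' hev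
    exact fun z hz ↦ h hz
  -- at `z = 1 − s`
  have hΓs : Gammaℝ s ≠ 0 := Gammaℝ_ne_zero_of_re_pos (by linarith)
  have hs0 : ∀ n : ℕ, s ≠ -2 * (n : ℂ) := fun n h ↦ by
    have := congrArg Complex.re h; simp at this; linarith
  have hs1' : ∀ n : ℕ, s ≠ 1 + 2 * (n : ℂ) := fun n h ↦ by
    have := congrArg Complex.re h; simp at this; linarith
  have hws : w - s ≠ 0 := sub_ne_zero.2 (Ne.symm hsw)
  have key : rightMellin ((𝓕 k : Lp ℂ 2 (volume : Measure ℝ)) : ℝ → ℂ) s * (w - s) =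
      rightMellin (f : ℝ → ℂ) s := by
    -- FE for `k` at `s` and for `𝓕f` at `s`
    have e1 := SonineLContinuation.rightMellinExt_functionalEquation_of_mem_sonineL ha hk s hs0 hs1'
    have e2 := SonineLContinuation.rightMellinExt_functionalEquation_of_mem_sonineL ha hFL s hs0 hs1'
    rw [hFF] at e2
    have e3 := hA (1 - s) (by intro h; have := congrArg Complex.re h; simp at this; linarith)
    rw [show (1 - s - (1 - w)) = w - s by ring] at e3
    -- assemble: Γℝ s · (𝓕k)~(s) · (w − s) = Γℝ(1−s) k~(1−s) (w−s) = Γℝ(1−s) (𝓕f)~(1−s) = Γℝ s f~(s)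
    have e4 : Gammaℝ s * (rightMellinExt (𝓕 k : Lp ℂ 2 (volume : Measure ℝ)) s * (w - s)) =
        Gammaℝ s * rightMellinExt f s := by
      calc Gammaℝ s * (rightMellinExt (𝓕 k : Lp ℂ 2 (volume : Measure ℝ)) s * (w - s))
          = (Gammaℝ (1 - s) * rightMellinExt k (1 - s)) * (w - s) := by rw [← e1]; ring
        _ = Gammaℝ (1 - s) * rightMellinExt (𝓕 f : Lp ℂ 2 (volume : Measure ℝ)) (1 - s) := by
            rw [mul_assoc, e3]
        _ = Gammaℝ s * rightMellinExt f s := by rw [← e2]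
    have e5 := mul_left_cancel₀ hΓs e4
    rw [hcFk.2 s hs hs1, hcf.2 s hs hs1] at e5
    exact e5
  rw [rightMellin_smul]
  have hsw' : s - w ≠ 0 := sub_ne_zero.2 hsw
  have key' : rightMellin ((𝓕 k : Lp ℂ 2 (volume : Measure ℝ)) : ℝ → ℂ) s =
      rightMellin (f : ℝ → ℂ) s / (w - s) := by
    rw [← key]; field_simp
  rw [key']
  field_simp
  ring


/-! ### N. Prop. 4.3 off the critical line: the two clauses assembled -/

/-- **Prop. 4.3, `K_a` clause, for `Re w ≠ ½`.** "If `G(s)` belongs to `K̂_a` and `π^{−s/2}Γ(s/2)G(s)`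
vanishes at `s = w` then `G(s)/(s−w)` again belongs to `K̂_a`" — for every `w` off the critical line
(on the line `Re w = ½` neither twisted average is `L²`-bounded and a limiting argument is needed; not
in this file). [cite: Burnol2004b, Prop. 4.3 (arXiv:math/0203120v7 p. 8, TeX l.711–731)] -/
theorem sonineK_div_of_re_ne_half {a : ℝ} (ha : 0 < a) {f : Lp ℂ 2 (volume : Measure ℝ)}
    (hf : f ∈ sonineK a) {w : ℂ} (hw : w.re ≠ 1 / 2) (hG : completedMellinEntire (f : ℝ → ℂ) w = 0) :
    ∃ h ∈ sonineK a, ∀ s : ℂ, 1 / 2 < s.re → s.re < 1 → s ≠ w →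
      rightMellin (h : ℝ → ℂ) s = rightMellin (f : ℝ → ℂ) s / (s - w) := by
  rcases lt_or_gt_of_ne hw with h | h
  · obtain ⟨k, hk, hkM⟩ := sonineK_div_of_re_lt_half ha hf h hG
    exact ⟨k, hk, fun s hs hs1 _ ↦ hkM s hs hs1⟩
  · exact sonineK_div_of_half_lt_re ha hf h hG

/-- **Prop. 4.3, `L_a` clause, for `Re w ≠ ½` and `w ≠ 0`.** "If `G(s)` belongs to `L̂_a` and
`s(s−1)π^{−s/2}Γ(s/2)G(s)` vanishes at `s = w` then `G(s)/(s−w)` again belongs to `L̂_a`" — typed as in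
`Burnol2004b_prop4_3R` (`w ≠ 1`, `w ∉ {−2, −4, …}`, hypothesis `G_f(w) = 0`), here for `w` off the critical
line and `w ≠ 0` (at `w = 0` the `𝓕`-side needs `c' = 2·G_f(0)`; on `Re w = ½` a limiting argument; both
not in this file). [cite: Burnol2004b, Prop. 4.3 (arXiv:math/0203120v7 p. 8, TeX l.711–731)] -/
theorem sonineL_div_of_re_ne_half {a : ℝ} (ha : 0 < a) {f : Lp ℂ 2 (volume : Measure ℝ)}
    (hf : f ∈ sonineL a) {w : ℂ} (hw : w.re ≠ 1 / 2) (hw0 : w ≠ 0) (hw1 : w ≠ 1)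
    (hwn : ∀ n : ℕ, w ≠ -2 * ((n : ℂ) + 1)) (hG : rightMellinExt f w = 0) :
    ∃ h ∈ sonineL a, ∀ s : ℂ, 1 / 2 < s.re → s.re < 1 → s ≠ w →
      rightMellin (h : ℝ → ℂ) s = rightMellin (f : ℝ → ℂ) s / (s - w) := by
  rcases lt_or_gt_of_ne hw with h | h
  · obtain ⟨k, hk, hkM⟩ := sonineL_div_of_re_lt_half ha hf h hw0 hwn hG
    exact ⟨k, hk, fun s hs hs1 _ ↦ hkM s hs hs1⟩
  · by_cases h1 : w.re < 1
    · exact sonineL_div_of_mem_strip ha hf h h1 hG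
    · obtain ⟨k, hk, hkM⟩ := sonineL_div_of_one_le_re ha hf (not_lt.1 h1) hw1 hG
      exact ⟨k, hk, fun s hs hs1 _ ↦ hkM s hs hs1⟩


/-! ### O. The point `w = 0` of the `L_a` clause: `c' = 2·G_f(0)` -/

/-- `Γ_ℝ` is differentiable off its poles. [folklore] -/
private theorem differentiableAt_Gammaℝ' {z : ℂ} (hz : Gammaℝ z ≠ 0) : DifferentiableAt ℂ Gammaℝ z := by
  have h : ∀ m : ℕ, z / 2 ≠ -m := by
    intro m hm
    apply hz
    rw [Gammaℝ_eq_zero_iff]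
    exact ⟨m, by linear_combination 2 * hm⟩
  have h1 : DifferentiableAt ℂ (fun s : ℂ ↦ (π : ℂ) ^ (-s / 2)) z :=
    ((differentiableAt_id.neg.div_const 2).const_cpow (Or.inl (ofReal_ne_zero.2 Real.pi_pos.ne')))
  have h2 : DifferentiableAt ℂ (fun s : ℂ ↦ Complex.Gamma (s / 2)) z :=
    (Complex.differentiableAt_Gamma _ h).comp z (differentiableAt_id.div_const 2)
  have e : Gammaℝ = fun s ↦ (π : ℂ) ^ (-s / 2) * Complex.Gamma (s / 2) := funext Gammaℝ_def
  rw [e]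
  exact h1.mul h2

/-- **The Fourier-side constant of `f ∈ L_a` is `c' = 2·G_f(0)`** ("`Res_{s=0} M(f) = 2·G_f(0)`",
Prop. 2.2: compare the residues at `s = 1` of the two sides of the functional equation
`Γ_ℝ(s)·G_{𝓕f}(s) = Γ_ℝ(1−s)·G_f(1−s)`: `Res_{s=1} G_{𝓕f} = −c'` and `(s−1)Γ_ℝ(1−s) → −2`).
[cite: Burnol2004b, Prop. 2.2 (arXiv:math/0203120v7 p. 5, TeX l.460–469)] -/
theorem fourierConst_eq_two_mul_rightMellinExt_zero {a : ℝ} (ha : 0 < a)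
    {f : Lp ℂ 2 (volume : Measure ℝ)} (hf : f ∈ sonineL a) {g₀ : ℝ → ℂ}
    (hgg₀ : ((𝓕 f : Lp ℂ 2 (volume : Measure ℝ)) : ℝ → ℂ) =ᵐ[volume] g₀) {c' : ℂ}
    (hg₀c : ∀ x, |x| ≤ a → g₀ x = c') : c' = 2 * rightMellinExt f 0 := by
  obtain ⟨f₀, g₁, c, c₁, hf₀m, hff₀, hf₀e, hf₀c, hf₀L, -, -, -, -, -, -, -⟩ := exists_reps_of_mem_sonineL hf
  have hfe : f ∈ evenL2 := hf.1
  set F : Lp ℂ 2 (volume : Measure ℝ) := (𝓕 f : Lp ℂ 2 (volume : Measure ℝ)) with hFdef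
  have hFF : (𝓕 F : Lp ℂ 2 (volume : Measure ℝ)) = f := fourier_fourier_eq_self_of_mem_evenL2 hfe
  have hFeven : ∀ᵐ x : ℝ, (F : ℝ → ℂ) (-x) = (F : ℝ → ℂ) x := fourier_mem_evenL2 hfe
  have hFc2 : ∀ᵐ x : ℝ, x ∈ Ioo (-a) a → (F : ℝ → ℂ) x = c' := by
    filter_upwards [hgg₀] with x hx hxI
    rw [hx]; exact hg₀c x (abs_le.2 ⟨hxI.1.le, hxI.2.le⟩)
  have hFFc2 : ∀ᵐ x : ℝ, x ∈ Ioo (-a) a → ((𝓕 F : Lp ℂ 2 (volume : Measure ℝ)) : ℝ → ℂ) x = c := by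
    rw [hFF]
    filter_upwards [hff₀] with x hx hxI
    rw [hx]; exact hf₀c x (abs_le.2 ⟨hxI.1.le, hxI.2.le⟩)
  -- `(s − 1)·G_F(s) → −c'`
  have hT1 : Tendsto (fun s ↦ (s - 1) * rightMellinExt F s) (𝓝[≠] (1 : ℂ)) (𝓝 (-c')) := by
    have h := SonineLContinuation.explicit_tendsto_sub_one_mul (c := c') (c' := c) ha F rfl
    have heq := SonineLContinuation.rightMellinExt_eqOn_explicit ha F hFeven hFc2 hFFc2 rfl
    refine h.congr' ?_
    filter_upwards [self_mem_nhdsWithin] with s hs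
    rw [heq hs]
  -- the functional equation near `1`
  have hcf := hasRightMellinContinuation_rightMellinExt_of_mem_sonineL ha hf
  have hball : ∀ s : ℂ, s ∈ Metric.ball (1 : ℂ) (1 / 2) → s ≠ 1 →
      Gammaℝ s * rightMellinExt F s = Gammaℝ (1 - s) * rightMellinExt f (1 - s) := by
    intro s hs hs1
    have hre : 1 / 2 < s.re := by
      rw [Metric.mem_ball, dist_eq_norm] at hs
      have h1 : |(s - 1).re| ≤ ‖s - 1‖ := abs_re_le_norm (s - 1)
      rw [Complex.sub_re, Complex.one_re] at h1
      have h2 := (abs_lt.1 (lt_of_le_of_lt h1 hs)).1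
      linarith
    have him : |s.im| < 1 / 2 := by
      rw [Metric.mem_ball, dist_eq_norm] at hs
      have h1 : |(s - 1).im| ≤ ‖s - 1‖ := abs_im_le_norm (s - 1)
      rw [Complex.sub_im, Complex.one_im, sub_zero] at h1
      exact lt_of_le_of_lt h1 hs
    refine SonineLContinuation.rightMellinExt_functionalEquation_of_mem_sonineL ha hf s (fun n h ↦ ?_)
      (fun n h ↦ ?_)
    · have := congrArg Complex.re h; simp at this; linarith
    · rcases n with _ | n
      · simp at h; exact hs1 h
      · have := congrArg Complex.re h
        simp at this
        have h3 : ‖s - 1‖ < 1 / 2 := by rwa [Metric.mem_ball, dist_eq_norm] at hs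
        have h4 : |(s - 1).re| ≤ ‖s - 1‖ := abs_re_le_norm (s - 1)
        rw [Complex.sub_re, Complex.one_re, this] at h4
        have h5 : (0 : ℝ) ≤ n := Nat.cast_nonneg n
        rw [abs_of_nonneg (by linarith)] at h4
        linarith
  -- left side: `(s−1)Γℝ(s)G_F(s) → Γℝ(1)(−c') = −c'`
  have hΓ1 : ContinuousAt Gammaℝ (1 : ℂ) :=
    (differentiableAt_Gammaℝ' (by rw [Gammaℝ_one]; exact one_ne_zero)).continuousAt
  have hL : Tendsto (fun s ↦ Gammaℝ s * ((s - 1) * rightMellinExt F s)) (𝓝[≠] (1 : ℂ)) (𝓝 (-c')) := by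
    have := (hΓ1.tendsto.mono_left nhdsWithin_le_nhds).mul hT1
    rwa [Gammaℝ_one, one_mul] at this
  -- right side: `(s−1)Γℝ(1−s)G_f(1−s) = −2 π^{−(1−s)/2} Γ((1−s)/2 + 1) G_f(1−s) → −2 G_f(0)`
  set ψ : ℂ → ℂ := fun s ↦ -2 * ((π : ℂ) ^ (-(1 - s) / 2) * Complex.Gamma ((1 - s) / 2 + 1)) *
    rightMellinExt f (1 - s) with hψ
  have hψ_eq : ∀ s : ℂ, s ≠ 1 → (s - 1) * (Gammaℝ (1 - s) * rightMellinExt f (1 - s)) = ψ s := by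
    intro s hs
    have hz : (1 - s) / 2 ≠ 0 := by
      intro h; apply hs
      have : (1 : ℂ) - s = 0 := by linear_combination 2 * h
      linear_combination -this
    rw [hψ]
    dsimp only
    rw [Gammaℝ_def, Complex.Gamma_add_one _ hz]
    field_simp
    ring
  have hψc : ContinuousAt ψ (1 : ℂ) := by
    have h1 : ContinuousAt (fun s : ℂ ↦ (π : ℂ) ^ (-(1 - s) / 2)) 1 :=
      (((differentiableAt_id.const_sub (1 : ℂ)).neg.div_const 2).const_cpow
        (Or.inl (ofReal_ne_zero.2 Real.pi_pos.ne'))).continuousAt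
    have h2 : ContinuousAt (fun s : ℂ ↦ Complex.Gamma ((1 - s) / 2 + 1)) 1 := by
      have hd : DifferentiableAt ℂ Complex.Gamma (1 : ℂ) := by
        refine Complex.differentiableAt_Gamma _ fun m h ↦ ?_
        have := congrArg Complex.re h
        simp at this
        have h5 : (0 : ℝ) ≤ m := Nat.cast_nonneg m
        linarith
      have hg : ContinuousAt (fun s : ℂ ↦ (1 - s) / 2 + 1) 1 :=
        (((continuous_const.sub continuous_id).div_const _).add continuous_const).continuousAt
      exact ContinuousAt.comp_of_eq hd.continuousAt hg (by norm_num)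
    have h3 : ContinuousAt (fun s : ℂ ↦ rightMellinExt f (1 - s)) 1 := by
      have hd : DifferentiableAt ℂ (rightMellinExt f) 0 :=
        (hcf.1 0 zero_ne_one).differentiableAt (isOpen_ne.mem_nhds zero_ne_one)
      have hg : ContinuousAt (fun s : ℂ ↦ 1 - s) 1 := (continuous_const.sub continuous_id).continuousAt
      exact ContinuousAt.comp_of_eq hd.continuousAt hg (sub_self _)
    exact ((h1.mul h2).const_mul _ |>.mul h3)
  have hR : Tendsto (fun s ↦ (s - 1) * (Gammaℝ (1 - s) * rightMellinExt f (1 - s))) (𝓝[≠] (1 : ℂ))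
      (𝓝 (-2 * rightMellinExt f 0)) := by
    have hlim : Tendsto ψ (𝓝[≠] (1 : ℂ)) (𝓝 (ψ 1)) := hψc.tendsto.mono_left nhdsWithin_le_nhds
    have hψ1 : ψ 1 = -2 * rightMellinExt f 0 := by
      rw [hψ]; dsimp only
      rw [sub_self, neg_zero, zero_div, Complex.cpow_zero, zero_add, Complex.Gamma_one]; ring
    rw [← hψ1]
    refine hlim.congr' ?_
    filter_upwards [self_mem_nhdsWithin] with s hs
    exact (hψ_eq s hs).symm
  -- the two sides agree near `1`
  have hLR : Tendsto (fun s ↦ Gammaℝ s * ((s - 1) * rightMellinExt F s)) (𝓝[≠] (1 : ℂ))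
      (𝓝 (-2 * rightMellinExt f 0)) := by
    refine hR.congr' ?_
    have hB : Metric.ball (1 : ℂ) (1 / 2) ∈ 𝓝[≠] (1 : ℂ) :=
      mem_nhdsWithin_of_mem_nhds (Metric.ball_mem_nhds _ (by norm_num))
    filter_upwards [hB, self_mem_nhdsWithin] with s hs hs1
    rw [show Gammaℝ s * ((s - 1) * rightMellinExt F s) = (s - 1) * (Gammaℝ s * rightMellinExt F s) by
      ring, hball s hs hs1]
  have := tendsto_nhds_unique hL hLR
  linear_combination -this

/-- **Prop. 4.3, `L_a` clause at `w = 0`**: for `f ∈ L_a` with `G_f(0) = 0` the (plain) Cesàro average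
`Qf` is in `L_a` with `(Qf)^(s) = f̂(s)/s` (`c' = 2·G_f(0) = 0`, so `𝓕f` vanishes on `(−a,a)` and the
Fourier side is the constant `∫_a^∞ (𝓕f)(η)dη/η`). [cite: Burnol2004b, Prop. 4.3 and Lemma 4.4 (arXiv:math/0203120v7 p. 8, TeX l.711–758)] -/
theorem sonineL_div_zero {a : ℝ} (ha : 0 < a) {f : Lp ℂ 2 (volume : Measure ℝ)}
    (hf : f ∈ sonineL a) (hG : rightMellinExt f 0 = 0) :
    ∃ h ∈ sonineL a, ∀ s : ℂ, 1 / 2 < s.re → s.re < 1 →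
      rightMellin (h : ℝ → ℂ) s = rightMellin (f : ℝ → ℂ) s / (s - 0) := by
  obtain ⟨f₀, g₀, c, c', hf₀m, hff₀, hf₀e, hf₀c, hf₀L, hg₀m, hgg₀, hg₀e, hg₀c, hg₀L, hfc, hFc⟩ :=
    exists_reps_of_mem_sonineL hf
  have hc' : c' = 0 := by
    rw [fourierConst_eq_two_mul_rightMellinExt_zero ha hf hgg₀ hg₀c, hG, mul_zero]
  subst hc'
  have hΨ : ∀ ξ : ℝ, ξ ≠ 0 → |ξ| ≤ a →
      (∫ v in Ioo (0 : ℝ) 1, ((v⁻¹ : ℝ) : ℂ) * ((v : ℂ) ^ (-(0 : ℂ)) * g₀ (v⁻¹ * ξ))) =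
        ∫ η in Ioi a, (η : ℂ) ^ ((0 : ℂ) - 1) * g₀ η :=
    fun ξ hξ0 hξ ↦ psi_cesaro_const_zero ha hg₀L hg₀e hg₀c hξ0 hξ
  obtain ⟨h, hhe, hh0, hhF, hhM⟩ := exists_cesaro_twisted ha f hf₀m hff₀ hf₀e hf₀c hg₀m hgg₀
    (w := 0) (by rw [Complex.zero_re]; norm_num) hΨ
  exact ⟨h, ⟨hhe, ⟨_, hh0⟩, ⟨_, hhF⟩⟩, fun s hs hs1 ↦ hhM s hs hs1⟩

/-- **Prop. 4.3, `L_a` clause, for every `w` off the critical line** (as typed in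
`Burnol2004b_prop4_3R`: `w ≠ 1`, `w ∉ {−2, −4, …}`, hypothesis `G_f(w) = 0`).
[cite: Burnol2004b, Prop. 4.3 (arXiv:math/0203120v7 p. 8, TeX l.711–731)] -/
theorem sonineL_div_of_re_ne_half' {a : ℝ} (ha : 0 < a) {f : Lp ℂ 2 (volume : Measure ℝ)}
    (hf : f ∈ sonineL a) {w : ℂ} (hw : w.re ≠ 1 / 2) (hw1 : w ≠ 1)
    (hwn : ∀ n : ℕ, w ≠ -2 * ((n : ℂ) + 1)) (hG : rightMellinExt f w = 0) :
    ∃ h ∈ sonineL a, ∀ s : ℂ, 1 / 2 < s.re → s.re < 1 → s ≠ w →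
      rightMellin (h : ℝ → ℂ) s = rightMellin (f : ℝ → ℂ) s / (s - w) := by
  by_cases hw0 : w = 0
  · subst hw0
    obtain ⟨k, hk, hkM⟩ := sonineL_div_zero ha hf hG
    exact ⟨k, hk, fun s hs hs1 _ ↦ hkM s hs hs1⟩
  · exact sonineL_div_of_re_ne_half ha hf hw hw0 hw1 hwn hG


/-! ### Q. Towards the critical line: the Cesàro witness given the two analytic inputs -/

/-- **The twisted Cesàro witness for ANY `Re w < 1`, modulo the two analytic inputs of the critical
line**: if `Q_w f₀ ∈ L²` (automatic for `Re w < ½`, `memLp_twisted`; on `Re w = ½` an `L²`-limit) and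
its class `h` satisfies the duality identity `⟨𝓕⁻¹α, h⟩ = κ·conj(∫α)` for every `α ∈ L²` vanishing off
`[−a,a]`, then `h` is even, equals `c/(1−w)` on `(0,a)`, has `𝓕h = κ` on `(0,a)` and
`ĥ(s) = f̂(s)/(s−w)` on the strip `max(½, Re w) < Re s < 1`.
[cite: Burnol2004b, Prop. 4.3 (arXiv:math/0203120v7 p. 8, TeX l.711–731)] -/
theorem exists_cesaro_twisted_of_memLp {a : ℝ} (ha : 0 < a) (f : Lp ℂ 2 (volume : Measure ℝ))
    {f₀ : ℝ → ℂ} (hf₀m : Measurable f₀) (hff₀ : (f : ℝ → ℂ) =ᵐ[volume] f₀)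
    (hf₀e : ∀ x, f₀ (-x) = f₀ x) {c : ℂ} (hf₀c : ∀ x, |x| ≤ a → f₀ x = c)
    {w : ℂ} (hw : w.re < 1)
    (hHL : MemLp (fun t : ℝ ↦ ∫ v in Ioo (0 : ℝ) 1, (v : ℂ) ^ (-w) * f₀ (v * t)) 2 volume) {κ : ℂ}
    (hdual : ∀ α : Lp ℂ 2 (volume : Measure ℝ), (∀ᵐ ξ : ℝ, ξ ∉ Icc (-a) a → (α : ℝ → ℂ) ξ = 0) →
      ⟪(𝓕⁻ α : Lp ℂ 2 (volume : Measure ℝ)), hHL.toLp _⟫_ℂ = κ * (starRingEnd ℂ) (∫ ξ, (α : ℝ → ℂ) ξ)) :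
    ∃ h : Lp ℂ 2 (volume : Measure ℝ), h ∈ evenL2 ∧
      (∀ᵐ x : ℝ, x ∈ Ioo 0 a → (h : ℝ → ℂ) x = c / (1 - w)) ∧
      (∀ᵐ x : ℝ, x ∈ Ioo 0 a → ((𝓕 h : Lp ℂ 2 (volume : Measure ℝ)) : ℝ → ℂ) x = κ) ∧
      ∀ s : ℂ, 1 / 2 < s.re → s.re < 1 → w.re < s.re →
        rightMellin (h : ℝ → ℂ) s = rightMellin (f : ℝ → ℂ) s / (s - w) := by
  have hf₀L : MemLp f₀ 2 volume := (Lp.memLp f).ae_eq hff₀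
  set h : Lp ℂ 2 (volume : Measure ℝ) := hHL.toLp _ with hh
  have hco : (h : ℝ → ℂ) =ᵐ[volume] fun t ↦ ∫ v in Ioo (0 : ℝ) 1, (v : ℂ) ^ (-w) * f₀ (v * t) :=
    hHL.coeFn_toLp
  refine ⟨h, ?_, ?_, ?_, ?_⟩
  · have hneg : Measure.QuasiMeasurePreserving (fun x : ℝ ↦ -x) volume volume :=
      (Measure.measurePreserving_neg (volume : Measure ℝ)).quasiMeasurePreserving
    show ∀ᵐ x : ℝ, (h : ℝ → ℂ) (-x) = (h : ℝ → ℂ) x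
    filter_upwards [hco, hneg.ae hco] with x h1 h2
    rw [h2, h1]
    exact twisted_even hf₀e w x
  · filter_upwards [hco] with x hx hxI
    rw [hx]
    exact cesaro_twisted_eq_const hf₀c hw (by rw [abs_of_pos hxI.1]; exact hxI.2.le)
  · have hF := fourier_ae_eq_const_of_inner (a := a) h (κ := κ) hdual
    filter_upwards [hF] with x hx hxI
    exact hx ⟨by linarith [hxI.1], hxI.2.le⟩
  · intro s hs hs1 hsw
    have hSint : IntegrableOn (fun v : ℝ ↦ v ^ (s.re - w.re - 1)) (Ioo 0 1) :=
      (intervalIntegral.integrableOn_Ioo_rpow_iff zero_lt_one).2 (by linarith)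
    obtain ⟨-, hM⟩ := rightMellin_twisted measurableSet_Ioo Ioo_subset_Ioi_self hf₀m
      (mellinConvergent_rep ha hf₀L hf₀c hs hs1) hSint (w := w)
    rw [rightMellin_congr_ae hco, hM, integral_Ioo_cpow_eq hsw, rightMellin_congr_ae hff₀]
    ring


/-! ### R. The critical line `Re w = ½`

#### R1. Elementary helpers -/

/-- `∫_ℝ dτ / (A² + (τ − b)²) = π / A` for `A > 0`, with integrability. [folklore] -/
private theorem integral_univ_inv_sq_add_sq_sub {A : ℝ} (hA : 0 < A) (b : ℝ) :
    Integrable (fun τ : ℝ ↦ (A ^ 2 + (τ - b) ^ 2)⁻¹) ∧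
      ∫ τ : ℝ, (A ^ 2 + (τ - b) ^ 2)⁻¹ = π / A := by
  have hA0 : A ≠ 0 := hA.ne'
  -- `(A² + u²)⁻¹ = A⁻² · (1 + (u/A)²)⁻¹`
  have e : ∀ u : ℝ, (A ^ 2 + u ^ 2)⁻¹ = (A ^ 2)⁻¹ * (1 + (u / A) ^ 2)⁻¹ := by
    intro u
    rw [← mul_inv]
    congr 1
    field_simp
  have hint0 : Integrable (fun u : ℝ ↦ (1 + (u / A) ^ 2)⁻¹) :=
    (integrable_inv_one_add_sq.comp_div hA0)
  have hint1 : Integrable (fun u : ℝ ↦ (A ^ 2 + u ^ 2)⁻¹) := by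
    simp_rw [e]
    exact hint0.const_mul _
  refine ⟨?_, ?_⟩
  · exact hint1.comp_sub_right b
  · rw [integral_sub_right_eq_self (fun u : ℝ ↦ (A ^ 2 + u ^ 2)⁻¹) b]
    simp_rw [e]
    rw [integral_const_mul, Measure.integral_comp_div (fun u : ℝ ↦ (1 + u ^ 2)⁻¹) A,
      integral_univ_inv_one_add_sq, smul_eq_mul, abs_of_pos hA]
    field_simp

/-- `‖s − (w − δ)‖ ≥ ‖s − w‖` when `Re w ≤ Re s` and `0 ≤ δ`. [folklore] -/
private theorem norm_sub_le_norm_sub_sub_ofReal {s w : ℂ} (hsw : w.re ≤ s.re) {δ : ℝ} (hδ : 0 ≤ δ) :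
    ‖s - w‖ ≤ ‖s - (w - δ)‖ := by
  rw [← Real.sqrt_sq (norm_nonneg (s - w)), ← Real.sqrt_sq (norm_nonneg (s - (w - δ))),
    Complex.sq_norm, Complex.sq_norm, Complex.normSq_apply, Complex.normSq_apply]
  refine Real.sqrt_le_sqrt ?_
  simp only [Complex.sub_re, Complex.sub_im, Complex.ofReal_re, Complex.ofReal_im, sub_zero]
  have h1 : 0 ≤ s.re - w.re := by linarith
  nlinarith

/-- **The pointwise inequality behind the Cauchy estimate.** With `wₙ = w − δₙ`, `wₘ = w − δₘ`,
`0 ≤ δₘ ≤ δₙ`, `Re w < Re s`, and `‖F‖ ≤ M‖s − w‖` whenever `‖s − w‖ < r`: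
`‖F‖² ‖1/(s−wₙ) − 1/(s−wₘ)‖² ≤ M² δₙ²/‖s − wₙ‖² + ‖F‖² δₙ²/r⁴`. [folklore] -/
private theorem norm_sq_mul_resolvent_diff_le {s w : ℂ} (hsw : w.re < s.re) {δn δm : ℝ} (hδm : 0 ≤ δm)
    (hδ : δm ≤ δn) {F : ℂ} {M r : ℝ} (hM : 0 ≤ M) (hr : 0 < r)
    (hF : ‖s - w‖ < r → ‖F‖ ≤ M * ‖s - w‖) :
    ‖F‖ ^ 2 * ‖1 / (s - (w - δn)) - 1 / (s - (w - δm))‖ ^ 2 ≤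
      M ^ 2 * δn ^ 2 / ‖s - (w - δn)‖ ^ 2 + ‖F‖ ^ 2 * δn ^ 2 / r ^ 4 := by
  have hδn : 0 ≤ δn := hδm.trans hδ
  have hn0 : s - (w - δn) ≠ 0 := by
    intro h
    have := congrArg Complex.re h
    simp at this
    linarith
  have hm0 : s - (w - δm) ≠ 0 := by
    intro h
    have := congrArg Complex.re h
    simp at this
    linarith
  have hnpos : 0 < ‖s - (w - δn)‖ := norm_pos_iff.2 hn0
  have hmpos : 0 < ‖s - (w - δm)‖ := norm_pos_iff.2 hm0
  have hwn : ‖s - w‖ ≤ ‖s - (w - δn)‖ := norm_sub_le_norm_sub_sub_ofReal hsw.le hδn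
  have hwm : ‖s - w‖ ≤ ‖s - (w - δm)‖ := norm_sub_le_norm_sub_sub_ofReal hsw.le hδm
  -- the resolvent difference
  have hdiff : 1 / (s - (w - δn)) - 1 / (s - (w - δm)) =
      ((δm : ℂ) - δn) / ((s - (w - δn)) * (s - (w - δm))) := by
    field_simp
    ring
  have hnd : ‖1 / (s - (w - δn)) - 1 / (s - (w - δm))‖ ≤
      δn / (‖s - (w - δn)‖ * ‖s - (w - δm)‖) := by
    rw [hdiff, norm_div, norm_mul]
    refine div_le_div_of_nonneg_right ?_ (mul_pos hnpos hmpos).le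
    rw [← Complex.ofReal_sub, Complex.norm_real, Real.norm_eq_abs, abs_sub_comm,
      abs_of_nonneg (by linarith)]
    linarith
  have hprod : ‖F‖ * ‖1 / (s - (w - δn)) - 1 / (s - (w - δm))‖ ≤
      ‖F‖ * (δn / (‖s - (w - δn)‖ * ‖s - (w - δm)‖)) :=
    mul_le_mul_of_nonneg_left hnd (norm_nonneg F)
  have hsq : ∀ {x y : ℝ}, 0 ≤ x → x ≤ y → x ^ 2 ≤ y ^ 2 := fun hx hxy ↦ pow_le_pow_left₀ hx hxy 2
  have h1nonneg : 0 ≤ M ^ 2 * δn ^ 2 / ‖s - (w - δn)‖ ^ 2 := by positivity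
  have h2nonneg : 0 ≤ ‖F‖ ^ 2 * δn ^ 2 / r ^ 4 := by positivity
  by_cases hnear : ‖s - w‖ < r
  · -- near `w`: `‖F‖ ≤ M‖s − w‖ ≤ M‖s − wₘ‖`
    have hFle : ‖F‖ ≤ M * ‖s - (w - δm)‖ := (hF hnear).trans (mul_le_mul_of_nonneg_left hwm hM)
    have key : ‖F‖ * (δn / (‖s - (w - δn)‖ * ‖s - (w - δm)‖)) ≤ M * δn / ‖s - (w - δn)‖ := by
      calc ‖F‖ * (δn / (‖s - (w - δn)‖ * ‖s - (w - δm)‖))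
          ≤ M * ‖s - (w - δm)‖ * (δn / (‖s - (w - δn)‖ * ‖s - (w - δm)‖)) :=
            mul_le_mul_of_nonneg_right hFle (by positivity)
        _ = M * δn / ‖s - (w - δn)‖ := by
            field_simp
    calc ‖F‖ ^ 2 * ‖1 / (s - (w - δn)) - 1 / (s - (w - δm))‖ ^ 2
        = (‖F‖ * ‖1 / (s - (w - δn)) - 1 / (s - (w - δm))‖) ^ 2 := by ring
      _ ≤ (M * δn / ‖s - (w - δn)‖) ^ 2 := hsq (by positivity) (hprod.trans key)
      _ = M ^ 2 * δn ^ 2 / ‖s - (w - δn)‖ ^ 2 := by rw [div_pow, mul_pow]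
      _ ≤ _ := le_add_of_nonneg_right h2nonneg
  · -- far from `w`: both distances are `≥ r`
    have hr' : r ≤ ‖s - w‖ := not_lt.1 hnear
    have hrn : r ≤ ‖s - (w - δn)‖ := hr'.trans hwn
    have hrm : r ≤ ‖s - (w - δm)‖ := hr'.trans hwm
    have key : ‖F‖ * (δn / (‖s - (w - δn)‖ * ‖s - (w - δm)‖)) ≤ ‖F‖ * δn / r ^ 2 := by
      rw [mul_div_assoc]
      refine mul_le_mul_of_nonneg_left ?_ (norm_nonneg F)
      refine div_le_div_of_nonneg_left hδn (by positivity) ?_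
      rw [sq]
      exact mul_le_mul hrn hrm hr.le (norm_nonneg _)
    calc ‖F‖ ^ 2 * ‖1 / (s - (w - δn)) - 1 / (s - (w - δm))‖ ^ 2
        = (‖F‖ * ‖1 / (s - (w - δn)) - 1 / (s - (w - δm))‖) ^ 2 := by ring
      _ ≤ (‖F‖ * δn / r ^ 2) ^ 2 := hsq (by positivity) (hprod.trans key)
      _ = ‖F‖ ^ 2 * δn ^ 2 / r ^ 4 := by rw [div_pow, mul_pow]; ring
      _ ≤ _ := le_add_of_nonneg_left h1nonneg

/-- `x^{2σ−1} ≤ 1 + x^{−1/2}` for `x > 0` and `¼ ≤ σ ≤ ½`. [folklore] -/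
private theorem rpow_two_mul_sub_one_le {x : ℝ} (hx : 0 < x) {σ : ℝ} (hσ : 1 / 4 ≤ σ) (hσ' : σ ≤ 1 / 2) :
    x ^ (2 * σ - 1) ≤ 1 + x ^ (-(1 / 2 : ℝ)) := by
  rcases le_or_gt 1 x with h1 | h1
  · have : x ^ (2 * σ - 1) ≤ 1 := Real.rpow_le_one_of_one_le_of_nonpos h1 (by linarith)
    linarith [Real.rpow_nonneg hx.le (-(1 / 2 : ℝ))]
  · have : x ^ (2 * σ - 1) ≤ x ^ (-(1 / 2 : ℝ)) :=
      Real.rpow_le_rpow_of_exponent_ge hx h1.le (by linarith)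
    linarith

/-- For an even function, `∫_ℝ g = 2 ∫_{(0,∞)} g`. [folklore] -/
private theorem integral_eq_two_mul_Ioi_of_even {g : ℝ → ℝ} (hg : Integrable g) (he : ∀ x, g (-x) = g x) :
    ∫ x, g x = 2 * ∫ x in Ioi (0 : ℝ), g x := by
  have h1 : ∫ x in Iic (0 : ℝ), g x = ∫ x in Ioi (0 : ℝ), g x := by
    have h := integral_comp_neg_Ioi 0 g
    simp only [neg_zero, he] at h
    exact h.symm
  rw [← integral_add_compl (measurableSet_Ioi (a := (0 : ℝ))) hg, compl_Ioi, h1]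
  ring


/-- Weighted integrability on `(0,∞)`: for `φ ∈ L²` equal to `κ` on `[−a,a]` (`a > 0`) and
`−1 < e ≤ 0`, `‖φ‖² x^e` is integrable on `(0,∞)`. [folklore] -/
private theorem integrableOn_norm_sq_mul_rpow {a : ℝ} (ha : 0 < a) {φ : ℝ → ℂ} (hφ : MemLp φ 2 volume)
    {κ : ℂ} (hφc : ∀ x, |x| ≤ a → φ x = κ) {e : ℝ} (he : -1 < e) (he0 : e ≤ 0) :
    IntegrableOn (fun x : ℝ ↦ ‖φ x‖ ^ 2 * x ^ e) (Ioi 0) := by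
  have hφ2 : Integrable (fun x ↦ ‖φ x‖ ^ 2) := (memLp_two_iff_integrable_sq_norm hφ.1).1 hφ
  rw [← Ioc_union_Ioi_eq_Ioi ha.le]
  refine IntegrableOn.union ?_ ?_
  · -- on `(0, a]`: the integrand is `‖κ‖² x^e`
    have h1 : IntegrableOn (fun x : ℝ ↦ ‖κ‖ ^ 2 * x ^ e) (Ioc 0 a) := by
      rw [integrableOn_Ioc_iff_integrableOn_Ioo]
      exact ((intervalIntegral.integrableOn_Ioo_rpow_iff ha).2 he).const_mul _
    refine h1.congr_fun (fun x hx ↦ ?_) measurableSet_Ioc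
    rw [hφc x (by rw [abs_of_pos hx.1]; exact hx.2)]
  · -- on `(a, ∞)`: `x^e ≤ a^e`
    have hm : AEStronglyMeasurable (fun x : ℝ ↦ x ^ e) (volume.restrict (Ioi a)) :=
      (measurable_id.pow_const e).aestronglyMeasurable
    have hb : ∀ᵐ x ∂(volume.restrict (Ioi a)), ‖x ^ e‖ ≤ a ^ e := by
      filter_upwards [ae_restrict_mem measurableSet_Ioi] with x hx
      have hx0 : 0 < x := ha.trans hx
      rw [Real.norm_eq_abs, abs_of_nonneg (Real.rpow_nonneg hx0.le e)]
      exact Real.rpow_le_rpow_of_nonpos ha hx.le he0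
    have h : IntegrableOn (fun x : ℝ ↦ ‖φ x‖ ^ 2 * x ^ e) (Ioi a) :=
      (hφ2.integrableOn (s := Ioi a)).mul_bdd hm hb
    exact h

/-- **From uniform weighted bounds to the unweighted bound.** If `∫_{(0,∞)} ‖φ‖² x^e ≤ B` for all
`e₀ < e < 0` (with integrability), and `‖φ‖²` is integrable on `(0,∞)`, then `∫_{(0,∞)} ‖φ‖² ≤ B`
(dominated convergence on `(1,∞)`, monotonicity on `(0,1]`). [folklore] -/
private theorem setIntegral_norm_sq_le_of_weighted {φ : ℝ → ℂ}
    (hφ2 : IntegrableOn (fun x ↦ ‖φ x‖ ^ 2) (Ioi 0)) {e₀ B : ℝ} (he₀ : e₀ < 0)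
    (hint : ∀ e : ℝ, e₀ < e → e < 0 → IntegrableOn (fun x : ℝ ↦ ‖φ x‖ ^ 2 * x ^ e) (Ioi 0))
    (hB : ∀ e : ℝ, e₀ < e → e < 0 → ∫ x in Ioi (0 : ℝ), ‖φ x‖ ^ 2 * x ^ e ≤ B) :
    ∫ x in Ioi (0 : ℝ), ‖φ x‖ ^ 2 ≤ B := by
  -- the exponents `eₖ = e₀/(k+2) ↑ 0`
  set ek : ℕ → ℝ := fun k ↦ e₀ / ((k : ℝ) + 2) with hek
  have hek_lt : ∀ k, ek k < 0 := fun k ↦ div_neg_of_neg_of_pos he₀ (by positivity)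
  have hek_gt : ∀ k, e₀ < ek k := by
    intro k
    rw [hek]
    dsimp only
    have h2 : (1 : ℝ) < (k : ℝ) + 2 := by
      have : (0 : ℝ) ≤ k := Nat.cast_nonneg k
      linarith
    have hpos : (0 : ℝ) < (k : ℝ) + 2 := by linarith
    rw [lt_div_iff₀ hpos]
    nlinarith
  have hek_tend : Tendsto ek atTop (𝓝 0) := by
    have h1 : Tendsto (fun k : ℕ ↦ ((k : ℝ) + 2)⁻¹) atTop (𝓝 0) := by
      have := tendsto_natCast_atTop_atTop (R := ℝ)
      exact tendsto_inv_atTop_zero.comp (tendsto_atTop_add_const_right _ _ this)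
    have h2 : Tendsto (fun k : ℕ ↦ e₀ * ((k : ℝ) + 2)⁻¹) atTop (𝓝 (e₀ * 0)) := h1.const_mul e₀
    rw [mul_zero] at h2
    refine h2.congr fun k ↦ ?_
    rw [hek]; dsimp only; rw [div_eq_mul_inv]
  -- splitting `(0,∞) = (0,1] ∪ (1,∞)`
  have hdisj : Disjoint (Ioc (0 : ℝ) 1) (Ioi 1) := Ioc_disjoint_Ioi_same
  have hsplit : ∀ {g : ℝ → ℝ}, IntegrableOn g (Ioi 0) →
      ∫ x in Ioi (0 : ℝ), g x = (∫ x in Ioc (0 : ℝ) 1, g x) + ∫ x in Ioi (1 : ℝ), g x := by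
    intro g hg
    rw [← Ioc_union_Ioi_eq_Ioi zero_le_one] at hg ⊢
    exact setIntegral_union hdisj measurableSet_Ioi (hg.mono_set subset_union_left)
      (hg.mono_set subset_union_right)
  -- the `(1,∞)` part converges
  have hlim : Tendsto (fun k ↦ ∫ x in Ioi (1 : ℝ), ‖φ x‖ ^ 2 * x ^ ek k) atTop
      (𝓝 (∫ x in Ioi (1 : ℝ), ‖φ x‖ ^ 2)) := by
    refine tendsto_integral_of_dominated_convergence (fun x ↦ ‖φ x‖ ^ 2) (fun k ↦ ?_)
      (hφ2.mono_set (Ioi_subset_Ioi zero_le_one)) (fun k ↦ ?_) ?_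
    · exact ((hint (ek k) (hek_gt k) (hek_lt k)).mono_set
        (Ioi_subset_Ioi zero_le_one)).aestronglyMeasurable
    · filter_upwards [ae_restrict_mem measurableSet_Ioi] with x hx
      have hx1 : (1 : ℝ) ≤ x := le_of_lt hx
      rw [Real.norm_eq_abs, abs_of_nonneg (by positivity)]
      have : x ^ ek k ≤ 1 := Real.rpow_le_one_of_one_le_of_nonpos hx1 (hek_lt k).le
      calc ‖φ x‖ ^ 2 * x ^ ek k ≤ ‖φ x‖ ^ 2 * 1 :=
            mul_le_mul_of_nonneg_left this (by positivity)
        _ = ‖φ x‖ ^ 2 := mul_one _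
    · filter_upwards [ae_restrict_mem measurableSet_Ioi] with x hx
      have hx0 : (0 : ℝ) < x := zero_lt_one.trans hx
      have hc : Tendsto (fun k ↦ x ^ ek k) atTop (𝓝 (x ^ (0 : ℝ))) :=
        ((Real.continuousAt_const_rpow hx0.ne').tendsto).comp hek_tend
      rw [Real.rpow_zero] at hc
      have := hc.const_mul (‖φ x‖ ^ 2)
      rwa [mul_one] at this
  -- the inequality for each `k`
  have hk : ∀ k, (∫ x in Ioc (0 : ℝ) 1, ‖φ x‖ ^ 2) + ∫ x in Ioi (1 : ℝ), ‖φ x‖ ^ 2 * x ^ ek k ≤ B := by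
    intro k
    have hI := hint (ek k) (hek_gt k) (hek_lt k)
    have h1 : ∫ x in Ioc (0 : ℝ) 1, ‖φ x‖ ^ 2 ≤ ∫ x in Ioc (0 : ℝ) 1, ‖φ x‖ ^ 2 * x ^ ek k := by
      refine setIntegral_mono_on (hφ2.mono_set Ioc_subset_Ioi_self)
        (hI.mono_set Ioc_subset_Ioi_self) measurableSet_Ioc fun x hx ↦ ?_
      have : 1 ≤ x ^ ek k := Real.one_le_rpow_of_pos_of_le_one_of_nonpos hx.1 hx.2 (hek_lt k).le
      calc ‖φ x‖ ^ 2 = ‖φ x‖ ^ 2 * 1 := (mul_one _).symm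
        _ ≤ ‖φ x‖ ^ 2 * x ^ ek k := mul_le_mul_of_nonneg_left this (by positivity)
    calc (∫ x in Ioc (0 : ℝ) 1, ‖φ x‖ ^ 2) + ∫ x in Ioi (1 : ℝ), ‖φ x‖ ^ 2 * x ^ ek k
        ≤ (∫ x in Ioc (0 : ℝ) 1, ‖φ x‖ ^ 2 * x ^ ek k) + ∫ x in Ioi (1 : ℝ), ‖φ x‖ ^ 2 * x ^ ek k :=
          add_le_add h1 le_rfl
      _ = ∫ x in Ioi (0 : ℝ), ‖φ x‖ ^ 2 * x ^ ek k := (hsplit hI).symm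
      _ ≤ B := hB (ek k) (hek_gt k) (hek_lt k)
  rw [hsplit hφ2]
  exact le_of_tendsto' (tendsto_const_nhds.add hlim) hk

/-- `‖[d]‖² = ∫ ‖d‖²` for the `L²` class of `d`. [folklore] -/
private theorem norm_toLp_sq_eq {d : ℝ → ℂ} (hd : MemLp d 2 volume) :
    ‖hd.toLp d‖ ^ 2 = ∫ x, ‖d x‖ ^ 2 := by
  rw [Lp.norm_toLp, MemLp.eLpNorm_eq_integral_rpow_norm two_ne_zero ENNReal.ofNat_ne_top hd]
  simp only [ENNReal.toReal_ofNat, Real.rpow_two]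
  have hnn : 0 ≤ ∫ x, ‖d x‖ ^ 2 := integral_nonneg fun x ↦ by positivity
  rw [ENNReal.toReal_ofReal (by positivity), ← Real.rpow_natCast, ← Real.rpow_mul hnn]
  norm_num

/-! #### R2. The twisted Cesàro averages `Q_{w'} f₀`: Mellin transforms and the Mellin–Plancherel line bound -/

/-- `(Q_{w'} f₀)^(s) = f̂₀(s)/(s − w')` with absolute convergence, for `f₀ ∈ L²` constant on `[−a,a]`,
`s` in the strip and `Re w' < Re s`. [cite: Burnol2004b, Prop. 4.3 (arXiv:math/0203120v7 p. 8, TeX l.711–731)] -/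
theorem rightMellin_cesaro {a : ℝ} (ha : 0 < a) {f₀ : ℝ → ℂ} (hf₀m : Measurable f₀)
    (hf₀L : MemLp f₀ 2 volume) {c : ℂ} (hf₀c : ∀ x, |x| ≤ a → f₀ x = c) {w' s : ℂ}
    (hs : 1 / 2 < s.re) (hs1 : s.re < 1) (hsw : w'.re < s.re) :
    MellinConvergent (fun t : ℝ ↦ ∫ v in Ioo (0 : ℝ) 1, (v : ℂ) ^ (-w') * f₀ (v * t)) (1 - s) ∧
      rightMellin (fun t : ℝ ↦ ∫ v in Ioo (0 : ℝ) 1, (v : ℂ) ^ (-w') * f₀ (v * t)) s =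
        rightMellin f₀ s / (s - w') := by
  have hSint : IntegrableOn (fun v : ℝ ↦ v ^ (s.re - w'.re - 1)) (Ioo 0 1) :=
    (intervalIntegral.integrableOn_Ioo_rpow_iff zero_lt_one).2 (by linarith)
  obtain ⟨hc, hM⟩ := rightMellin_twisted measurableSet_Ioo Ioo_subset_Ioi_self hf₀m
    (mellinConvergent_rep ha hf₀L hf₀c hs hs1) hSint (w := w')
  refine ⟨hc, ?_⟩
  rw [hM, integral_Ioo_cpow_eq hsw]
  ring

/-- `mellin (f − g) = mellin f − mellin g` under absolute convergence. [folklore] -/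
private theorem mellin_sub_of_convergent {f g : ℝ → ℂ} {s : ℂ} (hf : MellinConvergent f s)
    (hg : MellinConvergent g s) : mellin (f - g) s = mellin f s - mellin g s := by
  rw [mellin, mellin, mellin, ← integral_sub hf hg]
  refine integral_congr_ae (ae_of_all _ fun t ↦ ?_)
  simp only [Pi.sub_apply, smul_sub]

/-- `‖z‖² = (Re z)² + (Im z)²`. [folklore] -/
private theorem norm_sq_eq_re_sq_add_im_sq (z : ℂ) : ‖z‖ ^ 2 = z.re ^ 2 + z.im ^ 2 := by
  rw [Complex.sq_norm, Complex.normSq_apply]; ring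

/-- **The Mellin–Plancherel bound for `Q_{wₙ}f₀ − Q_{wₘ}f₀` on the line `Re = σ`.** With `w` on the
critical line, `wₙ = w − δₙ`, `wₘ = w − δₘ` (`0 < δₘ ≤ δₙ ≤ 1`), `σ ∈ [¼, ½)` and the local bound
`‖f̂₀(s)‖ ≤ M‖s − w‖` (`‖s − w‖ < r`, `s` in the strip):
`∫_ℝ ‖(Qₙ − Qₘ)^∼(σ + iτ)‖² dτ ≤ (M²π + 2π B/r⁴)·δₙ`, `B = ∫_{(0,∞)} ‖f₀‖²(1 + x^{−½})`.
[cite: Burnol2004b, Prop. 4.3 (arXiv:math/0203120v7 p. 8, TeX l.711–731)] -/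
theorem integral_norm_sq_mellin_cesaro_sub_le {a : ℝ} (ha : 0 < a) {f₀ : ℝ → ℂ} (hf₀m : Measurable f₀)
    (hf₀L : MemLp f₀ 2 volume) {c : ℂ} (hf₀c : ∀ x, |x| ≤ a → f₀ x = c)
    {w : ℂ} (hw : w.re = 1 / 2) {M r : ℝ} (hM : 0 ≤ M) (hr : 0 < r)
    (hF : ∀ s : ℂ, 1 / 2 < s.re → s.re < 1 → ‖s - w‖ < r → ‖rightMellin f₀ s‖ ≤ M * ‖s - w‖)
    {δn δm : ℝ} (hδm : 0 < δm) (hδ : δm ≤ δn) (hδn1 : δn ≤ 1)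
    {σ : ℝ} (hσ : 1 / 4 ≤ σ) (hσ' : σ < 1 / 2) :
    Integrable (fun τ : ℝ ↦ ‖mellin ((fun t : ℝ ↦ ∫ v in Ioo (0 : ℝ) 1, (v : ℂ) ^ (-(w - δn)) * f₀ (v * t)) -
        (fun t : ℝ ↦ ∫ v in Ioo (0 : ℝ) 1, (v : ℂ) ^ (-(w - δm)) * f₀ (v * t))) (σ + τ * I)‖ ^ 2) ∧
    ∫ τ : ℝ, ‖mellin ((fun t : ℝ ↦ ∫ v in Ioo (0 : ℝ) 1, (v : ℂ) ^ (-(w - δn)) * f₀ (v * t)) -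
        (fun t : ℝ ↦ ∫ v in Ioo (0 : ℝ) 1, (v : ℂ) ^ (-(w - δm)) * f₀ (v * t))) (σ + τ * I)‖ ^ 2 ≤
      (M ^ 2 * π + 2 * π * (∫ x in Ioi (0 : ℝ), ‖f₀ x‖ ^ 2 * (1 + x ^ (-(1 / 2 : ℝ)))) / r ^ 4) * δn := by
  set Qn : ℝ → ℂ := fun t ↦ ∫ v in Ioo (0 : ℝ) 1, (v : ℂ) ^ (-(w - δn)) * f₀ (v * t) with hQn
  set Qm : ℝ → ℂ := fun t ↦ ∫ v in Ioo (0 : ℝ) 1, (v : ℂ) ^ (-(w - δm)) * f₀ (v * t) with hQm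
  set B : ℝ := ∫ x in Ioi (0 : ℝ), ‖f₀ x‖ ^ 2 * (1 + x ^ (-(1 / 2 : ℝ))) with hB
  have hδn : 0 < δn := hδm.trans_le hδ
  -- the point `s(τ) = 1 − (σ + iτ)` of the strip
  set sτ : ℝ → ℂ := fun τ ↦ 1 - ((σ : ℂ) + (τ : ℂ) * I) with hsτ
  have hsre : ∀ τ : ℝ, (sτ τ).re = 1 - σ := fun τ ↦ by simp [hsτ]
  have hsim : ∀ τ : ℝ, (sτ τ).im = -τ := fun τ ↦ by simp [hsτ]
  have hs1 : ∀ τ : ℝ, 1 / 2 < (sτ τ).re := fun τ ↦ by rw [hsre]; linarith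
  have hs2 : ∀ τ : ℝ, (sτ τ).re < 1 := fun τ ↦ by rw [hsre]; linarith
  have hsw : ∀ τ : ℝ, w.re < (sτ τ).re := fun τ ↦ by rw [hsre, hw]; linarith
  have hswn : ∀ τ : ℝ, (w - δn).re < (sτ τ).re := fun τ ↦ by
    rw [Complex.sub_re, Complex.ofReal_re]; linarith [hsw τ]
  have hswm : ∀ τ : ℝ, (w - δm).re < (sτ τ).re := fun τ ↦ by
    rw [Complex.sub_re, Complex.ofReal_re]; linarith [hsw τ]
  have h1s : ∀ τ : ℝ, 1 - sτ τ = (σ : ℂ) + (τ : ℂ) * I := fun τ ↦ by rw [hsτ]; ring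
  -- Mellin transforms on the line
  have hmel : ∀ τ : ℝ, mellin (Qn - Qm) (σ + τ * I) =
      rightMellin f₀ (sτ τ) * (1 / (sτ τ - (w - δn)) - 1 / (sτ τ - (w - δm))) := by
    intro τ
    obtain ⟨hcn, hMn⟩ := rightMellin_cesaro ha hf₀m hf₀L hf₀c (hs1 τ) (hs2 τ) (hswn τ)
    obtain ⟨hcm, hMm⟩ := rightMellin_cesaro ha hf₀m hf₀L hf₀c (hs1 τ) (hs2 τ) (hswm τ)
    rw [h1s] at hcn hcm
    rw [mellin_sub_of_convergent hcn hcm]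
    have en : mellin Qn (σ + τ * I) = rightMellin Qn (sτ τ) := by rw [rightMellin, h1s]
    have em : mellin Qm (σ + τ * I) = rightMellin Qm (sτ τ) := by rw [rightMellin, h1s]
    rw [en, em, hMn, hMm]
    ring
  have hmelf : ∀ τ : ℝ, mellin f₀ (σ + τ * I) = rightMellin f₀ (sτ τ) := fun τ ↦ by
    rw [rightMellin, h1s]
  -- Plancherel for `f₀` on the line `σ`
  have hf₀w : IntegrableOn (fun x : ℝ ↦ ‖f₀ x‖ ^ 2 * x ^ (2 * σ - 1)) (Ioi 0) :=
    integrableOn_norm_sq_mul_rpow ha hf₀L hf₀c (by linarith) (by linarith)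
  have hf₀c1 : MellinConvergent f₀ σ := by
    have := mellinConvergent_rep ha hf₀L hf₀c (hs1 0) (hs2 0)
    rw [h1s] at this
    simpa using this
  obtain ⟨hPi, hPe⟩ := Literature.Analysis.FunctionSpaces.integral_norm_sq_mellin_eq hf₀c1 hf₀w
  -- the uniform weighted bound for `f₀`
  have hBint : IntegrableOn (fun x : ℝ ↦ ‖f₀ x‖ ^ 2 * (1 + x ^ (-(1 / 2 : ℝ)))) (Ioi 0) := by
    have h1 : IntegrableOn (fun x : ℝ ↦ ‖f₀ x‖ ^ 2 * x ^ (0 : ℝ)) (Ioi 0) :=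
      integrableOn_norm_sq_mul_rpow ha hf₀L hf₀c (by norm_num) le_rfl
    have h2 : IntegrableOn (fun x : ℝ ↦ ‖f₀ x‖ ^ 2 * x ^ (-(1 / 2 : ℝ))) (Ioi 0) :=
      integrableOn_norm_sq_mul_rpow ha hf₀L hf₀c (by norm_num) (by norm_num)
    refine ((h1.add h2).congr_fun (fun x _ ↦ ?_) measurableSet_Ioi)
    simp only [Real.rpow_zero, Pi.add_apply]
    ring
  have hf₀B : ∫ x in Ioi (0 : ℝ), ‖f₀ x‖ ^ 2 * x ^ (2 * σ - 1) ≤ B := by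
    refine setIntegral_mono_on hf₀w hBint measurableSet_Ioi fun x hx ↦ ?_
    exact mul_le_mul_of_nonneg_left (rpow_two_mul_sub_one_le hx hσ hσ'.le) (by positivity)
  have hB0 : 0 ≤ B := by
    refine setIntegral_nonneg measurableSet_Ioi fun x hx ↦ ?_
    have : 0 ≤ x ^ (-(1 / 2 : ℝ)) := Real.rpow_nonneg (le_of_lt hx) _
    positivity
  -- the Cauchy kernel on the line
  set A : ℝ := 1 / 2 - σ + δn with hA
  have hApos : 0 < A := by rw [hA]; linarith
  have hAδ : δn ≤ A := by rw [hA]; linarith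
  obtain ⟨hKi, hKe⟩ := integral_univ_inv_sq_add_sq_sub hApos (-w.im)
  have hnorm_n : ∀ τ : ℝ, ‖sτ τ - (w - δn)‖ ^ 2 = A ^ 2 + (τ - -w.im) ^ 2 := by
    intro τ
    rw [norm_sq_eq_re_sq_add_im_sq]
    simp only [Complex.sub_re, Complex.sub_im, Complex.ofReal_re, Complex.ofReal_im, hsre, hsim, hw,
      hA]
    ring
  -- pointwise bound
  have hpt : ∀ τ : ℝ, ‖mellin (Qn - Qm) (σ + τ * I)‖ ^ 2 ≤
      M ^ 2 * δn ^ 2 * (A ^ 2 + (τ - -w.im) ^ 2)⁻¹ +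
        δn ^ 2 / r ^ 4 * ‖mellin f₀ (σ + τ * I)‖ ^ 2 := by
    intro τ
    rw [hmel, norm_mul, mul_pow, hmelf]
    have h := norm_sq_mul_resolvent_diff_le (hsw τ) hδm.le hδ (F := rightMellin f₀ (sτ τ)) hM hr
      (fun hlt ↦ hF (sτ τ) (hs1 τ) (hs2 τ) hlt)
    rw [hnorm_n τ] at h
    refine h.trans (le_of_eq ?_)
    ring
  -- the dominating function is integrable
  have hdom : Integrable (fun τ : ℝ ↦ M ^ 2 * δn ^ 2 * (A ^ 2 + (τ - -w.im) ^ 2)⁻¹ +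
      δn ^ 2 / r ^ 4 * ‖mellin f₀ (σ + τ * I)‖ ^ 2) :=
    (hKi.const_mul _).add (hPi.const_mul _)
  have hs_cont : Continuous sτ :=
    continuous_const.sub (continuous_const.add (Complex.continuous_ofReal.mul continuous_const))
  have hne_n : ∀ τ : ℝ, sτ τ - (w - δn) ≠ 0 := fun τ h ↦ by
    have h' : (sτ τ - (w - δn)).re = (sτ τ).re - (w.re - δn) := by
      rw [Complex.sub_re]; simp
    rw [h, Complex.zero_re, hsre, hw] at h'
    linarith
  have hne_m : ∀ τ : ℝ, sτ τ - (w - δm) ≠ 0 := fun τ h ↦ by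
    have h' : (sτ τ - (w - δm)).re = (sτ τ).re - (w.re - δm) := by
      rw [Complex.sub_re]; simp
    rw [h, Complex.zero_re, hsre, hw] at h'
    linarith
  have hR : Continuous fun τ : ℝ ↦ ‖1 / (sτ τ - (w - δn)) - 1 / (sτ τ - (w - δm))‖ ^ 2 :=
    ((continuous_const.div (hs_cont.sub continuous_const) hne_n).sub
      (continuous_const.div (hs_cont.sub continuous_const) hne_m)).norm.pow 2
  have hmeas : AEStronglyMeasurable (fun τ : ℝ ↦ ‖mellin (Qn - Qm) (σ + τ * I)‖ ^ 2) volume := by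
    have e : (fun τ : ℝ ↦ ‖mellin (Qn - Qm) (σ + τ * I)‖ ^ 2) =
        fun τ : ℝ ↦ ‖mellin f₀ (σ + τ * I)‖ ^ 2 *
          ‖1 / (sτ τ - (w - δn)) - 1 / (sτ τ - (w - δm))‖ ^ 2 := by
      funext τ; rw [hmel, norm_mul, mul_pow, hmelf]
    rw [e]
    exact hPi.aestronglyMeasurable.mul hR.aestronglyMeasurable
  refine ⟨?_, ?_⟩
  · refine hdom.mono' hmeas (ae_of_all _ fun τ ↦ ?_)
    rw [Real.norm_eq_abs, abs_of_nonneg (by positivity)]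
    exact hpt τ
  · calc ∫ τ : ℝ, ‖mellin (Qn - Qm) (σ + τ * I)‖ ^ 2
        ≤ ∫ τ : ℝ, (M ^ 2 * δn ^ 2 * (A ^ 2 + (τ - -w.im) ^ 2)⁻¹ +
            δn ^ 2 / r ^ 4 * ‖mellin f₀ (σ + τ * I)‖ ^ 2) :=
          integral_mono_of_nonneg (ae_of_all _ fun τ ↦ by positivity) hdom (ae_of_all _ hpt)
      _ = M ^ 2 * δn ^ 2 * (π / A) +
            δn ^ 2 / r ^ 4 * (2 * π * ∫ x in Ioi (0 : ℝ), ‖f₀ x‖ ^ 2 * x ^ (2 * σ - 1)) := by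
          rw [integral_add (hKi.const_mul _) (hPi.const_mul _), integral_const_mul,
            integral_const_mul, hKe, hPe]
      _ ≤ M ^ 2 * π * δn + 2 * π * B / r ^ 4 * δn := by
          have h1 : M ^ 2 * δn ^ 2 * (π / A) ≤ M ^ 2 * π * δn := by
            have : δn ^ 2 * (π / A) ≤ π * δn := by
              rw [sq, mul_assoc, mul_comm]
              have hle : δn * (π / A) ≤ π := by
                rw [mul_div_assoc', div_le_iff₀ hApos]
                nlinarith [Real.pi_pos]
              nlinarith [Real.pi_pos]
            nlinarith
          have h2 : δn ^ 2 / r ^ 4 * (2 * π * ∫ x in Ioi (0 : ℝ), ‖f₀ x‖ ^ 2 * x ^ (2 * σ - 1)) ≤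
              2 * π * B / r ^ 4 * δn := by
            have hr4 : 0 < r ^ 4 := by positivity
            have hsq : δn ^ 2 ≤ δn := by nlinarith
            calc δn ^ 2 / r ^ 4 * (2 * π * ∫ x in Ioi (0 : ℝ), ‖f₀ x‖ ^ 2 * x ^ (2 * σ - 1))
                ≤ δn ^ 2 / r ^ 4 * (2 * π * B) := by
                  refine mul_le_mul_of_nonneg_left ?_ (by positivity)
                  nlinarith [Real.pi_pos]
              _ ≤ δn / r ^ 4 * (2 * π * B) := by
                  refine mul_le_mul_of_nonneg_right ?_ (by positivity)
                  exact div_le_div_of_nonneg_right hsq hr4.le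
              _ = 2 * π * B / r ^ 4 * δn := by ring
          linarith
      _ = (M ^ 2 * π + 2 * π * B / r ^ 4) * δn := by ring



/-! #### R3. The `L²` Cauchy estimate -/

/-- `MellinConvergent` is closed under subtraction. [folklore] -/
private theorem mellinConvergent_sub {f g : ℝ → ℂ} {s : ℂ} (hf : MellinConvergent f s)
    (hg : MellinConvergent g s) : MellinConvergent (f - g) s := by
  have h := hf.sub hg
  refine h.congr_fun (fun t _ ↦ ?_) measurableSet_Ioi
  simp only [Pi.sub_apply, smul_sub]

/-- **`‖Q_{wₙ}f₀ − Q_{wₘ}f₀‖²_{L²(ℝ)} ≤ 2K δₙ`** (`K = (M²π + 2πB/r⁴)/(2π)`): the twisted Cesàro averages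
`Q_{w−δ}f₀`, `δ ↓ 0`, form a Cauchy family in `L²` when `f̂₀` vanishes to first order at the point `w` of
the critical line. [cite: Burnol2004b, Prop. 4.3 (arXiv:math/0203120v7 p. 8, TeX l.711–731)] -/
theorem integral_norm_sq_cesaro_sub_le {a : ℝ} (ha : 0 < a) {f₀ : ℝ → ℂ} (hf₀m : Measurable f₀)
    (hf₀L : MemLp f₀ 2 volume) (hf₀e : ∀ x, f₀ (-x) = f₀ x) {c : ℂ} (hf₀c : ∀ x, |x| ≤ a → f₀ x = c)
    {w : ℂ} (hw : w.re = 1 / 2) {M r : ℝ} (hM : 0 ≤ M) (hr : 0 < r)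
    (hF : ∀ s : ℂ, 1 / 2 < s.re → s.re < 1 → ‖s - w‖ < r → ‖rightMellin f₀ s‖ ≤ M * ‖s - w‖)
    {δn δm : ℝ} (hδm : 0 < δm) (hδ : δm ≤ δn) (hδn1 : δn ≤ 1) :
    Integrable (fun t : ℝ ↦ ‖(∫ v in Ioo (0 : ℝ) 1, (v : ℂ) ^ (-(w - δn)) * f₀ (v * t)) -
        (∫ v in Ioo (0 : ℝ) 1, (v : ℂ) ^ (-(w - δm)) * f₀ (v * t))‖ ^ 2) ∧
    ∫ t : ℝ, ‖(∫ v in Ioo (0 : ℝ) 1, (v : ℂ) ^ (-(w - δn)) * f₀ (v * t)) -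
        (∫ v in Ioo (0 : ℝ) 1, (v : ℂ) ^ (-(w - δm)) * f₀ (v * t))‖ ^ 2 ≤
      2 * ((M ^ 2 * π + 2 * π * (∫ x in Ioi (0 : ℝ), ‖f₀ x‖ ^ 2 * (1 + x ^ (-(1 / 2 : ℝ)))) / r ^ 4)
        / (2 * π)) * δn := by
  set Qn : ℝ → ℂ := fun t ↦ ∫ v in Ioo (0 : ℝ) 1, (v : ℂ) ^ (-(w - δn)) * f₀ (v * t) with hQn
  set Qm : ℝ → ℂ := fun t ↦ ∫ v in Ioo (0 : ℝ) 1, (v : ℂ) ^ (-(w - δm)) * f₀ (v * t) with hQm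
  set K₀ : ℝ := M ^ 2 * π + 2 * π * (∫ x in Ioi (0 : ℝ), ‖f₀ x‖ ^ 2 * (1 + x ^ (-(1 / 2 : ℝ)))) / r ^ 4
    with hK₀
  have hδn : 0 < δn := hδm.trans_le hδ
  have hwn : (w - δn).re < 1 / 2 := by rw [Complex.sub_re, Complex.ofReal_re, hw]; linarith
  have hwm : (w - δm).re < 1 / 2 := by rw [Complex.sub_re, Complex.ofReal_re, hw]; linarith
  have hQnL : MemLp Qn 2 volume :=
    memLp_twisted measurableSet_Ioo Ioo_subset_Ioi_self hf₀m hf₀L (integrableOn_schur_Ioo hwn)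
  have hQmL : MemLp Qm 2 volume :=
    memLp_twisted measurableSet_Ioo Ioo_subset_Ioi_self hf₀m hf₀L (integrableOn_schur_Ioo hwm)
  set φ : ℝ → ℂ := Qn - Qm with hφ
  have hφL : MemLp φ 2 volume := hQnL.sub hQmL
  have hφ2 : Integrable (fun t ↦ ‖φ t‖ ^ 2) := (memLp_two_iff_integrable_sq_norm hφL.1).1 hφL
  -- `φ` is constant on `[−a, a]` and even
  set κ : ℂ := c / (1 - (w - δn)) - c / (1 - (w - δm)) with hκ
  have hφc : ∀ x, |x| ≤ a → φ x = κ := by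
    intro x hx
    show Qn x - Qm x = κ
    rw [hQn, hQm]
    dsimp only
    rw [cesaro_twisted_eq_const hf₀c (by linarith) hx, cesaro_twisted_eq_const hf₀c (by linarith) hx]
  have hφe : ∀ x, φ (-x) = φ x := by
    intro x
    show Qn (-x) - Qm (-x) = Qn x - Qm x
    rw [hQn, hQm]
    dsimp only
    rw [twisted_even hf₀e, twisted_even hf₀e]
  -- weighted bounds from the line estimate
  have hweighted : ∀ e : ℝ, -(1 / 2 : ℝ) < e → e < 0 →
      IntegrableOn (fun x : ℝ ↦ ‖φ x‖ ^ 2 * x ^ e) (Ioi 0) ∧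
        ∫ x in Ioi (0 : ℝ), ‖φ x‖ ^ 2 * x ^ e ≤ K₀ / (2 * π) * δn := by
    intro e he he0
    set σ : ℝ := (e + 1) / 2 with hσ
    have hσ1 : 1 / 4 ≤ σ := by rw [hσ]; linarith
    have hσ2 : σ < 1 / 2 := by rw [hσ]; linarith
    have he' : e = 2 * σ - 1 := by rw [hσ]; ring
    have hint : IntegrableOn (fun x : ℝ ↦ ‖φ x‖ ^ 2 * x ^ e) (Ioi 0) :=
      integrableOn_norm_sq_mul_rpow ha hφL hφc (by linarith) he0.le
    refine ⟨hint, ?_⟩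
    -- Plancherel for `φ` on the line `σ`
    have hs1 : 1 / 2 < (1 - (σ : ℂ)).re := by simp; linarith
    have hs2 : (1 - (σ : ℂ)).re < 1 := by simp; linarith
    have hsn : (w - δn).re < (1 - (σ : ℂ)).re := lt_trans hwn hs1
    have hsm : (w - δm).re < (1 - (σ : ℂ)).re := lt_trans hwm hs1
    have hcn := (rightMellin_cesaro ha hf₀m hf₀L hf₀c hs1 hs2 hsn).1
    have hcm := (rightMellin_cesaro ha hf₀m hf₀L hf₀c hs1 hs2 hsm).1
    rw [sub_sub_cancel] at hcn hcm
    have hφconv : MellinConvergent φ σ := mellinConvergent_sub hcn hcm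
    have hint' : IntegrableOn (fun x : ℝ ↦ ‖φ x‖ ^ 2 * x ^ (2 * σ - 1)) (Ioi 0) := by rwa [← he']
    obtain ⟨-, hPe⟩ := Literature.Analysis.FunctionSpaces.integral_norm_sq_mellin_eq hφconv hint'
    obtain ⟨-, hline⟩ := integral_norm_sq_mellin_cesaro_sub_le ha hf₀m hf₀L hf₀c hw hM hr hF hδm hδ
      hδn1 hσ1 hσ2
    have h2π : (0 : ℝ) < 2 * π := by positivity
    rw [he', ← mul_le_mul_iff_right₀ h2π]
    calc 2 * π * ∫ x in Ioi (0 : ℝ), ‖φ x‖ ^ 2 * x ^ (2 * σ - 1)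
        = ∫ τ : ℝ, ‖mellin φ (σ + τ * I)‖ ^ 2 := hPe.symm
      _ ≤ K₀ * δn := hline
      _ = 2 * π * (K₀ / (2 * π) * δn) := by field_simp
  have hhalf : ∫ x in Ioi (0 : ℝ), ‖φ x‖ ^ 2 ≤ K₀ / (2 * π) * δn :=
    setIntegral_norm_sq_le_of_weighted hφ2.integrableOn (by norm_num : -(1 / 2 : ℝ) < 0)
      (fun e he he0 ↦ (hweighted e he he0).1) (fun e he he0 ↦ (hweighted e he he0).2)
  refine ⟨hφ2, ?_⟩
  show ∫ t : ℝ, ‖φ t‖ ^ 2 ≤ 2 * (K₀ / (2 * π)) * δn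
  rw [integral_eq_two_mul_Ioi_of_even hφ2 (fun x ↦ by rw [hφe])]
  linarith

/-- Per-`t` absolute convergence of the twisted Cesàro integral `∫₀¹ v^{−w'} f₀(vt) dv` for `f₀ ∈ L²`
constant on `[−a,a]` and `0 ≤ Re w' < 1` (the constancy near `0` is what makes `Re w' ≥ ½` possible).
[cite: Burnol2004b, Prop. 4.3 (arXiv:math/0203120v7 p. 8, TeX l.711–731)] -/
theorem integrableOn_cesaro_integrand {a : ℝ} (ha : 0 < a) {f₀ : ℝ → ℂ} (hf₀m : Measurable f₀)
    (hf₀L : MemLp f₀ 2 volume) {c : ℂ} (hf₀c : ∀ x, |x| ≤ a → f₀ x = c) {w' : ℂ} (hw0 : 0 ≤ w'.re)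
    (hw1 : w'.re < 1) (t : ℝ) :
    IntegrableOn (fun v : ℝ ↦ (v : ℂ) ^ (-w') * f₀ (v * t)) (Ioo 0 1) := by
  -- the two dominating pieces
  have hmeas : AEStronglyMeasurable (fun v : ℝ ↦ (v : ℂ) ^ (-w') * f₀ (v * t))
      (volume.restrict (Ioo 0 1)) :=
    (((Complex.measurable_ofReal).pow_const _).mul (hf₀m.comp (measurable_id.mul_const t)))
      |>.aestronglyMeasurable
  have h1 : IntegrableOn (fun v : ℝ ↦ ‖c‖ * v ^ (-w'.re)) (Ioo 0 1) :=
    ((intervalIntegral.integrableOn_Ioo_rpow_iff zero_lt_one).2 (by linarith)).const_mul _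
  have h2 : IntegrableOn (fun v : ℝ ↦ (|t| / a) ^ w'.re * ‖f₀ (v * t)‖) (Ioo 0 1) := by
    have hft : Integrable (fun v : ℝ ↦ f₀ (v * t)) (volume.restrict (Ioo 0 1)) := by
      by_cases ht : t = 0
      · subst ht
        simp only [mul_zero]
        exact integrable_const _
      · have hL : MemLp (fun v : ℝ ↦ f₀ (v * t)) 2 volume := by
          simpa only [mul_comm] using Literature.Analysis.Fourier.memLp_comp_mul_left hf₀L ht
        exact (hL.restrict (Ioo 0 1)).integrable one_le_two
    exact (hft.norm.const_mul _)
  refine Integrable.mono' (h1.add h2) hmeas ?_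
  filter_upwards [ae_restrict_mem measurableSet_Ioo] with v hv
  have hv0 : 0 < v := hv.1
  rw [Pi.add_apply, norm_mul, Complex.norm_cpow_eq_rpow_re_of_pos hv0, Complex.neg_re]
  have hA : 0 ≤ ‖c‖ * v ^ (-w'.re) := by positivity
  by_cases hvt : |v * t| ≤ a
  · rw [hf₀c _ hvt]
    have hB : 0 ≤ (|t| / a) ^ w'.re * ‖c‖ := by positivity
    calc v ^ (-w'.re) * ‖c‖ = ‖c‖ * v ^ (-w'.re) := mul_comm _ _
      _ ≤ _ := le_add_of_nonneg_right hB
  · -- `|vt| > a` forces `v > a/|t|`, so `v^{−Re w'} ≤ (|t|/a)^{Re w'}`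
    have hvt' : a < v * |t| := by
      rw [abs_mul, abs_of_pos hv0] at hvt; exact not_le.1 hvt
    have ht0 : 0 < |t| := by
      rcases le_or_gt (|t|) 0 with h | h
      · nlinarith
      · exact h
    have hv_lb : a / |t| < v := by rwa [div_lt_iff₀ ht0]
    have hpow : v ^ (-w'.re) ≤ (|t| / a) ^ w'.re := by
      rw [Real.rpow_neg hv0.le, ← Real.inv_rpow hv0.le]
      refine Real.rpow_le_rpow (inv_nonneg.2 hv0.le) ?_ hw0
      rw [inv_le_comm₀ hv0 (by positivity), inv_div]
      exact hv_lb.le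
    calc v ^ (-w'.re) * ‖f₀ (v * t)‖ ≤ (|t| / a) ^ w'.re * ‖f₀ (v * t)‖ :=
          mul_le_mul_of_nonneg_right hpow (norm_nonneg _)
      _ ≤ _ := le_add_of_nonneg_left hA


/-! #### R4. Pointwise convergence `Q_{w−δ}f₀(t) → Q_w f₀(t)` -/

/-- For every `t`, `Q_{w−δₖ} f₀(t) → Q_w f₀(t)` as `δₖ ↓ 0` (dominated convergence in `v`; the dominating
function `v^{−½}|f₀(vt)|` is integrable on `(0,1)` because `f₀` is constant near `0`).
[cite: Burnol2004b, Prop. 4.3 (arXiv:math/0203120v7 p. 8, TeX l.711–731)] -/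
theorem tendsto_cesaro_pointwise {a : ℝ} (ha : 0 < a) {f₀ : ℝ → ℂ} (hf₀m : Measurable f₀)
    (hf₀L : MemLp f₀ 2 volume) {c : ℂ} (hf₀c : ∀ x, |x| ≤ a → f₀ x = c)
    {w : ℂ} (hw : w.re = 1 / 2) {δ : ℕ → ℝ} (hδpos : ∀ k, 0 < δ k)
    (hδ0 : Tendsto δ atTop (𝓝 0)) (t : ℝ) :
    Tendsto (fun k ↦ ∫ v in Ioo (0 : ℝ) 1, (v : ℂ) ^ (-(w - δ k)) * f₀ (v * t)) atTop
      (𝓝 (∫ v in Ioo (0 : ℝ) 1, (v : ℂ) ^ (-w) * f₀ (v * t))) := by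
  have hbound : IntegrableOn (fun v : ℝ ↦ (v : ℂ) ^ (-w) * f₀ (v * t)) (Ioo 0 1) :=
    integrableOn_cesaro_integrand ha hf₀m hf₀L hf₀c (by rw [hw]; norm_num) (by rw [hw]; norm_num) t
  refine tendsto_integral_of_dominated_convergence (fun v ↦ ‖(v : ℂ) ^ (-w) * f₀ (v * t)‖)
    (fun k ↦ ?_) hbound.norm (fun k ↦ ?_) ?_
  · exact (((Complex.measurable_ofReal).pow_const _).mul
      (hf₀m.comp (measurable_id.mul_const t))).aestronglyMeasurable
  · filter_upwards [ae_restrict_mem measurableSet_Ioo] with v hv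
    have hv0 : 0 < v := hv.1
    rw [norm_mul, norm_mul, Complex.norm_cpow_eq_rpow_re_of_pos hv0,
      Complex.norm_cpow_eq_rpow_re_of_pos hv0]
    refine mul_le_mul_of_nonneg_right ?_ (norm_nonneg _)
    refine Real.rpow_le_rpow_of_exponent_ge hv0 hv.2.le ?_
    simp only [Complex.neg_re, Complex.sub_re, Complex.ofReal_re]
    linarith [hδpos k]
  · filter_upwards [ae_restrict_mem measurableSet_Ioo] with v hv
    have hv0 : (v : ℂ) ≠ 0 := Complex.ofReal_ne_zero.2 hv.1.ne'
    have hδC : Tendsto (fun k ↦ ((δ k : ℝ) : ℂ)) atTop (𝓝 0) := by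
      have := (Complex.continuous_ofReal.tendsto 0).comp hδ0
      rwa [Function.comp_def, Complex.ofReal_zero] at this
    have hexp : Tendsto (fun k ↦ -(w - (δ k : ℂ))) atTop (𝓝 (-w)) := by
      have := (tendsto_const_nhds (x := w)).sub hδC
      rw [sub_zero] at this
      exact this.neg
    exact (hexp.const_cpow (Or.inl hv0)).mul_const _

/-! #### R5. The Fourier side of `Q_{w'}f₀` for `0 < Re w' < ½` -/

/-- Integrability of `u · conj v` from that of `u · v`. [folklore] -/
private theorem integrable_mul_conj_of_norm {u v : ℝ → ℂ} (hint : Integrable (fun ξ ↦ u ξ * v ξ))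
    (hu : AEStronglyMeasurable u volume) (hv : AEStronglyMeasurable v volume) :
    Integrable (fun ξ ↦ u ξ * (starRingEnd ℂ) (v ξ)) :=
  hint.norm.mono' (hu.mul (Complex.continuous_conj.comp_aestronglyMeasurable hv))
    (ae_of_all _ fun ξ ↦ by rw [norm_mul, norm_mul, RCLike.norm_conj])

/-- An `L²` class vanishing off `[−a, a]` is integrable. [folklore] -/
private theorem integrable_of_Lp_two_of_support {a : ℝ} (α : Lp ℂ 2 (volume : Measure ℝ))
    (hα0 : ∀ᵐ ξ : ℝ, ξ ∉ Icc (-a) a → (α : ℝ → ℂ) ξ = 0) : Integrable (α : ℝ → ℂ) := by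
  have h1 : IntegrableOn (α : ℝ → ℂ) (Icc (-a) a) :=
    ((Lp.memLp α).restrict (Icc (-a) a)).integrable one_le_two
  exact h1.integrable_of_ae_notMem_eq_zero hα0

/-- `‖∫ p · conj(α)‖ ≤ ‖[p]‖ ‖α‖` (Cauchy–Schwarz through the `L²` inner product). [folklore] -/
private theorem norm_integral_mul_conj_le {p : ℝ → ℂ} (hpL : MemLp p 2 volume)
    (α : Lp ℂ 2 (volume : Measure ℝ)) :
    ‖∫ ξ, p ξ * (starRingEnd ℂ) ((α : ℝ → ℂ) ξ)‖ ≤ ‖hpL.toLp p‖ * ‖α‖ := by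
  have e : ∫ ξ, p ξ * (starRingEnd ℂ) ((α : ℝ → ℂ) ξ) = (starRingEnd ℂ) ⟪hpL.toLp p, α⟫_ℂ := by
    rw [L2.inner_def, ← integral_conj]
    refine integral_congr_ae ?_
    filter_upwards [hpL.coeFn_toLp] with ξ hξ
    simp only [RCLike.inner_apply, hξ, map_mul, RCLike.conj_conj]
    ring
  rw [e, RCLike.norm_conj]
  exact norm_inner_le_norm _ _

/-- **The weight `|ξ|^{−w'}𝟙_{[−a,a]}` is in `L²` with `‖·‖² = a^{2δ}/δ`**, `δ = ½ − Re w' > 0`. [folklore] -/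
private theorem memLp_absCpow_indicator {a : ℝ} (ha : 0 < a) {w' : ℂ} (hw0 : 0 < w'.re)
    (hw' : w'.re < 1 / 2) :
    MemLp ((Icc (-a) a).indicator fun ξ : ℝ ↦ ((|ξ| : ℝ) : ℂ) ^ (-w')) 2 volume ∧
    ∫ ξ, ‖(Icc (-a) a).indicator (fun ξ : ℝ ↦ ((|ξ| : ℝ) : ℂ) ^ (-w')) ξ‖ ^ 2 =
      a ^ (2 * (1 / 2 - w'.re)) / (1 / 2 - w'.re) := by
  set δ' : ℝ := 1 / 2 - w'.re with hδ'
  have hδ'pos : 0 < δ' := by rw [hδ']; linarith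
  set p : ℝ → ℂ := (Icc (-a) a).indicator fun ξ : ℝ ↦ ((|ξ| : ℝ) : ℂ) ^ (-w') with hp
  -- the square of the norm
  set G : ℝ → ℝ := (Icc (-a) a).indicator fun ξ : ℝ ↦ |ξ| ^ (2 * δ' - 1) with hG
  have hnorm : ∀ ξ, ‖p ξ‖ ^ 2 = G ξ := by
    intro ξ
    by_cases hI : ξ ∈ Icc (-a) a
    · rw [hp, hG, indicator_of_mem hI, indicator_of_mem hI]
      by_cases hξ0 : ξ = 0
      · subst hξ0
        have hw0' : -w' ≠ 0 := by
          intro h; have := congrArg Complex.re h; simp at this; linarith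
        rw [abs_zero, Complex.ofReal_zero, Complex.zero_cpow hw0', norm_zero,
          Real.zero_rpow (by rw [hδ']; linarith), zero_pow two_ne_zero]
      · have hξp : 0 < |ξ| := abs_pos.2 hξ0
        rw [Complex.norm_cpow_eq_rpow_re_of_pos hξp, Complex.neg_re, ← Real.rpow_natCast,
          ← Real.rpow_mul hξp.le]
        congr 1
        rw [hδ']; push_cast; ring
    · rw [hp, hG, indicator_of_notMem hI, indicator_of_notMem hI, norm_zero, zero_pow two_ne_zero]
  have hGe : ∀ ξ, G (-ξ) = G ξ := by
    intro ξ
    by_cases hI : ξ ∈ Icc (-a) a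
    · have hI' : -ξ ∈ Icc (-a) a := ⟨by linarith [hI.2], by linarith [hI.1]⟩
      rw [hG, indicator_of_mem hI, indicator_of_mem hI', abs_neg]
    · have hI' : -ξ ∉ Icc (-a) a := fun h ↦ hI ⟨by linarith [h.2], by linarith [h.1]⟩
      rw [hG, indicator_of_notMem hI, indicator_of_notMem hI']
  have hGIoi : ∀ ξ ∈ Ioi (0 : ℝ), G ξ = (Ioc 0 a).indicator (fun ξ : ℝ ↦ ξ ^ (2 * δ' - 1)) ξ := by
    intro ξ hξ
    have hξ0 : (0 : ℝ) < ξ := hξ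
    by_cases hξa : ξ ≤ a
    · rw [hG, indicator_of_mem (show ξ ∈ Icc (-a) a from ⟨by linarith, hξa⟩),
        indicator_of_mem (show ξ ∈ Ioc 0 a from ⟨hξ0, hξa⟩), abs_of_pos hξ0]
    · rw [hG, indicator_of_notMem (fun h ↦ hξa h.2), indicator_of_notMem (fun h ↦ hξa h.2)]
  have hrpow : IntegrableOn (fun ξ : ℝ ↦ ξ ^ (2 * δ' - 1)) (Ioc 0 a) := by
    rw [integrableOn_Ioc_iff_integrableOn_Ioo]
    exact (intervalIntegral.integrableOn_Ioo_rpow_iff ha).2 (by linarith)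
  have hGint_Ioi : IntegrableOn G (Ioi 0) := by
    have h1 : IntegrableOn ((Ioc 0 a).indicator (fun ξ : ℝ ↦ ξ ^ (2 * δ' - 1))) (Ioi 0) :=
      (hrpow.integrable_indicator measurableSet_Ioc).integrableOn
    exact h1.congr_fun (fun ξ hξ ↦ (hGIoi ξ hξ).symm) measurableSet_Ioi
  have hGint : Integrable G := by
    -- even function integrable on `(0,∞)`
    have hneg : IntegrableOn G (Iio 0) := by
      have hmp := Measure.measurePreserving_neg (volume : Measure ℝ)
      have hme := (MeasurableEquiv.neg ℝ).measurableEmbedding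
      have h := (hmp.integrableOn_comp_preimage hme (f := G) (s := Ioi 0)).2 hGint_Ioi
      have hpre : (Neg.neg : ℝ → ℝ) ⁻¹' (Ioi (0 : ℝ)) = Iio 0 := by
        ext x; simp
      have hcomp : G ∘ (Neg.neg : ℝ → ℝ) = G := by
        funext x
        exact hGe x
      rw [hcomp, hpre] at h
      exact h
    have hunion : IntegrableOn G (Iio 0 ∪ Ici 0) :=
      hneg.union (by rw [integrableOn_Ici_iff_integrableOn_Ioi]; exact hGint_Ioi)
    rwa [Iio_union_Ici, integrableOn_univ] at hunion
  have hpm : AEStronglyMeasurable p volume := by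
    refine (Measurable.indicator ?_ measurableSet_Icc).aestronglyMeasurable
    exact (Complex.measurable_ofReal.comp continuous_abs.measurable).pow_const _
  have hpL : MemLp p 2 volume := by
    rw [memLp_two_iff_integrable_sq_norm hpm]
    exact hGint.congr (ae_of_all _ fun ξ ↦ (hnorm ξ).symm)
  refine ⟨hpL, ?_⟩
  -- the value of the integral
  have e1 : ∫ ξ, ‖p ξ‖ ^ 2 = ∫ ξ, G ξ := integral_congr_ae (ae_of_all _ hnorm)
  rw [e1, integral_eq_two_mul_Ioi_of_even hGint hGe, setIntegral_congr_fun measurableSet_Ioi hGIoi,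
    setIntegral_indicator measurableSet_Ioc, inter_eq_right.2 Ioc_subset_Ioi_self,
    ← intervalIntegral.integral_of_le ha.le,
    integral_rpow (Or.inl (by linarith)), Real.zero_rpow (by linarith), sub_zero,
    show 2 * δ' - 1 + 1 = 2 * δ' by ring]
  field_simp

/-- **The Fourier side of `Q_{w'} f` for `0 < Re w' < ½`**: for `α ∈ L²` vanishing off `[−a,a]`,
`⟨𝓕⁻¹α, Q_{w'}f⟩ = −(c'/w')·conj(∫α) + A(w')·∫ |ξ|^{−w'}𝟙_{[−a,a]} ᾱ`, where
`A(w') = c'a^{w'}/w' + ∫_a^∞ η^{w'−1} g₀ = G_{𝓕f}(1 − w')`. (When `A(w') = 0` this is the constancy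
`𝓕(Q_{w'}f) = −c'/w'` on `(0,a)` of `psi_cesaro_const`.) [cite: Burnol2004b, Prop. 4.3 (arXiv:math/0203120v7 p. 8, TeX l.711–731)] -/
theorem inner_fourierInv_cesaro_eq {a : ℝ} (ha : 0 < a) (f : Lp ℂ 2 (volume : Measure ℝ))
    {f₀ : ℝ → ℂ} (hf₀m : Measurable f₀) (hff₀ : (f : ℝ → ℂ) =ᵐ[volume] f₀)
    {g₀ : ℝ → ℂ} (hg₀m : Measurable g₀)
    (hgg₀ : ((𝓕 f : Lp ℂ 2 (volume : Measure ℝ)) : ℝ → ℂ) =ᵐ[volume] g₀)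
    (hg₀e : ∀ x, g₀ (-x) = g₀ x) {c' : ℂ} (hg₀c : ∀ x, |x| ≤ a → g₀ x = c')
    {w' : ℂ} (hw0 : 0 < w'.re) (hw' : w'.re < 1 / 2)
    (H : Lp ℂ 2 (volume : Measure ℝ))
    (hH : (H : ℝ → ℂ) =ᵐ[volume] fun t ↦ ∫ v in Ioo (0 : ℝ) 1, (v : ℂ) ^ (-w') * f₀ (v * t))
    (α : Lp ℂ 2 (volume : Measure ℝ)) (hα0 : ∀ᵐ ξ : ℝ, ξ ∉ Icc (-a) a → (α : ℝ → ℂ) ξ = 0) :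
    ⟪(𝓕⁻ α : Lp ℂ 2 (volume : Measure ℝ)), H⟫_ℂ =
      -(c' / w') * (starRingEnd ℂ) (∫ ξ, (α : ℝ → ℂ) ξ) +
        (c' * (a : ℂ) ^ w' / w' + ∫ η in Ioi a, (η : ℂ) ^ (w' - 1) * g₀ η) *
          ∫ ξ, (Icc (-a) a).indicator (fun ξ : ℝ ↦ ((|ξ| : ℝ) : ℂ) ^ (-w')) ξ *
            (starRingEnd ℂ) ((α : ℝ → ℂ) ξ) := by
  have hg₀L : MemLp g₀ 2 volume := (Lp.memLp (𝓕 f : Lp ℂ 2 (volume : Measure ℝ))).ae_eq hgg₀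
  have hw'0 : w' ≠ 0 := by intro h; rw [h, Complex.zero_re] at hw0; exact lt_irrefl _ hw0
  set A : ℂ := c' * (a : ℂ) ^ w' / w' + ∫ η in Ioi a, (η : ℂ) ^ (w' - 1) * g₀ η with hA
  set p : ℝ → ℂ := (Icc (-a) a).indicator fun ξ : ℝ ↦ ((|ξ| : ℝ) : ℂ) ^ (-w') with hp
  obtain ⟨hpL, -⟩ := memLp_absCpow_indicator ha hw0 hw'
  rw [inner_fourierInv_twisted f hf₀m hff₀ hg₀m hgg₀ measurableSet_Ioo Ioo_subset_Ioi_self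
    (integrableOn_schur_Ioo hw') H hH α]
  -- pointwise rewriting of `Ψ · conj α`
  have hpt : ∀ᵐ ξ : ℝ,
      (∫ v in Ioo (0 : ℝ) 1, ((v⁻¹ : ℝ) : ℂ) * ((v : ℂ) ^ (-w') * g₀ (v⁻¹ * ξ))) *
          (starRingEnd ℂ) ((α : ℝ → ℂ) ξ) =
        -(c' / w') * (starRingEnd ℂ) ((α : ℝ → ℂ) ξ) + A * (p ξ * (starRingEnd ℂ) ((α : ℝ → ℂ) ξ)) := by
    have hae0 : ∀ᵐ ξ : ℝ, ξ ≠ 0 := by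
      have : ∀ᵐ ξ : ℝ, ξ ∉ ({0} : Set ℝ) := compl_mem_ae_iff.mpr (measure_singleton 0)
      filter_upwards [this] with ξ hξ h
      exact hξ (mem_singleton_iff.2 h)
    filter_upwards [hα0, hae0] with ξ h0 hξ0
    by_cases hI : ξ ∈ Icc (-a) a
    · have hξ : |ξ| ≤ a := abs_le.2 ⟨hI.1, hI.2⟩
      have hξp : 0 < |ξ| := abs_pos.2 hξ0
      have hξC : ((|ξ| : ℝ) : ℂ) ≠ 0 := Complex.ofReal_ne_zero.2 hξp.ne'
      rw [psi_cesaro_eq ha hg₀L hg₀e hg₀c hw' hξ0 hξ, hp, indicator_of_mem hI]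
      have hP : ∫ η in Ioc |ξ| a, (η : ℂ) ^ (w' - 1) = ((a : ℂ) ^ w' - ((|ξ| : ℝ) : ℂ) ^ w') / w' := by
        rw [← intervalIntegral.integral_of_le hξ,
          integral_cpow (Or.inr ⟨fun h ↦ hw'0 (by linear_combination h), by
            rw [Set.uIcc_of_le hξ]; exact fun h ↦ by linarith [h.1]⟩), sub_add_cancel]
      have h1 : ((|ξ| : ℝ) : ℂ) ^ (-w') * ((|ξ| : ℝ) : ℂ) ^ w' = 1 := by
        rw [Complex.cpow_neg, inv_mul_cancel₀]
        exact fun h ↦ hξC ((Complex.cpow_eq_zero_iff _ _).1 h).1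
      rw [hP]
      have e : ((|ξ| : ℝ) : ℂ) ^ (-w') * (c' * (((a : ℂ) ^ w' - ((|ξ| : ℝ) : ℂ) ^ w') / w') +
          ∫ η in Ioi a, (η : ℂ) ^ (w' - 1) * g₀ η) =
          -(c' / w') * (((|ξ| : ℝ) : ℂ) ^ (-w') * ((|ξ| : ℝ) : ℂ) ^ w') +
            A * ((|ξ| : ℝ) : ℂ) ^ (-w') := by
        rw [hA]; field_simp; ring
      rw [e, h1]
      ring
    · rw [h0 hI, map_zero, mul_zero, mul_zero, mul_zero, mul_zero, add_zero]
  -- integrability of the two pieces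
  have hαint : Integrable (α : ℝ → ℂ) := integrable_of_Lp_two_of_support α hα0
  have hI1 : Integrable (fun ξ ↦ -(c' / w') * (starRingEnd ℂ) ((α : ℝ → ℂ) ξ)) :=
    integrable_mul_conj_of_norm (u := fun _ ↦ -(c' / w')) (v := (α : ℝ → ℂ))
      (hαint.const_mul _) aestronglyMeasurable_const (Lp.aestronglyMeasurable α)
  have hI2 : Integrable (fun ξ ↦ p ξ * (starRingEnd ℂ) ((α : ℝ → ℂ) ξ)) :=
    integrable_mul_conj_of_norm (hpL.integrable_mul (Lp.memLp α)) hpL.1 (Lp.aestronglyMeasurable α)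
  rw [integral_congr_ae hpt, integral_add hI1 (hI2.const_mul A), integral_const_mul, integral_const_mul,
    integral_conj]



/-! #### R6. `Q_w f₀ ∈ L²` on the critical line and its duality identity -/

/-- **The two analytic inputs of the critical line.** Let `f ∈ L²` with an even representative
`f₀ = c` on `[−a,a]`, `g₀ = c'` on `[−a,a]` an even representative of `𝓕f`, and `w` with `Re w = ½`
such that (i) `‖f̂₀(s)‖ ≤ M‖s − w‖` for `s` in the strip near `w` (first-order vanishing of the
continuation `G_f` at `w`) and (ii) `‖A(w')‖ ≤ M'‖w' − w‖` for `Re w' < ½` near `w`, where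
`A(w') = c'a^{w'}/w' + ∫_a^∞ η^{w'−1} g₀` (first-order vanishing of `G_{𝓕f}` at `1 − w`). Then the
twisted Cesàro average `Q_w f₀ = ∫₀¹ v^{−w} f₀(v·) dv` is in `L²` — it is the `L²`-limit of
`Q_{w−δ} f₀`, `δ ↓ 0`, by the Mellin–Plancherel Cauchy estimate `integral_norm_sq_cesaro_sub_le` — and
its class satisfies `⟨𝓕⁻¹α, Q_w f⟩ = −(c'/w)·conj(∫α)` for every `α ∈ L²` vanishing off `[−a,a]`.
[cite: Burnol2004b, Prop. 4.3 (arXiv:math/0203120v7 p. 8, TeX l.711–731)] -/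
theorem memLp_cesaro_critical {a : ℝ} (ha : 0 < a) (f : Lp ℂ 2 (volume : Measure ℝ))
    {f₀ : ℝ → ℂ} (hf₀m : Measurable f₀) (hff₀ : (f : ℝ → ℂ) =ᵐ[volume] f₀)
    (hf₀e : ∀ x, f₀ (-x) = f₀ x) {c : ℂ} (hf₀c : ∀ x, |x| ≤ a → f₀ x = c)
    {g₀ : ℝ → ℂ} (hg₀m : Measurable g₀)
    (hgg₀ : ((𝓕 f : Lp ℂ 2 (volume : Measure ℝ)) : ℝ → ℂ) =ᵐ[volume] g₀)
    (hg₀e : ∀ x, g₀ (-x) = g₀ x) {c' : ℂ} (hg₀c : ∀ x, |x| ≤ a → g₀ x = c')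
    {w : ℂ} (hw : w.re = 1 / 2) {M r : ℝ} (hM : 0 ≤ M) (hr : 0 < r)
    (hF : ∀ s : ℂ, 1 / 2 < s.re → s.re < 1 → ‖s - w‖ < r → ‖rightMellin f₀ s‖ ≤ M * ‖s - w‖)
    {M' r' : ℝ} (hM' : 0 ≤ M') (hr' : 0 < r')
    (hA : ∀ w' : ℂ, w'.re < 1 / 2 → ‖w' - w‖ < r' →
      ‖c' * (a : ℂ) ^ w' / w' + ∫ η in Ioi a, (η : ℂ) ^ (w' - 1) * g₀ η‖ ≤ M' * ‖w' - w‖) :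
    ∃ hQ : MemLp (fun t : ℝ ↦ ∫ v in Ioo (0 : ℝ) 1, (v : ℂ) ^ (-w) * f₀ (v * t)) 2 volume,
      ∀ α : Lp ℂ 2 (volume : Measure ℝ), (∀ᵐ ξ : ℝ, ξ ∉ Icc (-a) a → (α : ℝ → ℂ) ξ = 0) →
        ⟪(𝓕⁻ α : Lp ℂ 2 (volume : Measure ℝ)), hQ.toLp _⟫_ℂ =
          -(c' / w) * (starRingEnd ℂ) (∫ ξ, (α : ℝ → ℂ) ξ) := by
  have hf₀L : MemLp f₀ 2 volume := (Lp.memLp f).ae_eq hff₀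
  have hw0 : w ≠ 0 := by
    intro h; rw [h, Complex.zero_re] at hw; norm_num at hw
  -- the sequence `δ k = (1/2)^(k+2)` and the exponents `w − δ k`
  set δ : ℕ → ℝ := fun k ↦ (1 / 2 : ℝ) ^ (k + 2) with hδ
  have hδpos : ∀ k, 0 < δ k := fun k ↦ by positivity
  have hδle : ∀ k, δ k ≤ 1 / 4 := by
    intro k
    have h1 : (1 / 2 : ℝ) ^ k ≤ 1 := pow_le_one₀ (by norm_num) (by norm_num)
    have h2 : δ k = (1 / 2 : ℝ) ^ k * (1 / 4) := by rw [hδ]; dsimp only; rw [pow_add]; norm_num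
    rw [h2]
    linarith
  have hδanti : ∀ {k l : ℕ}, k ≤ l → δ l ≤ δ k := fun {k l} hkl ↦
    pow_le_pow_of_le_one (by norm_num) (by norm_num) (by omega)
  have hδ0 : Tendsto δ atTop (𝓝 0) :=
    (tendsto_pow_atTop_nhds_zero_of_lt_one (by norm_num : (0 : ℝ) ≤ 1 / 2)
      (by norm_num : (1 / 2 : ℝ) < 1)).comp (tendsto_add_atTop_nat 2)
  have hwk : ∀ k, (w - δ k).re < 1 / 2 := fun k ↦ by
    rw [Complex.sub_re, Complex.ofReal_re, hw]; linarith [hδpos k]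
  have hwk0 : ∀ k, 0 < (w - δ k).re := fun k ↦ by
    rw [Complex.sub_re, Complex.ofReal_re, hw]; linarith [hδle k]
  -- the functions `Q k = Q_{w − δ k} f₀` and their classes `H k`
  set Q : ℕ → ℝ → ℂ := fun k t ↦ ∫ v in Ioo (0 : ℝ) 1, (v : ℂ) ^ (-(w - δ k)) * f₀ (v * t) with hQ
  have hQL : ∀ k, MemLp (Q k) 2 volume := fun k ↦
    memLp_twisted measurableSet_Ioo Ioo_subset_Ioi_self hf₀m hf₀L (integrableOn_schur_Ioo (hwk k))
  set H : ℕ → Lp ℂ 2 (volume : Measure ℝ) := fun k ↦ (hQL k).toLp (Q k) with hH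
  have hHco : ∀ k, (H k : ℝ → ℂ) =ᵐ[volume] Q k := fun k ↦ (hQL k).coeFn_toLp
  -- the Cauchy estimate `‖H k − H l‖² ≤ 2K δ k` (`k ≤ l`)
  set K : ℝ := (M ^ 2 * π + 2 * π * (∫ x in Ioi (0 : ℝ), ‖f₀ x‖ ^ 2 * (1 + x ^ (-(1 / 2 : ℝ)))) /
    r ^ 4) / (2 * π) with hK
  have hdist : ∀ {k l : ℕ}, k ≤ l → ‖H k - H l‖ ^ 2 ≤ 2 * K * δ k := by
    intro k l hkl
    obtain ⟨-, hle⟩ := integral_norm_sq_cesaro_sub_le ha hf₀m hf₀L hf₀e hf₀c hw hM hr hF (hδpos l)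
      (hδanti hkl) ((hδle k).trans (by norm_num))
    have hsub : H k - H l = ((hQL k).sub (hQL l)).toLp (Q k - Q l) :=
      (MemLp.toLp_sub (hQL k) (hQL l)).symm
    rw [hsub, norm_toLp_sq_eq]
    exact hle
  have hK0 : 0 ≤ 2 * K * δ 0 := le_trans (sq_nonneg _) (hdist le_rfl)
  have hK0' : 0 ≤ K := by
    have := hδpos 0
    nlinarith
  have hCauchy : CauchySeq H := by
    refine Metric.cauchySeq_iff'.2 fun ε hε ↦ ?_
    have hlim : Tendsto (fun k ↦ 2 * K * δ k) atTop (𝓝 0) := by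
      have := hδ0.const_mul (2 * K)
      rwa [mul_zero] at this
    obtain ⟨N, hN⟩ := (hlim.eventually (gt_mem_nhds (by positivity : (0 : ℝ) < ε ^ 2))).exists
    refine ⟨N, fun n hn ↦ ?_⟩
    rw [dist_eq_norm, ← norm_neg, neg_sub]
    have h2 : ‖H N - H n‖ ^ 2 < ε ^ 2 := (hdist hn).trans_lt hN
    exact lt_of_pow_lt_pow_left₀ 2 hε.le h2
  obtain ⟨h, hh⟩ := cauchySeq_tendsto_of_complete hCauchy
  -- identification of the limit with the pointwise `Q_w f₀`
  set Qw : ℝ → ℂ := fun t ↦ ∫ v in Ioo (0 : ℝ) 1, (v : ℂ) ^ (-w) * f₀ (v * t) with hQw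
  have hpt : ∀ t, Tendsto (fun k ↦ Q k t) atTop (𝓝 (Qw t)) := fun t ↦
    tendsto_cesaro_pointwise ha hf₀m hf₀L hf₀c hw hδpos hδ0 t
  have hae : (h : ℝ → ℂ) =ᵐ[volume] Qw := by
    obtain ⟨ns, hns, hlim⟩ := (tendstoInMeasure_of_tendsto_Lp hh).exists_seq_tendsto_ae
    have hall : ∀ᵐ x : ℝ, ∀ i, (H (ns i) : ℝ → ℂ) x = Q (ns i) x := ae_all_iff.2 fun i ↦ hHco (ns i)
    filter_upwards [hlim, hall] with x hx hx'
    have h1 : Tendsto (fun i ↦ Q (ns i) x) atTop (𝓝 ((h : ℝ → ℂ) x)) := hx.congr fun i ↦ hx' i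
    have h2 : Tendsto (fun i ↦ Q (ns i) x) atTop (𝓝 (Qw x)) := (hpt x).comp hns.tendsto_atTop
    exact tendsto_nhds_unique h1 h2
  have hQwL : MemLp Qw 2 volume := (Lp.memLp h).ae_eq hae
  have hQweq : hQwL.toLp Qw = h := Lp.ext (hQwL.coeFn_toLp.trans hae.symm)
  refine ⟨hQwL, fun α hα0 ↦ ?_⟩
  rw [hQweq]
  -- the duality identity for each `k`, and the limit
  set Aw : ℕ → ℂ := fun k ↦ c' * (a : ℂ) ^ (w - δ k) / (w - δ k) +
    ∫ η in Ioi a, (η : ℂ) ^ ((w - δ k) - 1) * g₀ η with hAw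
  set E : ℕ → ℂ := fun k ↦ Aw k * ∫ ξ, (Icc (-a) a).indicator
    (fun ξ : ℝ ↦ ((|ξ| : ℝ) : ℂ) ^ (-(w - δ k))) ξ * (starRingEnd ℂ) ((α : ℝ → ℂ) ξ) with hE
  have hk : ∀ k, ⟪(𝓕⁻ α : Lp ℂ 2 (volume : Measure ℝ)), H k⟫_ℂ =
      -(c' / (w - δ k)) * (starRingEnd ℂ) (∫ ξ, (α : ℝ → ℂ) ξ) + E k := fun k ↦
    inner_fourierInv_cesaro_eq ha f hf₀m hff₀ hg₀m hgg₀ hg₀e hg₀c (hwk0 k) (hwk k) (H k) (hHco k)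
      α hα0
  -- `E k → 0`
  have hE0 : Tendsto E atTop (𝓝 0) := by
    have hEle : ∀ᶠ k in atTop, ‖E k‖ ≤ Real.sqrt (M' ^ 2 * ‖α‖ ^ 2 * max a 1 * δ k) := by
      have hev : ∀ᶠ k in atTop, δ k < r' := hδ0.eventually (gt_mem_nhds hr')
      filter_upwards [hev] with k hkr
      obtain ⟨hpL, hpn⟩ := memLp_absCpow_indicator ha (hwk0 k) (hwk k)
      have hnw : ‖(w - δ k) - w‖ = δ k := by
        rw [sub_sub_cancel_left, norm_neg, Complex.norm_real, Real.norm_eq_abs,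
          abs_of_pos (hδpos k)]
      have hAk : ‖Aw k‖ ≤ M' * δ k := by
        have := hA (w - δ k) (hwk k) (by rw [hnw]; exact hkr)
        rwa [hnw] at this
      have hPk : ‖hpL.toLp _‖ ^ 2 = a ^ (2 * δ k) / δ k := by
        rw [norm_toLp_sq_eq, hpn]
        congr 2
        · rw [Complex.sub_re, Complex.ofReal_re, hw]; ring
        · rw [Complex.sub_re, Complex.ofReal_re, hw]; ring
      have hI := norm_integral_mul_conj_le hpL α
      have hEk : ‖E k‖ ≤ M' * δ k * (‖hpL.toLp _‖ * ‖α‖) := by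
        rw [hE]
        dsimp only
        rw [norm_mul]
        exact mul_le_mul hAk hI (norm_nonneg _) (by positivity)
      have ha2 : a ^ (2 * δ k) ≤ max a 1 := by
        rcases le_or_gt 1 a with ha1 | ha1
        · calc a ^ (2 * δ k) ≤ a ^ (1 : ℝ) :=
              Real.rpow_le_rpow_of_exponent_le ha1 (by linarith [hδle k])
            _ = a := Real.rpow_one a
            _ ≤ max a 1 := le_max_left _ _
        · calc a ^ (2 * δ k) ≤ 1 :=
              Real.rpow_le_one ha.le ha1.le (by linarith [hδpos k])
            _ ≤ max a 1 := le_max_right _ _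
      have hsq : ‖E k‖ ^ 2 ≤ M' ^ 2 * ‖α‖ ^ 2 * max a 1 * δ k := by
        calc ‖E k‖ ^ 2 ≤ (M' * δ k * (‖hpL.toLp _‖ * ‖α‖)) ^ 2 :=
              pow_le_pow_left₀ (norm_nonneg _) hEk 2
          _ = M' ^ 2 * ‖α‖ ^ 2 * (‖hpL.toLp _‖ ^ 2 * δ k) * δ k := by ring
          _ = M' ^ 2 * ‖α‖ ^ 2 * a ^ (2 * δ k) * δ k := by
              rw [hPk, div_mul_cancel₀ _ (hδpos k).ne']
          _ ≤ M' ^ 2 * ‖α‖ ^ 2 * max a 1 * δ k := by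
              have : 0 ≤ M' ^ 2 * ‖α‖ ^ 2 * δ k := by positivity
              nlinarith
      calc ‖E k‖ = Real.sqrt (‖E k‖ ^ 2) := (Real.sqrt_sq (norm_nonneg _)).symm
        _ ≤ Real.sqrt (M' ^ 2 * ‖α‖ ^ 2 * max a 1 * δ k) := Real.sqrt_le_sqrt hsq
    have hlim : Tendsto (fun k ↦ Real.sqrt (M' ^ 2 * ‖α‖ ^ 2 * max a 1 * δ k)) atTop (𝓝 0) := by
      have := (hδ0.const_mul (M' ^ 2 * ‖α‖ ^ 2 * max a 1)).sqrt
      rwa [mul_zero, Real.sqrt_zero] at this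
    exact squeeze_zero_norm' hEle hlim
  -- the limit of the main term
  have hmain : Tendsto (fun k ↦ -(c' / (w - δ k)) * (starRingEnd ℂ) (∫ ξ, (α : ℝ → ℂ) ξ)) atTop
      (𝓝 (-(c' / w) * (starRingEnd ℂ) (∫ ξ, (α : ℝ → ℂ) ξ))) := by
    have hδC : Tendsto (fun k ↦ ((δ k : ℝ) : ℂ)) atTop (𝓝 0) := by
      have := (Complex.continuous_ofReal.tendsto 0).comp hδ0
      rwa [Function.comp_def, Complex.ofReal_zero] at this
    have hwlim : Tendsto (fun k ↦ w - (δ k : ℂ)) atTop (𝓝 w) := by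
      have := (tendsto_const_nhds (x := w)).sub hδC
      rwa [sub_zero] at this
    exact ((tendsto_const_nhds.div hwlim hw0).neg).mul_const _
  have hLHS : Tendsto (fun k ↦ ⟪(𝓕⁻ α : Lp ℂ 2 (volume : Measure ℝ)), H k⟫_ℂ) atTop
      (𝓝 ⟪(𝓕⁻ α : Lp ℂ 2 (volume : Measure ℝ)), h⟫_ℂ) :=
    Filter.Tendsto.inner tendsto_const_nhds hh
  have hRHS : Tendsto (fun k ↦ ⟪(𝓕⁻ α : Lp ℂ 2 (volume : Measure ℝ)), H k⟫_ℂ) atTop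
      (𝓝 (-(c' / w) * (starRingEnd ℂ) (∫ ξ, (α : ℝ → ℂ) ξ))) := by
    have := hmain.add hE0
    rw [add_zero] at this
    exact this.congr fun k ↦ (hk k).symm
  exact tendsto_nhds_unique hLHS hRHS



/-! #### R7. Prop. 4.3 on the critical line -/

/-- From differentiability at a zero to a local linear bound. [folklore] -/
private theorem exists_linear_bound_of_differentiableAt {G : ℂ → ℂ} {z₀ : ℂ} (hG : DifferentiableAt ℂ G z₀)
    (hz : G z₀ = 0) : ∃ M r : ℝ, 0 ≤ M ∧ 0 < r ∧ ∀ z : ℂ, ‖z - z₀‖ < r → ‖G z‖ ≤ M * ‖z - z₀‖ := by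
  obtain ⟨C, hC, hCw⟩ := hG.isBigO_sub.exists_pos
  obtain ⟨r, hr, hball⟩ := Metric.eventually_nhds_iff.1 hCw.bound
  refine ⟨C, r, hC.le, hr, fun z hz' ↦ ?_⟩
  have h := hball (by rwa [dist_eq_norm])
  rwa [hz, sub_zero] at h

/-- **Prop. 4.3 on the critical line, with the constants.** For `f ∈ L_a` with representatives
`f₀ = c`, `g₀ = c'` (of `𝓕f`) on `[−a,a]`, `Re w = ½` and `G_f(w) = 0`: the class `h` of the twisted
Cesàro average `Q_w f₀` is even, equals `c/(1−w)` on `(0,a)`, has `𝓕h = −c'/w` on `(0,a)`, and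
`ĥ(s) = f̂(s)/(s−w)` on the strip. The two analytic inputs of `memLp_cesaro_critical` are supplied by
the holomorphy of `G_f` at `w` and of `G_{𝓕f}` at `1 − w` (where it vanishes by the functional equation
of Prop. 2.2). [cite: Burnol2004b, Prop. 4.3 and Prop. 2.2 (arXiv:math/0203120v7 pp. 5, 8; TeX l.460–469, 711–731)] -/
theorem exists_cesaro_twisted_critical {a : ℝ} (ha : 0 < a) {f : Lp ℂ 2 (volume : Measure ℝ)}
    (hf : f ∈ sonineL a) {f₀ : ℝ → ℂ} (hf₀m : Measurable f₀) (hff₀ : (f : ℝ → ℂ) =ᵐ[volume] f₀)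
    (hf₀e : ∀ x, f₀ (-x) = f₀ x) {c : ℂ} (hf₀c : ∀ x, |x| ≤ a → f₀ x = c)
    {g₀ : ℝ → ℂ} (hg₀m : Measurable g₀)
    (hgg₀ : ((𝓕 f : Lp ℂ 2 (volume : Measure ℝ)) : ℝ → ℂ) =ᵐ[volume] g₀)
    (hg₀e : ∀ x, g₀ (-x) = g₀ x) {c' : ℂ} (hg₀c : ∀ x, |x| ≤ a → g₀ x = c')
    {w : ℂ} (hw : w.re = 1 / 2) (hG : rightMellinExt f w = 0) :
    ∃ h : Lp ℂ 2 (volume : Measure ℝ), h ∈ evenL2 ∧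
      (∀ᵐ x : ℝ, x ∈ Ioo 0 a → (h : ℝ → ℂ) x = c / (1 - w)) ∧
      (∀ᵐ x : ℝ, x ∈ Ioo 0 a → ((𝓕 h : Lp ℂ 2 (volume : Measure ℝ)) : ℝ → ℂ) x = -(c' / w)) ∧
      ∀ s : ℂ, 1 / 2 < s.re → s.re < 1 →
        rightMellin (h : ℝ → ℂ) s = rightMellin (f : ℝ → ℂ) s / (s - w) := by
  have hw1 : w ≠ 1 := by
    intro h; rw [h, Complex.one_re] at hw; norm_num at hw
  have hw0 : w ≠ 0 := by
    intro h; rw [h, Complex.zero_re] at hw; norm_num at hw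
  have hopen : IsOpen {s : ℂ | s ≠ 1} := isOpen_ne
  -- (i) the local bound at `w` from the holomorphy of `G_f`
  obtain ⟨hGd, hGeq⟩ := hasRightMellinContinuation_rightMellinExt_of_mem_sonineL ha hf
  have hGw : DifferentiableAt ℂ (rightMellinExt f) w :=
    (hGd w hw1).differentiableAt (hopen.mem_nhds hw1)
  obtain ⟨M, r, hM, hr, hMr⟩ := exists_linear_bound_of_differentiableAt hGw hG
  have hF : ∀ s : ℂ, 1 / 2 < s.re → s.re < 1 → ‖s - w‖ < r →
      ‖rightMellin f₀ s‖ ≤ M * ‖s - w‖ := by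
    intro s hs hs1 hsw
    rw [← rightMellin_congr_ae hff₀, ← hGeq s hs hs1]
    exact hMr s hsw
  -- (ii) the rate at `1 − w` from the holomorphy of `G_{𝓕f}` and the functional equation
  have hFL : (𝓕 f : Lp ℂ 2 (volume : Measure ℝ)) ∈ sonineL a := fourier_mem_sonineL hf
  obtain ⟨hHd, -⟩ := hasRightMellinContinuation_rightMellinExt_of_mem_sonineL ha hFL
  have h1w1 : 1 - w ≠ 1 := by
    intro h; apply hw0; linear_combination -h
  have hHw : DifferentiableAt ℂ (rightMellinExt (𝓕 f : Lp ℂ 2 (volume : Measure ℝ))) (1 - w) :=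
    (hHd (1 - w) h1w1).differentiableAt (hopen.mem_nhds h1w1)
  have hH0 : rightMellinExt (𝓕 f : Lp ℂ 2 (volume : Measure ℝ)) (1 - w) = 0 := by
    have hΓ : Gammaℝ (1 - w) ≠ 0 :=
      Gammaℝ_ne_zero_of_re_pos (by rw [Complex.sub_re, Complex.one_re, hw]; norm_num)
    have hFE := SonineLContinuation.rightMellinExt_functionalEquation_of_mem_sonineL ha hf (1 - w)
      (fun n h ↦ by
        have := congrArg Complex.re h
        simp [hw] at this; linarith)
      (fun n h ↦ by
        have := congrArg Complex.re h
        simp [hw] at this; linarith)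
    rw [sub_sub_cancel, hG, mul_zero] at hFE
    exact (mul_eq_zero.1 hFE).resolve_left hΓ
  obtain ⟨M', r₁, hM', hr₁, hMr'⟩ := exists_linear_bound_of_differentiableAt hHw hH0
  -- shrink the radius so that `Re w' > ¼` (hence `w' ≠ 0`) on the ball
  set r' : ℝ := min r₁ (1 / 4) with hr'
  have hr'pos : 0 < r' := lt_min hr₁ (by norm_num)
  have hA : ∀ w' : ℂ, w'.re < 1 / 2 → ‖w' - w‖ < r' →
      ‖c' * (a : ℂ) ^ w' / w' + ∫ η in Ioi a, (η : ℂ) ^ (w' - 1) * g₀ η‖ ≤ M' * ‖w' - w‖ := by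
    intro w' hw' hww
    have hre : |w'.re - w.re| < 1 / 4 := by
      calc |w'.re - w.re| = |(w' - w).re| := by rw [Complex.sub_re]
        _ ≤ ‖w' - w‖ := Complex.abs_re_le_norm _
        _ < r' := hww
        _ ≤ 1 / 4 := min_le_right _ _
    have hw'0 : w' ≠ 0 := by
      intro h
      rw [h, Complex.zero_re, hw, zero_sub, abs_neg] at hre
      norm_num [abs_of_pos] at hre
    have hs : 1 / 2 < (1 - w').re := by rw [Complex.sub_re, Complex.one_re]; linarith
    have hs1 : 1 - w' ≠ 1 := by intro h; apply hw'0; linear_combination -h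
    have hval := rightMellinExt_eq_of_rep ha hFL hgg₀ hg₀c hs hs1
    rw [sub_sub_cancel, show (-(1 - w') : ℂ) = w' - 1 by ring] at hval
    have hdist : ‖(1 - w') - (1 - w)‖ = ‖w' - w‖ := by
      rw [show (1 - w') - (1 - w) = -(w' - w) by ring, norm_neg]
    have h := hMr' (1 - w') (by rw [hdist]; exact hww.trans_le (min_le_left _ _))
    rw [hval, hdist] at h
    exact h
  -- the two inputs give `Q_w f₀ ∈ L²` with the duality identity; then §Q
  obtain ⟨hQ, hdual⟩ := memLp_cesaro_critical ha f hf₀m hff₀ hf₀e hf₀c hg₀m hgg₀ hg₀e hg₀c hw hM hr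
    hF hM' hr'pos hA
  obtain ⟨h, hhe, hh0, hhF, hhM⟩ := exists_cesaro_twisted_of_memLp ha f hf₀m hff₀ hf₀e hf₀c
    (by rw [hw]; norm_num) hQ hdual
  exact ⟨h, hhe, hh0, hhF, fun s hs hs1 ↦ hhM s hs hs1 (by rw [hw]; exact hs)⟩

/-- **Prop. 4.3, `L_a`, critical line `Re w = ½`.** [cite: Burnol2004b, Prop. 4.3 (arXiv:math/0203120v7 p. 8, TeX l.711–731)] -/
theorem sonineL_div_of_re_eq_half {a : ℝ} (ha : 0 < a) {f : Lp ℂ 2 (volume : Measure ℝ)}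
    (hf : f ∈ sonineL a) {w : ℂ} (hw : w.re = 1 / 2) (hG : rightMellinExt f w = 0) :
    ∃ h ∈ sonineL a, ∀ s : ℂ, 1 / 2 < s.re → s.re < 1 → s ≠ w →
      rightMellin (h : ℝ → ℂ) s = rightMellin (f : ℝ → ℂ) s / (s - w) := by
  obtain ⟨f₀, g₀, c, c', hf₀m, hff₀, hf₀e, hf₀c, -, hg₀m, hgg₀, hg₀e, hg₀c, -, -, -⟩ :=
    exists_reps_of_mem_sonineL hf
  obtain ⟨h, hhe, hh0, hhF, hhM⟩ := exists_cesaro_twisted_critical ha hf hf₀m hff₀ hf₀e hf₀c hg₀m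
    hgg₀ hg₀e hg₀c hw hG
  exact ⟨h, ⟨hhe, ⟨_, hh0⟩, ⟨_, hhF⟩⟩, fun s hs hs1 _ ↦ hhM s hs hs1⟩

/-- **Prop. 4.3, `K_a`, critical line `Re w = ½`** (the hypothesis `𝒢_f(w) = 0` is `G_f(w) = 0` since
`Γ_ℝ(w) ≠ 0`; the witness of the `L_a` construction with `c = c' = 0` lies in `K_a`).
[cite: Burnol2004b, Prop. 4.3 and Thm. 2.1 (arXiv:math/0203120v7 pp. 5, 8; TeX l.437–443, 711–731)] -/
theorem sonineK_div_of_re_eq_half {a : ℝ} (ha : 0 < a) {f : Lp ℂ 2 (volume : Measure ℝ)}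
    (hf : f ∈ sonineK a) {w : ℂ} (hw : w.re = 1 / 2) (hG : completedMellinEntire (f : ℝ → ℂ) w = 0) :
    ∃ h ∈ sonineK a, ∀ s : ℂ, 1 / 2 < s.re → s.re < 1 → s ≠ w →
      rightMellin (h : ℝ → ℂ) s = rightMellin (f : ℝ → ℂ) s / (s - w) := by
  have hfL : f ∈ sonineL a := sonineK_subset_sonineL a hf
  obtain ⟨hfe, hfz, hFz⟩ := hf
  have hw1 : w ≠ 1 := by
    intro h; rw [h, Complex.one_re] at hw; norm_num at hw
  -- `G_f(w) = 0` from `𝒢_f(w) = 0`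
  have hG' : rightMellinExt f w = 0 := by
    obtain ⟨G, hGd, -, hGeq⟩ := (Burnol2004b_thm2_1_holds a ha).1 f ⟨hfe, hfz, hFz⟩
    have hΓ : Gammaℝ w ≠ 0 := Gammaℝ_ne_zero_of_re_pos (by rw [hw]; norm_num)
    have h1 := BurnolSonineHardy.completedMellinEntire_eq_Gammaℝ_mul ha ⟨hfe, hfz, hFz⟩ hGd hGeq hΓ
    rw [hG] at h1
    have hGw : G w = 0 := (mul_eq_zero.1 h1.symm).resolve_left hΓ
    have hcont : HasRightMellinContinuation f G := ⟨hGd.differentiableOn, hGeq⟩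
    rw [(hasRightMellinContinuation_rightMellinExt ⟨G, hcont⟩).eqOn hcont hw1]
    exact hGw
  obtain ⟨f₀, hf₀m, hff₀, hf₀e, hf₀c, -⟩ := exists_even_rep_const hfe (c := 0) hfz
  obtain ⟨g₀, hg₀m, hgg₀, hg₀e, hg₀c, -⟩ :=
    exists_even_rep_const (fourier_mem_evenL2 hfe) (c := 0) hFz
  obtain ⟨h, hhe, hh0, hhF, hhM⟩ := exists_cesaro_twisted_critical ha hfL hf₀m hff₀ hf₀e hf₀c hg₀m
    hgg₀ hg₀e hg₀c hw hG'
  refine ⟨h, ⟨hhe, ?_, ?_⟩, fun s hs hs1 _ ↦ hhM s hs hs1⟩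
  · filter_upwards [hh0] with x hx hxI
    rw [hx hxI, zero_div]
  · filter_upwards [hhF] with x hx hxI
    rw [hx hxI, zero_div, neg_zero]

end SonineDivision

/-! ### P. Reduction of `Burnol2004b_prop4_3R` to the critical line -/

/-- **Prop. 4.3 reduced to the critical line**: given the two clauses for `Re w = ½` (the only case not
proved in this file — there neither twisted average is `L²`-bounded), the typed fact
`Burnol2004b_prop4_3R` follows from `SonineDivision.sonineL_div_of_re_ne_half'` and
`SonineDivision.sonineK_div_of_re_ne_half`. (A reduction, not a discharge: the critical-line clauses are
explicit hypotheses.) [cite: Burnol2004b, Prop. 4.3 (arXiv:math/0203120v7 p. 8, TeX l.711–731)] -/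
theorem Burnol2004b_prop4_3R_of_critical_line
    (hL : ∀ a : ℝ, 0 < a → ∀ f ∈ sonineL a, ∀ w : ℂ, w.re = 1 / 2 →
      (∀ n : ℕ, w ≠ -2 * ((n : ℂ) + 1)) → rightMellinExt f w = 0 →
      ∃ h ∈ sonineL a, ∀ s : ℂ, 1 / 2 < s.re → s.re < 1 → s ≠ w →
        rightMellin h s = rightMellin f s / (s - w))
    (hK : ∀ a : ℝ, 0 < a → ∀ f ∈ sonineK a, ∀ w : ℂ, w.re = 1 / 2 →
      completedMellinEntire f w = 0 →
      ∃ h ∈ sonineK a, ∀ s : ℂ, 1 / 2 < s.re → s.re < 1 → s ≠ w →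
        rightMellin h s = rightMellin f s / (s - w)) :
    Burnol2004b_prop4_3R := by
  intro a ha
  refine ⟨fun f hf w hw1 hwn hG ↦ ?_, fun f hf w hG ↦ ?_⟩
  · by_cases hw : w.re = 1 / 2
    · exact hL a ha f hf w hw hwn hG
    · exact SonineDivision.sonineL_div_of_re_ne_half' ha hf hw hw1 hwn hG
  · by_cases hw : w.re = 1 / 2
    · exact hK a ha f hf w hw hG
    · exact SonineDivision.sonineK_div_of_re_ne_half ha hf hw hG

/-! ### S. Discharge of `Burnol2004b_prop4_3R` -/

/-- **Discharge of the named fact `Burnol2004b_prop4_3R`** (Burnol, JTNB 16 (2004), Prop. 4.3, the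
repaired record of `Burnol2004b_prop4_3`): division by `s − w` in `L̂_a` and in `K̂_a` at a zero `w` of
the (completed) Mellin transform — off the critical line by the bounded twisted Cesàro / tail averages
(sections K–O), on the critical line by the `L²`-limit of the twisted Cesàro averages (section R).
[cite: Burnol2004b, Prop. 4.3 (arXiv:math/0203120v7 p. 8, TeX l.711–731)] -/
theorem Burnol2004b_prop4_3R_holds : Burnol2004b_prop4_3R :=
  Burnol2004b_prop4_3R_of_critical_line
    (fun _ ha _ hf _ hw _ hG ↦ SonineDivision.sonineL_div_of_re_eq_half ha hf hw hG)
    (fun _ ha _ hf _ hw hG ↦ SonineDivision.sonineK_div_of_re_eq_half ha hf hw hG)
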